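/-
Copyright: cell `langlands-arthur-audit` (papers/Langlands/langlands-arthur-audit), unit `pub-arthur-down-g23`
(downstream tracer, gen 23).  Fifth file of the exact-support certificates of the downstream register:
`DownstreamSupport.lean` (sections 1–20, 188 350 bytes), `DownstreamSupport2.lean` (sections 21–29, 159 484 bytes),
`DownstreamSupport3.lean` (sections 30–35, 170 241 bytes) and `DownstreamSupport4.lean` (sections 36–41; v1.5 p205913,
176 099 bytes = 88 % of the gate's 200 000-byte file cap) are full or nearly so, so the certificates continue here,
APPEND-ONLY in the same conventions and the same namespace `…Arthur2013.Downstream.Support`; v1 = section 42, the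
supports of the thirty-ninth tranche (`Downstream9.lean` v2, same unit: the G_2 line, II — the auxiliary node `StabOrdG2`
(Arthur's stable trace formula for the split group G_2), E16 Du – Peng – Wan 2026, C199 Harris – Khare – Thorne 2023,
C200 Cauchi – Lemma – Rodrigues Jacinto 2025); v1.1 (same unit, APPEND-ONLY) = section 43, the supports of the
fortieth tranche (`Downstream9.lean` v3: the wavefront line — B60 Jiang – Liu – Zhang 2025 with the node `JLZvoganHyp`,
B56 Chen – Jiang – Liu – Zhang 2024, B41 Jiang – Liu – Luo – Ma – Zhang 2026, B26 Hazeltine – Liu – Lo – Shahidi 2024/26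
(nodes `HLLSHyp`, `HLLSHypQS`; statements `HLLSequiv`, `HLLSequivQS`), B14 Atobe – Ciubotaru 2026 with the node
`AGIKMSaubertDual`); v1.2 (unit `pub-arthur-down-g24`, APPEND-ONLY plus one import line) = section 44, the
supports of the forty-first tranche (`Downstream10.lean` v1, the new tenth register file, imported here: the
wavefront line, II — B106 D. Jiang – B. Liu 2025 typed twice (`JiangLiuWF` with KMSW's starred theorems in full,
`JiangLiuWFqs`), B107 Liu – Shahidi 2026 (`LiuShahidiJiang`), B31 Hazeltine – Liu – Lo – Zhang 2025 (`HLLZclosure`, over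
rows B2, B5, B42, B101), B17 Liu – Lo 2024 (`LiuLoWeak`, over B31)); v1.3 (same unit, APPEND-ONLY) = section 45, the
supports of the forty-second tranche (`Downstream10.lean` v2: the unipotent clauses — B26 §11 `HLLSunipQS` over
tranche 40's `HLLSHypQS` / `HLLSequivQS` and B31, B17's « in particular » clauses `LiuLoWeakIP`, B107's Theorem 1.14
`LiuShahidi114`); v1.4 (same unit, APPEND-ONLY) = section 46, the supports of the forty-third tranche (`Downstream10.lean`
v3: the Hecke-algebra line — B28 Aubert – Moussaoui – Solleveld 2022 `AMSHecke` / `AMScoincide`, B40 Solleveld 2020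
`SolleveldQS`, B69 Solleveld 2023/26 `SolleveldStd`); v1.5 (unit `pub-arthur-down-g25`, APPEND-ONLY) = section 47, the
supports of the forty-fourth tranche (`Downstream10.lean` v4: the Hecke-algebra line, II — V. Heiermann: B10 Math. Z. 287
(2017) `HeiermannDecomp`, B47 manuscripta math. 150 (2016) `HeiermannStd`); v1.6 (same unit, APPEND-ONLY plus one import
line) = section 48, the supports of the forty-fifth tranche (`Downstream11.lean` v1, the new eleventh register file,
imported here: the Mœglin conduits, I — B75 C. Mœglin 2011 typed with its node `MoeglinDSHyp` / `MoeglinDSHypQS` and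
statements `MoeglinMult1` / `MoeglinMult1qs` / `MoeglinMp`, E43 C. Mœglin 2007 `MoeglinUnitaryDS`, the re-issued
edges of B10 / B47 / B28); v1.7 (same unit, APPEND-ONLY) = section 49, the supports of the forty-sixth tranche
(`Downstream11.lean` v2: the A6 split `ChenZouO` ⇐ book / `ChenZouU` ⇐ Mok, A10 `ChenZouLLCU` ⇐ Mok, the RE-BASED
readings of A12 Peng (Case O) and C165 Graham (Case U), C158's premise-faithful re-issue); v1.8 (same unit, APPEND-ONLY) =
section 50, the supports of the forty-seventh tranche (`Downstream11.lean` v3: the Mœglin conduits, II — `ArthurClay30`,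
E42 `MoeglinDS2007` re-graded against E43, `MoeglinHypGen` / `MoeglinHypGenSOU`, B71, B72); v1.9 (unit
`pub-arthur-down-g26`, APPEND-ONLY) = section 51, the supports of the forty-eighth tranche (`Downstream11.lean` v4: the
Mœglin conduits, III — B70 `MoeglinElementary` / `MoeglinElemHyp`, B73 `MoeglinHolomorphy`, B74 `MoeglinComparaison` /
`MoeglinLdsConv`; `moeglinSeries_needs_node`).  Nothing of the first four files is redeclared or changed.
-/
import HarnessLib
import Literature.NumberTheory.Automorphic.Arthur2013.DownstreamSupport4
import Literature.NumberTheory.Automorphic.Arthur2013.Downstream10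
import Literature.NumberTheory.Automorphic.Arthur2013.Downstream11

/-!
# Downstream of Arthur (2013): exact leaf support of the downstream register, fifth file (sections ≥ 42)

**Source reproduced.**  Nothing beyond what `Downstream.lean` … `Downstream9.lean` transcribe (the downstream
authors' own sentences, cited there chunk by chunk) and what the three leaf-support modules certify
(`Arthur2013/LeafSupport.lean`, `Mok2015/LeafSupport.lean`, `KMSW2014/LeafSupport.lean`: for every leaf a
kernel-checked countermodel of the DAG as typed).  As in the first four files: a CANONICAL READING assigns to each
typed downstream statement the conjunction of DAG outputs its edge receives, the tranche's edges are shown to hold in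
that reading for arbitrary node assignments, and the countermodels then give the « only if » half of each support —
which leaves are load-bearing for which downstream theorem, in the register AS TYPED (a statement about the cell's
transcription, not about the mathematics).  [cite: Arthur2013, §1.5 with AGIKMS2024 l.380-382 (the conditional
reading whose supports are certified)]

**v1 (section 42).**  The thirty-ninth tranche (`Downstream9.lean` v2) types the G_2 line, II: the auxiliary node
`StabOrdG2` (Arthur's stabilisation of the standard trace formula for split G_2, as consumed by E16) ⇐ ν.FL ∧
ν.WFL_split ∧ ν.WFL_general ∧ ν.STF_Arthur (the premise shape of `Nodes.E_StabOrd`, `E_StabInner`, `E_StabOrdSim`); E16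
`DuPengWanG2` (Du – Peng – Wan 2026: the triality twisted trace formula for PGSO(8) and a coarse classification of the
automorphic representations of G_2) ⇐ book ∧ the tranche-38 node `StabTwTriality` ∧ `StabOrdG2`; C199
`HarrisKhareThorneG2` (Harris – Khare – Thorne 2023: a Langlands parameterization of the generic supercuspidal
representations of p-adic G_2) ⇐ A14; C200 `CLRJSteinberg` (Cauchi – Lemma – Rodrigues Jacinto 2025: the Steinberg-case
statements — G_2-valued Galois representations, cycle classes on Siegel sixfolds) ⇐ C10 — premises from `Downstream.lean`
(C10: `canon`), `Downstream3.lean` (A14: `canon₁₅`), `Downstream9.lean` v1 (the triality node: `canon₃₈`) and the tranche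
itself; no Mok, no KMSW.  Canonical reading (`canon₃₉`): each field := the conjunction of the canonical values of its
premises (book := ∀ N, ν.Everything N; the triality node := its seven leaves; the G_2 node := its four leaves; A14 and
C10 := the book's outputs, their values in `canon₁₅` and `canon`).  Certified here: all four edges hold in that reading
for arbitrary ν, μ, κ (`canon_implications₃₉`); all four fields hold at the top (`thirtyninth_holds_top`, through the
tranche's `g2Line39_of_inputs` and `stabOrdG2_of_leaves`); THE G_2 NODE'S EXACT SUPPORT: in the book countermodel
removing the leaf l, the node holds if and only if l is none of FL, WFL_split, WFL_general, STF_Arthur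
(`stabOrdG2_cm_iff`) — so, as typed, the standard-side stabilisation Du – Peng – Wan use « under the weighted fundamental
lemma (established by Chaudouard–Laumon) » is conditional in 2026 on exactly one unwritten leaf, the general (non-split)
weighted fundamental lemma; BOOK side: in each of the 24 book countermodels the three STATEMENT fields (E16, C199,
C200) FAIL — every book leaf is load-bearing, as typed, for the coarse classification of G_2, for the Langlands
parameterization of generic supercuspidals of G_2 (through [Xu]) and for the Steinberg-case G_2-valued Galois
representations (through [KretShin]) (`thirtyninth_book_cm`); MOK and KMSW sides: in every Mok countermodel and every
KMSW countermodel all four fields HOLD outright — no leaf of Mok or KMSW is in any support (`thirtyninth_mok_cm`,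
`thirtyninth_kmsw_cm`); ROUTES AS TYPED, in the all-ones assignment of the three DAGs: a joint reading of tranches 38
and 39 denying the TRIALITY node (tranche 38 by `canon₃₈noS` of section 41 — granting `E_StabTwTriality` the whole
thirty-eighth edge system holds while that edge fails —, tranche 39 by `canon₃₉noS38`, in which EVERY thirty-ninth edge
holds) falsifies E16 and nothing else of tranche 39 (`duPengWanG2_needs_node38`: « Moeglin and Waldspurger [MW2,MW3]
established the two identities »); a reading denying the G_2 node — granting `E_StabOrdG2` the whole thirty-ninth edge
system holds while that edge fails at the top, its four leaf premises holding there — falsifies E16 and nothing else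
(`duPengWanG2_needs_nodeG2`: « Arthur [A6] proved … that $S(f)$ is stable »).  So, as typed: support(DuPengWanG2) =
support(HarrisKhareThorneG2) = support(CLRJSteinberg) = the book's 24 leaves (the two stabilisations of E16, the
similitude stabilisation behind C10 and the book behind A14 adding only second occurrences of book leaves), no Mok
leaf, no KMSW leaf — against E16's single explicit hypothesis (the twisted weighted fundamental lemma, for its Theorem
6.1) and the silence of C199 and C200.  Not separately certified: route readings denying A14 or C10 (no denied readings
of `canon₁₅` / `canon` exist; their supports are the book's, sections 1–4 and 17).

**v1.1 (section 43).**  The fortieth tranche (`Downstream9.lean` v3) types the wavefront line: B60 `JLZwavefront`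
(Jiang – Liu – Zhang 2025: the arithmetic wavefront set of a representation with generic L-parameter is a well-defined
invariant; the wavefront-set statement for generic representations of quasi-split classical groups) ⇐ book ∧ Mok ∧
KMSW's proved scope ∧ the authors' own assumption node `JLZvoganHyp` (the Vogan LLC in the cases they call incomplete);
B56 `CJLZbranching` (Chen – Jiang – Liu – Zhang 2024: the first descent spectrum) ⇐ book ∧ Mok ∧ KMSW ∧ B60; B41
`JLLMZreciprocity` (Jiang – Liu – Luo – Ma – Zhang 2026: WF_des = WF_ari) ⇐ book ∧ Mok ∧ KMSW ∧ B60 ∧ B56; B26 (Hazeltine –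
Liu – Lo – Shahidi: equivalence theorems on the upper bound of wavefront sets, stated under an assumed local Langlands /
local A-packets theory) as `HLLSequiv` ⇐ the node `HLLSHyp` (no supplier) and `HLLSequivQS` ⇐ the node `HLLSHypQS` ⇐
book ∧ Mok; B14 `AtobeCiubotaruWF` (Atobe – Ciubotaru 2026: the wavefront sets of A-packets of split classical groups) ⇐
book ∧ the node `AGIKMSaubertDual` (no supplier).  Canonical reading (`canon₄₀`): the three supplier-less nodes :=
`True` (granted); each other field := the conjunction of the canonical values of its premises (book := ∀ N,
ν.Everything N; Mok := ∀ N, μ.Everything N; KMSW := ∀ N, κ.Scope N; B60, B56, `HLLSHypQS` := their own canonical values;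
granted nodes dropped).  Certified here: all seven edges hold in that reading for arbitrary ν, μ, κ
(`canon_implications₄₀`); every field holds at the top (`fortieth_holds_top`, through the tranche's
`wavefrontLine_of_inputs`); BOOK side: in each of the 24 book countermodels (Mok, KMSW at the all-ones assignment) B60,
B56, B41, `HLLSHypQS`, `HLLSequivQS` and B14 FAIL while `HLLSequiv` (over its granted node) holds — every book leaf is
load-bearing, as typed, for the arithmetic wavefront sets, the first descent spectrum, the reciprocity of wavefront sets,
the quasi-split instance of Hazeltine – Liu – Lo – Shahidi's theorems and the wavefront sets of A-packets of split
classical groups (`fortieth_book_cm`); MOK side: in each of Mok's 29 countermodels (book at the top, KMSW read without its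
import of Mok) B60, B56, B41, `HLLSHypQS`, `HLLSequivQS` FAIL and B14, `HLLSequiv` HOLD — every Mok leaf is load-bearing
for the three arithmetic-wavefront rows (unitary groups among the classical groups G_n) and for B26's quasi-split
instance, none for B14 (split SO / Sp only) (`fortieth_mok_cm`); KMSW side: in KMSW's countermodel for a leaf l ≠ MokMain
(book and Mok at the top) B60, B56, B41 hold if and only if `l.onlyFull` — exactly KMSW's PROVED-scope leaves are
load-bearing (pure inner forms of unitary groups, generic parameters), the sequels `KMS_A`, `KMS_B` and `AubertSS` are
not —, while `HLLSHypQS`, `HLLSequivQS`, B14 and `HLLSequiv` hold outright (`fortieth_kmsw_cm`); ROUTES AS TYPED, in the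
all-ones assignment of the three DAGs: a reading denying `JLZvoganHyp` (every fortieth edge holding) falsifies B60, B56,
B41 and nothing else (`arithmeticWavefront_needs_node`: the authors' « we may have to consider it as an assumption for
those incomplete cases » is load-bearing for the whole arithmetic-wavefront line, B56 and B41 inheriting it through
B60); a reading denying `HLLSHyp` falsifies `HLLSequiv` only (`hllsEquiv_needs_node`: as printed, B26's theorems rest on
no leaf of the three DAGs but on the assumed theory — the kernel displays the explicit-hypothesis style exactly); a
reading denying `AGIKMSaubertDual` falsifies B14 only (`atobeCiubotaruWF_needs_node`: « As explained in [AGIKMS], we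
have Π_ψ̂ = {π̂} » is load-bearing, a 2024–26 preprint statement outside the book's typed leaves).  So, as typed:
support(JLZwavefront) = support(CJLZbranching) = support(JLLMZreciprocity) = the book's 24 leaves ∪ Mok's 29 leaves ∪
KMSW's proved-scope leaves ∪ {`JLZvoganHyp`}; support(HLLSequivQS) = support(HLLSHypQS) = book ∪ Mok;
support(HLLSequiv) = {`HLLSHyp`}; support(AtobeCiubotaruWF) = book ∪ {`AGIKMSaubertDual`} — against no status sentence
on the monographs' inputs in B60, B56, B41, B14 and B26's explicit hypotheses.  Not separately certified: route readings
denying B60 or B56 with the node granted (their edges then fail at the top; the supports above already contain them).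

**v1.2 (section 44).**  The forty-first tranche (`Downstream10.lean` v1) types the wavefront line, II: B106
`JiangLiuWF` (D. Jiang – B. Liu, J. Eur. Math. Soc. 27 (2025): the upper bound for the wavefront sets of the
automorphic members of global Arthur packets, for quasi-split Sp_{2n}, SO_{2n+1}, O^α_{2n} AND for unitary groups
quasi-split or inner forms) ⇐ book ∧ Mok ∧ KMSW's starred theorems IN FULL (`κ.Full`), with its quasi-split instance
`JiangLiuWFqs` ⇐ book ∧ Mok; B107 `LiuShahidiJiang` (Liu – Shahidi 2026: theorems towards Jiang's conj. on the
wavefront sets of the members of local Arthur packets, each under the authors' own premise) ⇐ book; B31 `HLLZclosure`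
(Hazeltine – Liu – Lo – Zhang, Crelle 823 (2025): the closure ordering for Sp_{2n}, split SO_{2n+1}) ⇐ book ∧ B2 ∧ B5
∧ B42 ∧ B101; B17 `LiuLoWeak` (Liu – Lo, IMRN 2024: weak local Arthur packets of split classical groups) ⇐ book ∧ B31.
Canonical reading (`canon₄₁`, over the canonical readings `canon₂`, `canon₅`, `canon₂₆` of the rows it consumes):
each field := the conjunction of the canonical values of its premises (book := ∀ N, ν.Everything N; Mok := ∀ N,
μ.Everything N; KMSW in full := ∀ N, κ.Full N; B2, B5, B42, B101, B31 := their canonical values).  Certified here: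
all five edges hold in that reading for arbitrary ν, μ, κ (`canon_implications₄₁`); every field holds at the top
(`fortyfirst_holds_top`, through the tranche's `wavefrontLineII_of_inputs`, KMSW's sequels granted); BOOK side: in
each of the 24 book countermodels (Mok, KMSW at the all-ones assignment) ALL FIVE fields FAIL — every book leaf is
load-bearing, as typed, for the global upper bound (both readings), for the local theorems towards Jiang's conj., for
the closure ordering and for the weak packets (`fortyfirst_book_cm`); MOK side: in each of Mok's 29 countermodels
(book at the top, KMSW read without its import of Mok) B106's two readings FAIL and B107, B31, B17 HOLD — every Mok
leaf is load-bearing for the global upper bound (unitary groups among the G_n, « ( [Ar13], [Mok15], [KMSW14]) ») and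
for nothing else in the tranche (`fortyfirst_mok_cm`); KMSW side: in KMSW's countermodel for ANY leaf l ≠ MokMain
(book and Mok at the top) B106 AS STATED FAILS — every KMSW leaf, the unwritten sequels `KMS_A`, `KMS_B` and
`AubertSS` INCLUDED, is load-bearing for Theorem 1.3 with the inner forms of unitary groups (Theorem* 1.7.1 as stated)
— while the quasi-split instance and B107, B31, B17 hold outright (`fortyfirst_kmsw_cm`; the instance at l = KMS_A is
displayed separately as `jiangLiuWF_needs_sequel_A`).  So, as typed: support(JiangLiuWF) = the book's 24 leaves ∪
Mok's 29 leaves ∪ ALL of KMSW's leaves (sequels included); support(JiangLiuWFqs) = book ∪ Mok; support(LiuShahidiJiang)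
= support(HLLZclosure) = support(LiuLoWeak) = the book's 24 leaves — against no status sentence on the monographs'
inputs in any of the four texts (B31, B17: explicit hypotheses only for general G).  ROUTE, in the all-ones
assignment: a reading denying row B101 (Hazeltine – Liu – Lo 2022) while every forty-first-tranche edge holds
falsifies B31 and B17 and nothing else of the tranche (`closureLine_needs_B101`: B17's « [HLLZ22, Lemma 6.2, 6.4] »
and B31's « the operators developed in [HLL22] » are load-bearing as typed; the denied B101 is the reading
`canon₂₆noB101` of section 28).

**v1.3 (section 45).**  The forty-second tranche (`Downstream10.lean` v2) types the unipotent clauses: B26's §11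
`HLLSunipQS` (Hazeltine – Liu – Lo – Shahidi 2024/26, Thm 11.4 / Rem. 11.5 / Thm 11.7: the Jiang conj. for W_F-trivial local
Arthur parameters of Sp_{2n}(F), split SO_{2n+1}(F)) ⇐ tranche 40's node `HLLSHypQS` ∧ field `HLLSequivQS` ∧ row B31;
B17's « in particular » clauses `LiuLoWeakIP` ⇐ B17 ∧ `HLLSunipQS`; B107's Theorem 1.14 `LiuShahidi114` ⇐ book ∧ B107 ∧
`HLLSunipQS`.  Canonical reading (`canon₄₂`, over `canon₄₀` and `canon₄₁`): each field := the conjunction of the canonical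
values of its premises.  Certified here: the three edges hold in that reading (`canon_implications₄₂`); the three fields
hold at the top (`fortysecond_holds_top`, through `unipotentClauses_of_inputs`); BOOK side: all three FAIL in each of the
24 book countermodels (`fortysecond_book_cm`); MOK side: all three FAIL in each of Mok's 29 countermodels
(`fortysecond_mok_cm`) — AS TYPED, Mok's leaves enter the three symplectic / odd-orthogonal statements through the
quasi-split node `HLLSHypQS`, whose supplier sentence in B26 is the joint « proved in [Art13, Mok15] » (tranche 40,
`E_HLLSHypQS`); the register records this as a typing artefact of B26's uniform assumption (`DIVERGENCE.md` D-DN-g24-9),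
not as a use of Mok's theorems by B17 or B107; KMSW side: all three HOLD outright in KMSW's countermodels
(`fortysecond_kmsw_cm`).  ROUTE: over the denied B101 (`canon₂₆noB101` → `canon₄₁noB31` → `canon₄₂noB31`) every
forty-second edge holds and all three clauses are FALSE (`unipotentClauses_need_B31`: B26's « (Theorem 6.3) » = [HLLZ25,
Theorem 1.3] is load-bearing for the unipotent theorem and, through it, for B17's clause and B107's Theorem 1.14).  So, as
typed: support(HLLSunipQS) = support(LiuLoWeakIP) = support(LiuShahidi114) = the book's 24 leaves ∪ Mok's 29 leaves.

**v1.4 (section 46).**  The forty-third tranche (`Downstream10.lean` v3) types the Hecke-algebra line: B28's Theorems B, C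
with 3.7 `AMSHecke` ⇐ book ∧ Mok ∧ KMSW's proved scope `κ.Scope` ∧ row E41 (`Consumers14.MoeglinStable`) ∧ row A8-p
(`Consumers13.MRpadic`); B28's Theorem D = 4.11 `AMScoincide` ⇐ book ∧ A8-p ∧ `AMSHecke`; B40's Theorem 8.7 `SolleveldQS`
⇐ book ∧ Mok ∧ A7 (`Consumers.XuGSp`) ∧ A14 (`Consumers15.XuLifting`); B69's Theorem 7.4 (classical case) `SolleveldStd` ⇐
A8-p ∧ `AMSHecke`.  Canonical reading (`canon₄₃`, over `canon`, `canon₁₃`, `canon₁₄`, `canon₁₅` of the first support file):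
each field := the conjunction of the canonical values of its premises.  Certified here: the four edges hold in that
reading (`canon_implications₄₃`); the four fields hold at the top (`fortythird_holds_top`, through `heckeLine_of_inputs`);
BOOK side: all four FAIL in each of the 24 book countermodels (`fortythird_book_cm`); MOK side: all four FAIL in each of
Mok's 29 countermodels (`fortythird_mok_cm`: B28 and B40 quantify over the unitary groups — « [Mok] », « [KMSW] » —, B69
through B28); KMSW side (`fortythird_kmsw_cm`, KMSW's countermodels for a leaf other than `MokMain`): B40 HOLDS outright;
B28's two fields and B69 hold EXACTLY when the removed leaf is one of `AubertSS`, `KMS_A`, `KMS_B` — the proved-scope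
characterisation of section 17's `thirteenth_kmsw_cm` for A8-p, inherited (`κ.Scope` directly and through A8-p; neither
KMSW sequel in the support).  ROUTE: denying row A8-p with every forty-third-tranche edge valid (`c₁₃noA8p`,
`canon₄₃noA8p`) falsifies B28's two fields and B69 and leaves B40 true (`heckeLine_needs_A8p`): Mœglin – Renard 2018 —
hence the inner-form stabilisation `StabInner` and Taïbi's A3 behind it — is load-bearing, as typed, for the Hecke-algebra
LLC of the non-quasi-split classical groups.  So, as typed: support(AMSHecke) = support(AMScoincide) = support(SolleveldStd)
= the book's 24 leaves ∪ Mok's 29 ∪ KMSW's proved-scope leaves; support(SolleveldQS) = the book's 24 ∪ Mok's 29.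

**v1.5 (section 47).**  The forty-fourth tranche (`Downstream10.lean` v4) types V. Heiermann's two papers: B10's
Corollary 3.5 with Theorem 1.8, as printed with its provisos, `HeiermannDecomp` ⇐ book ∧ row E41
(`Consumers14.MoeglinStable`); B47's Theorems 3.1–3.3 with the application to unitary groups `HeiermannStd` ⇐ book ∧
Mok ∧ KMSW's proved scope `κ.Scope`.  Canonical reading (`canon₄₄`, over `canon₁₄` of the first support file): each
field := the conjunction of the canonical values of its premises.  Certified here: the two edges hold in that reading
for arbitrary ν, μ, κ (`canon_implications₄₄`); both fields hold at the top (`fortyfourth_holds_top`, through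
`heiermannLine_of_inputs`); BOOK side: both FAIL in each of the 24 book countermodels (`fortyfourth_book_cm`) — every
book leaf is load-bearing for B10 (« [A] » with « [M1, M3] ») and for B47 (« [A, Mk, KMSW] »), E41's eight leaves being
second occurrences of book leaves; MOK side: in each of Mok's 29 countermodels B10 HOLDS (no Mok premise: « [Mk] » is
named in annex C.1 as the generalisation of Arthur's work, not as the annex's input) and B47 FAILS (`fortyfourth_mok_cm`);
KMSW side (`fortyfourth_kmsw_cm`, KMSW's countermodels for a leaf other than `MokMain`): B10 HOLDS outright; B47 holds
EXACTLY when the removed leaf is one of `AubertSS`, `KMS_A`, `KMS_B` — KMSW's proved scope is load-bearing (« [KMSW] »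
for the generic Vogan L-packets of the unitary groups), neither unwritten sequel is.  ROUTE: denying row E41 with every
forty-fourth-tranche edge valid (`c₁₄noE41`, `canon₄₄noE41`) falsifies B10 and leaves B47 true
(`heiermannDecomp_needs_E41`): as typed, Mœglin's Contemp. Math. 614 paper [M3] — the input of B10's Theorem 1.1 with
[M1] — is load-bearing for the Bernstein-block decomposition, the book alone does not feed the edge.  So, as typed:
support(HeiermannDecomp) = the book's 24 leaves (no Mok leaf, no KMSW leaf); support(HeiermannStd) = the book's 24 ∪
Mok's 29 ∪ KMSW's proved-scope leaves.

**v1.6 (section 48).**  The forty-fifth tranche (`Downstream11.lean` v1) types the Mœglin conduits, I: B75 (Clay Math.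
Proc. 13, 2011) with its « hypothèse générale » as a NODE `MoeglinDSHyp` (as printed: quasi-split or not, GSpin included;
no supply edge in the register) and the node's quasi-split symplectic / orthogonal INSTANCE `MoeglinDSHypQS` ⇐ book,
statements `MoeglinMult1` ⇐ node, `MoeglinMult1qs` ⇐ instance, `MoeglinMp` ⇐ `MoeglinMult1`; E43 (Pacific J. Math. 233,
2007) `MoeglinUnitaryDS` ⇐ ν.LLC_GLN ∧ ν.FL ∧ ν.Transfer ∧ ν.InvariantTF ∧ ν.TwistedTF; and the RE-ISSUED edges of B10,
B47, B28 with the binders B75 (as printed) and E43.  Canonical reading (`canon₄₅`): the node's value := its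
instance's value (the book at all ranks) ∧ a REMAINDER standing for the hypothesis beyond the quasi-split symplectic /
orthogonal case — GRANTED (`True`) in `canon₄₅`, DENIED (`False`) in `canon₄₅noR` — (the weakest reading validating the
instance edge node → instance); the instance := book; `MoeglinMult1`, `MoeglinMp` := the node's value; `MoeglinMult1qs`
:= book; `MoeglinUnitaryDS` := the conjunction of its five published leaves; the re-issued edges are read against the
UNCHANGED canonical values of tranches 43 / 44 (`canon₄₃`, `canon₄₄`).  Certified here: every forty-fifth-tranche edge
holds in that reading for arbitrary ν, μ, κ (`canon_implications₄₅`); all six fields hold at the top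
(`fortyfifth_holds_top`); BOOK side (`fortyfifth_book_cm`): the node, its instance and the three B75 statements FAIL in
each of the 24 book countermodels (every book leaf load-bearing for B75 in every reading); E43's EXACT SUPPORT: in the
book countermodel removing the leaf l, `MoeglinUnitaryDS` holds if and only if l is none of LLC_GLN, FL, Transfer,
InvariantTF, TwistedTF (`moeglinUnitaryDS_cm_holds` / `_cm_fails`) — in particular it HOLDS, with every tranche-45 edge
valid and everything the book establishes FAILING, for each of the seven 2024–2026 preprint leaves and BOTH unwritten
weighted fundamental lemmas (`moeglinUnitaryDS_indep_open_leaves`): as typed, Mœglin's 2007 classification and base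
change for the discrete series of p-adic quasi-split unitary groups rests on five PUBLISHED leaves and on no open leaf of
the book (E41 — section 18 — rests on eight leaves, two of them unwritten); MOK and KMSW sides: all six fields HOLD in
every Mok countermodel and every KMSW countermodel (`fortyfifth_mok_cm`, `fortyfifth_kmsw_cm`) — no Mok leaf, no KMSW
leaf in any tranche-45 support.  ROUTE (`moeglinConsumers_need_node`): in the all-ones assignment of the three DAGs the
reading with the remainder DENIED (`canon₄₅noR`, with the companion readings `c₄₃noM`, `c₄₄noM` of B28 / B10 / B47 that
conjoin B75's value) satisfies EVERY forty-fifth-tranche edge — re-issues included — while the node, B75 as printed, the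
metaplectic statements AND the three re-issued consumers B10, B47, B28 are FALSE and the instance, B75's quasi-split
statements, E43 and B40 are TRUE: as typed by the re-issued edges, Mœglin's 2011 hypothesis BEYOND its quasi-split
symplectic / orthogonal instance is load-bearing for Heiermann's two papers and for the Hecke-algebra LLC of Aubert –
Moussaoui – Solleveld — the typed form of their own provisos (« forthcoming », « remains to be published », « not all
arguments have been worked out in detail »); the landed edges of tranches 43 / 44 (binder « the book at all ranks »)
are exactly the edges that fail in this reading.  So, as typed: support(MoeglinDSHypQS) = support(MoeglinMult1qs) = the
book's 24 leaves; support(MoeglinMult1) = support(MoeglinMp) = the book's 24 leaves ∪ {the node's remainder};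
support(MoeglinUnitaryDS) = {LLC_GLN, FL, Transfer, InvariantTF, TwistedTF}.

**v1.7 (section 49).**  The forty-sixth tranche (`Downstream11.lean` v2) SPLITS row A6 (Chen – Zou, JEMS 27 (2025)) by
case: `ChenZouO` (Case O, even orthogonal groups) ⇐ book, `ChenZouU` (Case U, unitary groups) ⇐ Mok, with the instance
edges from and the join edge to the landed whole-paper field `Consumers.ChenZou` (first tranche, ⇐ book ∧ Mok), and
RE-ISSUES the two consumers that print one case only: A12 Peng (even special orthogonal groups) `E_PengO` ⇐ book ∧
`ChenZouO` ∧ `StabInner`, C165 Graham (unitary groups) `E_GrahamU` ⇐ `ChenZouU`.  Canonical reading (`canon₄₆`): the two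
cases := book, resp. Mok; and — the point of the tranche — the readings of the two re-issued consumers are RE-BASED on
the case they use: `c₄pengO` = `canon₄` with `Peng` := book (section 8 had book ∧ Mok, the value inherited from A6
whole), `c₆grahamU` = `canon₆` with `Graham` := Mok (section 11 had book ∧ Mok).  Certified here: every forty-sixth edge
holds in these readings for arbitrary ν, μ, κ (`canon_implications₄₆`), AND SO DO THE LANDED EDGES `E_Peng`, `E_Graham`
and indeed the whole landed bundles `Implications4`, `Implications6` (`canon_implications₄pengO`, `canon_implications₆grahamU`:
the re-based readings are legitimate readings of the landed register too — the old values were an artefact of the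
canonical recipe applied to the coarse premise A6, not forced by the edges); all fields hold at the top
(`fortysixth_holds_top`); BOOK side (`fortysixth_book_cm`): in each of the 24 book countermodels `ChenZouO`, the landed
`ChenZou` and PENG FAIL while `ChenZouU` and GRAHAM HOLD — so, as re-typed, Graham's theorems (unitary Friedberg – Jacquet
periods, unitary groups) inherit NO leaf of the book's own DAG (section 11: all 24); MOK side (`fortysixth_mok_cm`): in
each of Mok's 29 countermodels `ChenZouU`, `ChenZou` and GRAHAM FAIL while `ChenZouO` and PENG HOLD — so, as re-typed,
Peng's endoscopic character identity for even special orthogonal groups inherits NO leaf of Mok's memoir (section 8: «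
inherits ALL 29 Mok leaves as typed »); KMSW side (`fortysixth_kmsw_cm`): everything holds.  So, as typed on the case
each paper prints: support(ChenZouO) = support(Peng) = the book's 24 leaves; support(ChenZouU) = support(Graham) = Mok's
29 leaves; support(ChenZou) = both (unchanged).  The seven other consumers of A6 take the book and Mok as direct premises
(support-identical; not re-based).  BY PAPER: A10 (`ChenZouLLCU`, Chen – Zou Represent. Theory 25 (2021), typed ⇐ Mok
in the same tranche) := Mok in the canonical reading — HOLDS in the 24 book countermodels and KMSW's, FAILS in each of
Mok's 29: support(A10) = Mok's 29 leaves; and C158's premise-faithful re-issue `E_DHKMb` (A10 in place of the landed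
display's A6) holds in the canonical third-tranche reading `canon₃` (`canon_implications₄₆.dhkmB`) — support-identical to
the landed `E_DHKM` (both directions proved in `Downstream11.lean` v2).

**v1.8 (section 50).**  The forty-seventh tranche (`Downstream11.lean` v3) types the Mœglin conduits, II: J. Arthur's
Clay Math. Proc. 4 (2005) §30 Theorem 30.1, as stated there, as the node `ArthurClay30` with its supplier in print, the
book (`E_ArthurClay30` ⇐ book); E42 C. Mœglin 2007 (census grade « CONTROL ») as `MoeglinDS2007` ⇐ FL ∧ Transfer ∧
`ArthurClay30` ∧ its own hypothesis `MoeglinIcuspHyp` (node); the « Hypothèse générale » of B71 / B72 as the node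
`MoeglinHypGen` (supplier 2011: B75's `MoeglinMult1` ∧ E43) with its instance `MoeglinHypGenSOU` (suppliers 2007: E42 ∧
E43); B71 `MoeglinDiscretePackets` ⇐ the node; B72 `MoeglinPacketsComb` ⇐ the node ∧ B71; B75's printed pointer
`ArthurClay30 → MoeglinDSHypQS`.  Canonical reading (`canon₄₇`, over the unchanged `canon₄₅`): `ArthurClay30` := book;
E42's own node GRANTED (`True`); `MoeglinDS2007` := FL ∧ Transfer ∧ book; the « Hypothèse générale », its instance, B71
and B72 := (B75's value) ∧ (E43's five published leaves).  Certified here: every forty-seventh edge holds in this reading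
for arbitrary ν (`canon_implications₄₇`); all fields hold at the top (`fortyseventh_holds_top`); BOOK side
(`fortyseventh_book_cm`): in each of the 24 book countermodels (every edge of tranches 45 and 47 valid) ALL SIX typed
statements — Arthur 2005 §30, E42, the « Hypothèse générale », its instance, B71, B72 — FAIL; and THE RE-GRADING
(`e42_vs_e43_open_leaves`): in the book countermodel of each of the NINE OPEN leaves (the seven preprint leaves and the
two unwritten weighted fundamental lemmas) E42 FAILS while E43 — same author, same year, typed in tranche 45 from the
published leaves alone — HOLDS: as typed through its explicit use of Theorem 30.1, the census's CONTROL row E42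
inherits every open leaf of the book's DAG, E43 none (`moeglin2007_pair_published_leaves`: in the countermodels of the
five published leaves LLC_GLN, FL, Transfer, InvariantTF, TwistedTF both fail).  MOK side (`fortyseventh_mok_cm`) and
KMSW side (`fortyseventh_kmsw_cm`): everything holds (no Mok / KMSW premise in the Mœglin series).  So, as typed:
support(ArthurClay30) = support(MoeglinDS2007) = support(MoeglinHypGen) = support(B71) = support(B72) = the book's 24
leaves (E42 modulo its own granted node; the « Hypothèse générale » modulo B75's granted remainder).

**v1.9 (section 51; unit `pub-arthur-down-g26`).**  The forty-eighth tranche (`Downstream11.lean` v4) types the Mœglin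
conduits, III — the three remaining rows of C. Mœglin's p-adic packet series: B70 (Represent. Theory 10 (2006)) as
`MoeglinElementary` ⇐ its own §2.1 hypothesis, the node `MoeglinElemHyp` ⇐ `MoeglinHypGen` (instance of B71's
« Hypothèse générale »); B73 (Canad. J. Math. 62 (2010)) as `MoeglinHolomorphy` ⇐ B75's node `MoeglinDSHyp` ∧ B75
`MoeglinMult1` ∧ B70 ∧ B71 ∧ B72; B74 (J. Lie Theory 19 (2009)) as `MoeglinComparaison` ⇐ its « Conventions importantes »,
the node `MoeglinLdsConv` (supplier named by the paper: B75 ∧ B71), ∧ `MoeglinDSHyp` ∧ B75 ∧ B70 ∧ B71 ∧ B72 ∧ B73.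
Canonical reading (`canon₄₈`, over the unchanged `canon₄₅`, `canon₄₇`): all five fields := (B75's value = book ∧
granted remainder) ∧ (E43's five published leaves) — the value `canon₄₇` gives the « Hypothèse générale ».  Certified
here: every forty-eighth edge holds in this reading for arbitrary ν (`canon_implications₄₈`); all five fields hold at the
top (`fortyeighth_holds_top`); BOOK side (`fortyeighth_book_cm`): in each of the 24 book countermodels (every edge of
tranches 45, 47, 48 valid) B70, B73, B74 and both nodes ALL FAIL — every book leaf is load-bearing, the nine open ones
included (`fortyeighth_open_leaves`: there E43 holds and the five fail); MOK side (`fortyeighth_mok_cm`) and KMSW side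
(`fortyeighth_kmsw_cm`): all five hold (no Mok / KMSW premise).  THE NODE'S REMAINDER IS LOAD-BEARING FOR THE WHOLE
2006–2010 SERIES AS TYPED (`moeglinSeries_needs_node`): at the all-ones assignment of the three DAGs, the
denied-remainder readings `canon₄₅noR` (section 48), `canon₄₇noR`, `canon₄₈noR` satisfy every edge of tranches 45, 47
and 48 while B75's node, B75 as printed, the « Hypothèse générale », B71, B72, B70 and its node, B73, B74 and its node
are FALSE and B75's quasi-split statements, E43, Arthur 2005 §30, E42, the instance `MoeglinHypGenSOU` are TRUE: as
printed (symplectic, orthogonal AND GSpin groups, quasi-split or not) the series rests on Arthur's announced local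
results beyond the case the book proves — the typed form of B74's « Pour le moment le bilan est plutôt maigre » (2008)
and of B70's « ne sont non conditionnels que pour certains ψ ».  So, as typed: support(B70) = support(B73) =
support(B74) = support(MoeglinLdsConv) = the book's 24 leaves, modulo the granted remainder of B75's node.

**Deliberately not here.**  Any content of a node; any claim about the truth of a downstream theorem or of a
hypothesis; no Mathlib, no `axiom`, no `sorry`, no `opaque`.
-/

set_option autoImplicit false

namespace Literature.NumberTheory.Automorphic.Arthur2013

namespace Downstream

namespace Support

/-! ## 42. Thirty-ninth tranche (v1 of this file, after `Downstream9.lean` v2): supports of the G_2 line, II — the node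
`StabOrdG2`, E16 (`DuPengWanG2`), C199 (`HarrisKhareThorneG2`), C200 (`CLRJSteinberg`) — see the module docstring for
the summary of what is certified. -/

section Canon39

variable (ν : Nodes) (μ : Mok2015.Nodes) (κ : KMSW2014.Nodes)

/-- The canonical reading of the thirty-ninth tranche: each field := the conjunction of the canonical values of its
premises (book := ∀ N, ν.Everything N; the triality node := its seven leaves, `canon₃₈`'s value; the G_2 node := its
four leaves; A14 := `canon₁₅`'s value of `XuLifting`, C10 := `canon`'s value of `KretShinGSp`, both the book's outputs).
[cite: DuPenWan2026Triality, Thm 1.4 = Thm 9.3; HarrisKhareThorne2023G2, main theorem; CauchiLemmaRodriguesJacinto2025, Thm 1.4 = Thm 8.8; Arthur2002, STF I–III (canonical model; bookkeeping)] -/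
abbrev canon₃₉ : Consumers39 where
  StabOrdG2 := ν.FL ∧ ν.WFL_split ∧ ν.WFL_general ∧ ν.STF_Arthur
  DuPengWanG2 := (∀ N, ν.Everything N) ∧
    (ν.TWFL ∧ ν.WFL_nonstandard ∧ ν.FL ∧ ν.TwistedTF ∧ ν.MW_Stab ∧ ν.MW_Stab_I411 ∧ ν.Transfer) ∧
    (ν.FL ∧ ν.WFL_split ∧ ν.WFL_general ∧ ν.STF_Arthur)
  HarrisKhareThorneG2 := ∀ N, ν.Everything N
  CLRJSteinberg := ∀ N, ν.Everything N

/-- The four thirty-ninth-tranche edges hold in the canonical reading (first-tranche consumers `canon`, fifteenth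
`canon₁₅`, thirty-eighth `canon₃₈`), for arbitrary ν, μ, κ. [cite: DuPenWan2026Triality, Thm 1.4; HarrisKhareThorne2023G2, main theorem; CauchiLemmaRodriguesJacinto2025, Thm 1.4 (bookkeeping proved here)] -/
theorem canon_implications₃₉ :
    Implications39 ν (canon ν μ κ) (canon₁₅ ν μ) (canon₃₈ ν) (canon₃₉ ν) where
  stabOrdG2 := fun h0 h1 h2 h3 => ⟨h0, h1, h2, h3⟩
  duPengWanG2 := fun h0 h1 h2 => ⟨h0, h1, h2⟩
  harrisKhareThorneG2 := fun h => h
  clrjSteinberg := fun h => h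

/-- The thirty-ninth-tranche reading over `canon₃₈noS` (the TRIALITY node denied in tranche 38): E16 false, the G_2
node, C199 and C200 canonical. [cite: DuPenWan2026Triality, §6 p0016:L85 (« Moeglin and Waldspurger [MW2,MW3] established the two identities ») (separating model; bookkeeping)] -/
abbrev canon₃₉noS38 : Consumers39 where
  StabOrdG2 := ν.FL ∧ ν.WFL_split ∧ ν.WFL_general ∧ ν.STF_Arthur
  DuPengWanG2 := False
  HarrisKhareThorneG2 := ∀ N, ν.Everything N
  CLRJSteinberg := ∀ N, ν.Everything N

/-- Over the thirty-eighth reading with the triality node denied, EVERY thirty-ninth-tranche edge holds in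
`canon₃₉noS38` (E16's edge receives the node = `False`). [cite: DuPenWan2026Triality, §6 (bookkeeping proved here)] -/
theorem canon₃₉noS38_implications :
    Implications39 ν (canon ν μ κ) (canon₁₅ ν μ) (canon₃₈noS ν) (canon₃₉noS38 ν) where
  stabOrdG2 := fun h0 h1 h2 h3 => ⟨h0, h1, h2, h3⟩
  duPengWanG2 := fun _ h _ => h.elim
  harrisKhareThorneG2 := fun h => h
  clrjSteinberg := fun h => h

/-- The thirty-ninth-tranche reading with the G_2 NODE DENIED: it and E16 false, C199 and C200 canonical (tranche 38
canonical). [cite: DuPenWan2026Triality, §5 p0014:L83 (« Arthur [A6] proved, under the weighted fundamental lemma ») (separating model; bookkeeping)] -/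
abbrev canon₃₉noO : Consumers39 where
  StabOrdG2 := False
  DuPengWanG2 := False
  HarrisKhareThorneG2 := ∀ N, ν.Everything N
  CLRJSteinberg := ∀ N, ν.Everything N

/-- Granting the G_2 node's own edge, every thirty-ninth-tranche edge holds in the reading with that node denied (E16's
edge receives the node = `False`). [cite: DuPenWan2026Triality, §5 (bookkeeping proved here)] -/
theorem canon₃₉noO_implications_of_edge (e : E_StabOrdG2 ν (canon₃₉noO ν)) :
    Implications39 ν (canon ν μ κ) (canon₁₅ ν μ) (canon₃₈ ν) (canon₃₉noO ν) where
  stabOrdG2 := e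
  duPengWanG2 := fun _ _ h => h.elim
  harrisKhareThorneG2 := fun h => h
  clrjSteinberg := fun h => h

end Canon39

/-- With every input of the book granted (all-ones assignment) all four fields hold: the G_2 node through the tranche's
`stabOrdG2_of_leaves`, the three statements through its `g2Line39_of_inputs` (the triality node by tranche 38's
`stabTwTriality_of_leaves`, A14 by `xuLifting_of_leaves`, C10 by `kretShin_of_leaves` inside it). [cite: DuPenWan2026Triality, Thm 1.4; HarrisKhareThorne2023G2, main theorem; CauchiLemmaRodriguesJacinto2025, Thm 1.4 (bookkeeping proved here)] -/
theorem thirtyninth_holds_top :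
    (canon₃₉ νtop).StabOrdG2 ∧ (canon₃₉ νtop).DuPengWanG2 ∧ (canon₃₉ νtop).HarrisKhareThorneG2 ∧
      (canon₃₉ νtop).CLRJSteinberg :=
  have T := canon_implications₃₉ νtop μtop κtop
  ⟨stabOrdG2_of_leaves T bookInputs_top.published bookInputs_top.unwritten,
    g2Line39_of_inputs T (canon_implications₃₈ νtop μtop κtop) (canon_implications νtop μtop κtop)
      (canon_implications₁₅ νtop μtop κtop) bookInputs_top⟩

/-- THE G_2 NODE'S EXACT SUPPORT, AS TYPED: in the book countermodel removing the leaf `l` (every other book leaf holding)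
the canonical `StabOrdG2` holds if and only if `l` is none of the fundamental lemma, the split weighted lemma, the general
weighted lemma, Arthur's STF I–III — of which exactly one, `WFL_general`, is unwritten in 2026. [cite: Arthur2002, STF I–III (stated conditional on the fundamental lemma and its weighted version); DuPenWan2026Triality §5 p0014:L83 (bookkeeping proved here)] -/
theorem stabOrdG2_cm_iff (l : LeafSupport.Leaf) :
    (canon₃₉ (LeafSupport.mkN (LeafSupport.cm l))).StabOrdG2 ↔
      (l ≠ .FL ∧ l ≠ .WFL_split ∧ l ≠ .WFL_general ∧ l ≠ .STF_Arthur) := by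
  have cmod := LeafSupport.countermodel l
  have hall : ∀ l', l' ≠ l → (LeafSupport.mkN (LeafSupport.cm l)).leaf l' := cmod.2.1
  have hnot : ¬ (LeafSupport.mkN (LeafSupport.cm l)).leaf l := cmod.2.2.1
  constructor
  · intro ⟨h1, h2, h3, h4⟩
    exact ⟨fun e => by subst e; exact hnot h1, fun e => by subst e; exact hnot h2, fun e => by subst e; exact hnot h3,
      fun e => by subst e; exact hnot h4⟩
  · intro ⟨n1, n2, n3, n4⟩
    exact ⟨hall .FL (Ne.symm n1), hall .WFL_split (Ne.symm n2), hall .WFL_general (Ne.symm n3),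
      hall .STF_Arthur (Ne.symm n4)⟩

/-- BOOK side: in each of the 24 book countermodels (book edge systems and every other book leaf hold, the removed leaf
fails; Mok and KMSW at the all-ones assignment; every thirty-ninth-tranche edge valid over the canonical readings) the
three STATEMENT fields FAIL — every book leaf is load-bearing, as typed, for Du – Peng – Wan's coarse classification of
G_2, for Harris – Khare – Thorne's parameterization of generic supercuspidals of G_2 and for Cauchi – Lemma – Rodrigues
Jacinto's Steinberg-case statements. [cite: DuPenWan2026Triality, p0016:L85; HarrisKhareThorne2023G2, p0007:L11; CauchiLemmaRodriguesJacinto2025, p0040:L27, with Arthur2013 Thms 1.5.1, 1.5.2 (bookkeeping proved here)] -/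
theorem thirtyninth_book_cm (l : LeafSupport.Leaf) :
    LeafSupport.Systems (LeafSupport.mkN (LeafSupport.cm l)) (LeafSupport.mkW (LeafSupport.cm l)) (LeafSupport.mkG (LeafSupport.cm l)) ∧
      (∀ l', l' ≠ l → (LeafSupport.mkN (LeafSupport.cm l)).leaf l') ∧ ¬ (LeafSupport.mkN (LeafSupport.cm l)).leaf l ∧
      Implications39 (LeafSupport.mkN (LeafSupport.cm l)) (canon (LeafSupport.mkN (LeafSupport.cm l)) μtop κtop) (canon₁₅ (LeafSupport.mkN (LeafSupport.cm l)) μtop) (canon₃₈ (LeafSupport.mkN (LeafSupport.cm l))) (canon₃₉ (LeafSupport.mkN (LeafSupport.cm l))) ∧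
      ¬ (canon₃₉ (LeafSupport.mkN (LeafSupport.cm l))).DuPengWanG2 ∧
      ¬ (canon₃₉ (LeafSupport.mkN (LeafSupport.cm l))).HarrisKhareThorneG2 ∧
      ¬ (canon₃₉ (LeafSupport.mkN (LeafSupport.cm l))).CLRJSteinberg :=
  have cmod := LeafSupport.countermodel l
  ⟨cmod.1, cmod.2.1, cmod.2.2.1, canon_implications₃₉ _ _ _, fun h => not_B_cm l h.1, fun h => not_B_cm l h,
    fun h => not_B_cm l h⟩

/-- MOK side: in each of Mok's 29 countermodels (the book at the all-ones assignment; KMSW read without its import of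
Mok, `κnoMok`), every thirty-ninth-tranche edge valid over the canonical readings: ALL FOUR fields HOLD — no leaf of
Mok's memoir is in the support of the G_2 line (split G_2, PGSO(8), SO(8), SO(4), PGSp_6, GSp_6; no unitary group).
[cite: DuPenWan2026Triality, Thm 1.4; HarrisKhareThorne2023G2, main theorem; CauchiLemmaRodriguesJacinto2025, Thm 1.4 (bookkeeping proved here)] -/
theorem thirtyninth_mok_cm (l : Mok2015.LeafSupport.Leaf) :
    Mok2015.LeafSupport.Systems (Mok2015.LeafSupport.mkN (Mok2015.LeafSupport.cm l)) ∧
      (∀ l', l' ≠ l → (Mok2015.LeafSupport.mkN (Mok2015.LeafSupport.cm l)).leaf l') ∧ ¬ (Mok2015.LeafSupport.mkN (Mok2015.LeafSupport.cm l)).leaf l ∧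
      Implications39 νtop (canon νtop (Mok2015.LeafSupport.mkN (Mok2015.LeafSupport.cm l)) κnoMok) (canon₁₅ νtop (Mok2015.LeafSupport.mkN (Mok2015.LeafSupport.cm l))) (canon₃₈ νtop) (canon₃₉ νtop) ∧
      (canon₃₉ νtop).StabOrdG2 ∧ (canon₃₉ νtop).DuPengWanG2 ∧ (canon₃₉ νtop).HarrisKhareThorneG2 ∧
      (canon₃₉ νtop).CLRJSteinberg :=
  have cmod := Mok2015.LeafSupport.countermodel l
  ⟨cmod.1, cmod.2.1, cmod.2.2.1, canon_implications₃₉ _ _ _, thirtyninth_holds_top⟩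

/-- KMSW side: in KMSW's countermodel for a leaf `l ≠ MokMain` (book and Mok at the all-ones assignment), every
thirty-ninth-tranche edge valid: ALL FOUR fields HOLD outright — no KMSW premise at any order. [claim: KalethaMinguezShinWhite2014, under-review] (bookkeeping proved here) -/
theorem thirtyninth_kmsw_cm (l : KMSW2014.LeafSupport.Leaf) (hl : l ≠ .MokMain) :
    (∃ ωκ, KMSW2014.LeafSupport.Systems (KMSW2014.LeafSupport.mkN (KMSW2014.LeafSupport.cm l)) ωκ) ∧
      (∀ l', l' ≠ l → (KMSW2014.LeafSupport.mkN (KMSW2014.LeafSupport.cm l)).leaf l') ∧ ¬ (KMSW2014.LeafSupport.mkN (KMSW2014.LeafSupport.cm l)).leaf l ∧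
      KMSW2014.E_ImportMok μtop (KMSW2014.LeafSupport.mkN (KMSW2014.LeafSupport.cm l)) ∧
      Implications39 νtop (canon νtop μtop (KMSW2014.LeafSupport.mkN (KMSW2014.LeafSupport.cm l))) (canon₁₅ νtop μtop) (canon₃₈ νtop) (canon₃₉ νtop) ∧
      (canon₃₉ νtop).StabOrdG2 ∧ (canon₃₉ νtop).DuPengWanG2 ∧ (canon₃₉ νtop).HarrisKhareThorneG2 ∧
      (canon₃₉ νtop).CLRJSteinberg :=
  have cmod := KMSW2014.LeafSupport.countermodel l
  ⟨⟨_, cmod.1⟩, cmod.2.1, cmod.2.2.1, fun _ => cmod.2.1 .MokMain (Ne.symm hl), canon_implications₃₉ _ _ _,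
    thirtyninth_holds_top⟩

/-- THE TRIALITY NODE (tranche 38) IS ON THE ROUTE OF E16, AS TYPED — a cross-tranche route.  In the all-ones
assignment of the three DAGs there is a joint assignment of tranches 38 and 39 (tranche 38 read with its node denied —
`canon₃₈noS` of section 41: granting `E_StabTwTriality` the whole thirty-eighth edge system holds, and `E_StabTwTriality`
FAILS, its seven leaf premises holding at the top —; tranche 39 read by `canon₃₉noS38`, in which EVERY thirty-ninth
edge holds) where E16 is FALSE while the G_2 node, C199 and C200 hold (and, in tranche 38, C101 falls with the node
while B27 and C100 stand, as certified in section 41).  The typed form of « Assume that the twisted weighted fundamental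
lemma holds. Moeglin and Waldspurger [MW2,MW3] established the two identities ((twisted trace formula)) and ((twisted
trace 1)); we thus obtain the following theorem. » before Theorem 6.1. [cite: DuPenWan2026Triality, §6 (p0016:L85-88) with MoeglinWaldspurger2016 X 8.1 (bookkeeping proved here)] -/
theorem duPengWanG2_needs_node38 :
    ∃ c₃₈ : Consumers38, ∃ c₃₉ : Consumers39,
      BookInputs νtop ∧ MokInputs μtop ∧ KMSWInputs μtop κtop ∧ κtop.UnwrittenSequels ∧
      (∀ l : Mok2015.LeafSupport.Leaf, μtop.leaf l) ∧ (∀ l : KMSW2014.LeafSupport.Leaf, κtop.leaf l) ∧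
      Implications νtop μtop κtop (canon νtop μtop κtop) ∧
      Implications15 νtop μtop (canon νtop μtop κtop) (canon₁₅ νtop μtop) ∧
      Implications37 νtop (canon νtop μtop κtop) (canon₃₇ νtop) ∧
      (E_StabTwTriality νtop c₃₈ → Implications38 νtop (canon νtop μtop κtop) (canon₁₅ νtop μtop) (canon₃₇ νtop) c₃₈) ∧
      ¬ E_StabTwTriality νtop c₃₈ ∧
      Implications39 νtop (canon νtop μtop κtop) (canon₁₅ νtop μtop) c₃₈ c₃₉ ∧
      ¬ c₃₈.StabTwTriality ∧
      c₃₉.StabOrdG2 ∧ c₃₉.HarrisKhareThorneG2 ∧ c₃₉.CLRJSteinberg ∧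
      ¬ c₃₉.DuPengWanG2 :=
  have KQ := kmswInputs_top μtop
  have P := bookInputs_top.published
  have U := bookInputs_top.unwritten
  have b : ∀ N, νtop.Everything N := bookInputs_top.everything
  have x : νtop.FL ∧ νtop.WFL_split ∧ νtop.WFL_general ∧ νtop.STF_Arthur := ⟨P.fl, P.wfl_split, U.wfl_general, P.stf⟩
  have twfl : νtop.TWFL := bookInputs_top.supplies.twfl P.w4 U.wfl_general U.wfl_nonstandard
  ⟨canon₃₈noS νtop, canon₃₉noS38 νtop, bookInputs_top, mokInputs_top, KQ.1, KQ.2, mokLeaves_top, kmswLeaves_top,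
    canon_implications νtop μtop κtop, canon_implications₁₅ νtop μtop κtop, canon_implications₃₇ νtop μtop κtop,
    canon₃₈noS_implications_of_edge νtop μtop κtop,
    fun e => e twfl U.wfl_nonstandard P.fl P.ttf P.mwStab P.mwI411 P.transfer,
    canon₃₉noS38_implications νtop μtop κtop, id, x, b, b, id⟩

/-- THE G_2 NODE IS ON THE ROUTE OF E16, AS TYPED.  In the all-ones assignment there is a thirty-ninth-tranche
assignment (the G_2 node denied — granting `E_StabOrdG2` the whole thirty-ninth edge system holds, and `E_StabOrdG2`
FAILS at the top: its four leaf premises hold there) in which the node and E16 are FALSE while C199 and C200 hold (tranche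
38 canonical): Arthur's stabilisation of the standard trace formula of G_2 is load-bearing for the coarse classification
and for nothing else in the tranche.  The typed form of « Arthur [A6] proved, under the weighted fundamental lemma
(established by Chaudouard–Laumon [CL1,CL2]), that $S(f)$ is stable and admits a decomposition ». [cite: DuPenWan2026Triality, §5 (p0014:L83-86) with Arthur2002 STF I–III (bookkeeping proved here)] -/
theorem duPengWanG2_needs_nodeG2 :
    ∃ c₃₉ : Consumers39,
      BookInputs νtop ∧ MokInputs μtop ∧ KMSWInputs μtop κtop ∧ κtop.UnwrittenSequels ∧
      (∀ l : Mok2015.LeafSupport.Leaf, μtop.leaf l) ∧ (∀ l : KMSW2014.LeafSupport.Leaf, κtop.leaf l) ∧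
      Implications νtop μtop κtop (canon νtop μtop κtop) ∧
      Implications15 νtop μtop (canon νtop μtop κtop) (canon₁₅ νtop μtop) ∧
      Implications38 νtop (canon νtop μtop κtop) (canon₁₅ νtop μtop) (canon₃₇ νtop) (canon₃₈ νtop) ∧
      (E_StabOrdG2 νtop c₃₉ → Implications39 νtop (canon νtop μtop κtop) (canon₁₅ νtop μtop) (canon₃₈ νtop) c₃₉) ∧
      ¬ E_StabOrdG2 νtop c₃₉ ∧
      (canon₃₈ νtop).StabTwTriality ∧
      c₃₉.HarrisKhareThorneG2 ∧ c₃₉.CLRJSteinberg ∧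
      ¬ c₃₉.StabOrdG2 ∧ ¬ c₃₉.DuPengWanG2 :=
  have KQ := kmswInputs_top μtop
  have P := bookInputs_top.published
  have U := bookInputs_top.unwritten
  have b : ∀ N, νtop.Everything N := bookInputs_top.everything
  ⟨canon₃₉noO νtop, bookInputs_top, mokInputs_top, KQ.1, KQ.2, mokLeaves_top, kmswLeaves_top,
    canon_implications νtop μtop κtop, canon_implications₁₅ νtop μtop κtop, canon_implications₃₈ νtop μtop κtop,
    canon₃₉noO_implications_of_edge νtop μtop κtop,
    fun e => e P.fl P.wfl_split U.wfl_general P.stf,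
    thirtyeighth_holds_top.1, b, b, id, id⟩

/-! ## 43. Fortieth tranche (v1.1 of this file, after `Downstream9.lean` v3): supports of the wavefront line — B60
(`JLZwavefront`, with the node `JLZvoganHyp`), B56 (`CJLZbranching`), B41 (`JLLMZreciprocity`), B26 (`HLLSequiv` over the
node `HLLSHyp`; `HLLSequivQS` over the supplied node `HLLSHypQS`), B14 (`AtobeCiubotaruWF`, with the node
`AGIKMSaubertDual`) — see the module docstring for the summary of what is certified. -/

section Canon40

variable (ν : Nodes) (μ : Mok2015.Nodes) (κ : KMSW2014.Nodes)

/-- The canonical reading of the fortieth tranche: the three supplier-less nodes `JLZvoganHyp`, `HLLSHyp`, `AGIKMSaubertDual` := `True` (granted); each other field := the conjunction of the canonical values of its premises (book, Mok, KMSW's scope; B60's and B56's values for B56 / B41; `HLLSHypQS`'s value for `HLLSequivQS`; granted nodes dropped, so `HLLSequiv` := `True`). [cite: JiangLiuZhang2025Wavefront, Thm 1.1; ChenJiangLiuZhang2024Branching, Thm 1.5; JiangLiuLuoMaZhang2026Wavefront, Thm 1.2; HazeltineLiuLoShahidi2024Wavefront, Thms 1.2, 1.5, 1.8; AtobeCiubotaru2026Wavefront,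 Thm 1.4 (canonical model; bookkeeping)] -/
abbrev canon₄₀ : Consumers40 where
  JLZvoganHyp := True
  JLZwavefront := (∀ N, ν.Everything N) ∧ (∀ N, μ.Everything N) ∧ (∀ N, κ.Scope N)
  CJLZbranching := ((∀ N, ν.Everything N) ∧ (∀ N, μ.Everything N) ∧ (∀ N, κ.Scope N)) ∧ ((∀ N, ν.Everything N) ∧ (∀ N, μ.Everything N) ∧ (∀ N, κ.Scope N))
  JLLMZreciprocity := ((∀ N, ν.Everything N) ∧ (∀ N, μ.Everything N) ∧ (∀ N, κ.Scope N)) ∧ ((∀ N, ν.Everything N) ∧ (∀ N, μ.Everything N) ∧ (∀ N, κ.Scope N)) ∧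
    (((∀ N, ν.Everything N) ∧ (∀ N, μ.Everything N) ∧ (∀ N, κ.Scope N)) ∧ ((∀ N, ν.Everything N) ∧ (∀ N, μ.Everything N) ∧ (∀ N, κ.Scope N)))
  HLLSHyp := True
  HLLSHypQS := (∀ N, ν.Everything N) ∧ (∀ N, μ.Everything N)
  HLLSequiv := True
  HLLSequivQS := (∀ N, ν.Everything N) ∧ (∀ N, μ.Everything N)
  AGIKMSaubertDual := True
  AtobeCiubotaruWF := ∀ N, ν.Everything N

/-- The seven fortieth-tranche edges hold in the canonical reading, for arbitrary ν, μ, κ. [cite: JiangLiuZhang2025Wavefront, Thm 1.1; HazeltineLiuLoShahidi2024Wavefront, Thm 1.2; AtobeCiubotaru2026Wavefront, Thm 1.4 (bookkeeping proved here)] -/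
theorem canon_implications₄₀ : Implications40 ν μ κ (canon₄₀ ν μ κ) where
  jlzWavefront := fun h0 h1 h2 _ => ⟨h0, h1, h2⟩
  cjlzBranching := fun h0 h1 h2 h3 => ⟨⟨h0, h1, h2⟩, h3⟩
  jllmzReciprocity := fun h0 h1 h2 h3 h4 => ⟨⟨h0, h1, h2⟩, h3, h4⟩
  hllsHypQS := fun h0 h1 => ⟨h0, h1⟩
  hllsEquiv := fun _ => trivial
  hllsEquivQS := fun h => h
  atobeCiubotaruWF := fun h _ => h

/-- The fortieth-tranche reading with B60's assumption node `JLZvoganHyp` DENIED: it and B60, B56, B41 false; the B26 and B14 fields as in `canon₄₀`. [cite: JiangLiuZhang2025Wavefront, §3.1 p0016:L58-60 (separating model; bookkeeping)] -/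
abbrev canon₄₀noJLZ : Consumers40 where
  JLZvoganHyp := False
  JLZwavefront := False
  CJLZbranching := False
  JLLMZreciprocity := False
  HLLSHyp := True
  HLLSHypQS := (∀ N, ν.Everything N) ∧ (∀ N, μ.Everything N)
  HLLSequiv := True
  HLLSequivQS := (∀ N, ν.Everything N) ∧ (∀ N, μ.Everything N)
  AGIKMSaubertDual := True
  AtobeCiubotaruWF := ∀ N, ν.Everything N

/-- Every fortieth-tranche edge holds in the reading with `JLZvoganHyp` denied (B60's edge receives the node = `False`; B56's and B41's receive B60 = `False`). [cite: JiangLiuZhang2025Wavefront, §3.1 p0016:L58-60 (bookkeeping proved here)] -/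
theorem canon_implications₄₀noJLZ : Implications40 ν μ κ (canon₄₀noJLZ ν μ) where
  jlzWavefront := fun _ _ _ h => h.elim
  cjlzBranching := fun _ _ _ h => h.elim
  jllmzReciprocity := fun _ _ _ h _ => h.elim
  hllsHypQS := fun h0 h1 => ⟨h0, h1⟩
  hllsEquiv := fun _ => trivial
  hllsEquivQS := fun h => h
  atobeCiubotaruWF := fun h _ => h

/-- The fortieth-tranche reading with B26's hypothesis node `HLLSHyp` DENIED: it and `HLLSequiv` false; everything else as in `canon₄₀` (the quasi-split instance untouched). [cite: HazeltineLiuLoShahidi2024Wavefront, Conj. 1.1 p0001:L34-35, §6.1 p0016:L29 (separating model; bookkeeping)] -/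
abbrev canon₄₀noHLLS : Consumers40 where
  JLZvoganHyp := True
  JLZwavefront := (∀ N, ν.Everything N) ∧ (∀ N, μ.Everything N) ∧ (∀ N, κ.Scope N)
  CJLZbranching := ((∀ N, ν.Everything N) ∧ (∀ N, μ.Everything N) ∧ (∀ N, κ.Scope N)) ∧ ((∀ N, ν.Everything N) ∧ (∀ N, μ.Everything N) ∧ (∀ N, κ.Scope N))
  JLLMZreciprocity := ((∀ N, ν.Everything N) ∧ (∀ N, μ.Everything N) ∧ (∀ N, κ.Scope N)) ∧ ((∀ N, ν.Everything N) ∧ (∀ N, μ.Everything N) ∧ (∀ N, κ.Scope N)) ∧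
    (((∀ N, ν.Everything N) ∧ (∀ N, μ.Everything N) ∧ (∀ N, κ.Scope N)) ∧ ((∀ N, ν.Everything N) ∧ (∀ N, μ.Everything N) ∧ (∀ N, κ.Scope N)))
  HLLSHyp := False
  HLLSHypQS := (∀ N, ν.Everything N) ∧ (∀ N, μ.Everything N)
  HLLSequiv := False
  HLLSequivQS := (∀ N, ν.Everything N) ∧ (∀ N, μ.Everything N)
  AGIKMSaubertDual := True
  AtobeCiubotaruWF := ∀ N, ν.Everything N

/-- Every fortieth-tranche edge holds in the reading with `HLLSHyp` denied (`E_HLLSequiv` receives the node = `False`). [cite: HazeltineLiuLoShahidi2024Wavefront, §6.1 p0016:L29 (bookkeeping proved here)] -/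
theorem canon_implications₄₀noHLLS : Implications40 ν μ κ (canon₄₀noHLLS ν μ κ) where
  jlzWavefront := fun h0 h1 h2 _ => ⟨h0, h1, h2⟩
  cjlzBranching := fun h0 h1 h2 h3 => ⟨⟨h0, h1, h2⟩, h3⟩
  jllmzReciprocity := fun h0 h1 h2 h3 h4 => ⟨⟨h0, h1, h2⟩, h3, h4⟩
  hllsHypQS := fun h0 h1 => ⟨h0, h1⟩
  hllsEquiv := fun h => h.elim
  hllsEquivQS := fun h => h
  atobeCiubotaruWF := fun h _ => h

/-- The fortieth-tranche reading with the AGIKMS node `AGIKMSaubertDual` DENIED: it and B14 false; everything else as in `canon₄₀`. [cite: AtobeCiubotaru2026Wavefront, §1.3 p0004:L30-33 (separating model; bookkeeping)] -/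
abbrev canon₄₀noAGIKMS : Consumers40 where
  JLZvoganHyp := True
  JLZwavefront := (∀ N, ν.Everything N) ∧ (∀ N, μ.Everything N) ∧ (∀ N, κ.Scope N)
  CJLZbranching := ((∀ N, ν.Everything N) ∧ (∀ N, μ.Everything N) ∧ (∀ N, κ.Scope N)) ∧ ((∀ N, ν.Everything N) ∧ (∀ N, μ.Everything N) ∧ (∀ N, κ.Scope N))
  JLLMZreciprocity := ((∀ N, ν.Everything N) ∧ (∀ N, μ.Everything N) ∧ (∀ N, κ.Scope N)) ∧ ((∀ N, ν.Everything N) ∧ (∀ N, μ.Everything N) ∧ (∀ N, κ.Scope N)) ∧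
    (((∀ N, ν.Everything N) ∧ (∀ N, μ.Everything N) ∧ (∀ N, κ.Scope N)) ∧ ((∀ N, ν.Everything N) ∧ (∀ N, μ.Everything N) ∧ (∀ N, κ.Scope N)))
  HLLSHyp := True
  HLLSHypQS := (∀ N, ν.Everything N) ∧ (∀ N, μ.Everything N)
  HLLSequiv := True
  HLLSequivQS := (∀ N, ν.Everything N) ∧ (∀ N, μ.Everything N)
  AGIKMSaubertDual := False
  AtobeCiubotaruWF := False

/-- Every fortieth-tranche edge holds in the reading with `AGIKMSaubertDual` denied (B14's edge receives the node = `False`). [cite: AtobeCiubotaru2026Wavefront, §1.3 p0004:L30-33 (bookkeeping proved here)] -/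
theorem canon_implications₄₀noAGIKMS : Implications40 ν μ κ (canon₄₀noAGIKMS ν μ κ) where
  jlzWavefront := fun h0 h1 h2 _ => ⟨h0, h1, h2⟩
  cjlzBranching := fun h0 h1 h2 h3 => ⟨⟨h0, h1, h2⟩, h3⟩
  jllmzReciprocity := fun h0 h1 h2 h3 h4 => ⟨⟨h0, h1, h2⟩, h3, h4⟩
  hllsHypQS := fun h0 h1 => ⟨h0, h1⟩
  hllsEquiv := fun _ => trivial
  hllsEquivQS := fun h => h
  atobeCiubotaruWF := fun _ h => h.elim
end Canon40

/-- With every input of the three DAGs granted (all-ones assignments, KMSW in the proved scope) and the three nodes fed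
`trivial`, every field of the fortieth tranche holds, through the tranche's own bookkeeping theorem
`wavefrontLine_of_inputs`. [cite: JiangLiuZhang2025Wavefront, Thm 1.1; ChenJiangLiuZhang2024Branching, Thm 1.5; JiangLiuLuoMaZhang2026Wavefront, Thm 1.2; HazeltineLiuLoShahidi2024Wavefront, Thm 1.2; AtobeCiubotaru2026Wavefront, Thm 1.4 (bookkeeping proved here)] -/
theorem fortieth_holds_top :
    ((canon₄₀ νtop μtop κtop).JLZwavefront ∧ (canon₄₀ νtop μtop κtop).CJLZbranching ∧ (canon₄₀ νtop μtop κtop).JLLMZreciprocity) ∧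
      ((canon₄₀ νtop μtop κtop).HLLSequiv ∧ (canon₄₀ νtop μtop κtop).HLLSequivQS) ∧ (canon₄₀ νtop μtop κtop).AtobeCiubotaruWF :=
  wavefrontLine_of_inputs (canon_implications₄₀ νtop μtop κtop) bookInputs_top mokInputs_top (kmswInputs_top μtop).1
    trivial trivial trivial

/-- BOOK side: in each of the 24 book countermodels (book edge systems and every other book leaf hold, the removed leaf
fails; Mok and KMSW at the all-ones assignment), every fortieth-tranche edge valid over the canonical reading: B60, B56,
B41, the quasi-split node `HLLSHypQS` with `HLLSequivQS`, and B14 FAIL, while `HLLSequiv` holds over its granted node —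
every book leaf is load-bearing, as typed, for the arithmetic wavefront sets of representations with generic L-parameter
(B60: Sp_{2n}, quasi-split SO_m among the G_n), for the first descent spectrum (B56), for the reciprocity WF_des = WF_ari
(B41), for the quasi-split instance of Hazeltine – Liu – Lo – Shahidi's equivalences (« the existence of Π_ψ is proved in
[Art13, Mok15] ») and for the wavefront sets of the A-packets of split SO_{2n+1}, Sp_{2n}, SO_{2n} (B14). [cite: JiangLiuZhang2025Wavefront, §1 p0003:L8-9; HazeltineLiuLoShahidi2024Wavefront, §6.1 p0016:L24; AtobeCiubotaru2026Wavefront, §1.3 p0004:L1-2, with Arthur2013 §1.5 (bookkeeping proved here)] -/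
theorem fortieth_book_cm (l : LeafSupport.Leaf) :
    LeafSupport.Systems (LeafSupport.mkN (LeafSupport.cm l)) (LeafSupport.mkW (LeafSupport.cm l)) (LeafSupport.mkG (LeafSupport.cm l)) ∧
      (∀ l', l' ≠ l → (LeafSupport.mkN (LeafSupport.cm l)).leaf l') ∧ ¬ (LeafSupport.mkN (LeafSupport.cm l)).leaf l ∧
      Implications40 (LeafSupport.mkN (LeafSupport.cm l)) μtop κtop (canon₄₀ (LeafSupport.mkN (LeafSupport.cm l)) μtop κtop) ∧
      ((canon₄₀ (LeafSupport.mkN (LeafSupport.cm l)) μtop κtop).JLZvoganHyp ∧ (canon₄₀ (LeafSupport.mkN (LeafSupport.cm l)) μtop κtop).HLLSHyp ∧ (canon₄₀ (LeafSupport.mkN (LeafSupport.cm l)) μtop κtop).AGIKMSaubertDual ∧ (canon₄₀ (LeafSupport.mkN (LeafSupport.cm l)) μtop κtop).HLLSequiv) ∧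
      ¬ (canon₄₀ (LeafSupport.mkN (LeafSupport.cm l)) μtop κtop).JLZwavefront ∧
      ¬ (canon₄₀ (LeafSupport.mkN (LeafSupport.cm l)) μtop κtop).CJLZbranching ∧
      ¬ (canon₄₀ (LeafSupport.mkN (LeafSupport.cm l)) μtop κtop).JLLMZreciprocity ∧
      ¬ (canon₄₀ (LeafSupport.mkN (LeafSupport.cm l)) μtop κtop).HLLSHypQS ∧
      ¬ (canon₄₀ (LeafSupport.mkN (LeafSupport.cm l)) μtop κtop).HLLSequivQS ∧
      ¬ (canon₄₀ (LeafSupport.mkN (LeafSupport.cm l)) μtop κtop).AtobeCiubotaruWF :=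
  have cmod := LeafSupport.countermodel l
  ⟨cmod.1, cmod.2.1, cmod.2.2.1, canon_implications₄₀ _ _ _, ⟨trivial, trivial, trivial, trivial⟩,
    fun h => not_B_cm l h.1, fun h => not_B_cm l h.1.1, fun h => not_B_cm l h.1.1, fun h => not_B_cm l h.1,
    fun h => not_B_cm l h.1, fun h => not_B_cm l h⟩

/-- MOK side: in each of Mok's 29 countermodels (Mok's edges and every other Mok leaf hold, the removed leaf fails; the
book at the all-ones assignment; KMSW read without its import of Mok, `κnoMok`), every fortieth-tranche edge valid over
the canonical reading: B60, B56, B41, `HLLSHypQS`, `HLLSequivQS` FAIL and B14, `HLLSequiv` (and the three granted nodes)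
HOLD — every Mok leaf is load-bearing, as typed, for the three arithmetic-wavefront rows (the unitary groups U_n among the
classical groups G_n: « followed by [Mok15] ») and for the quasi-split instance of B26 (« proved in [Art13, Mok15] »),
none for the wavefront sets of A-packets of split classical groups. [cite: JiangLiuZhang2025Wavefront, §3.1 p0016:L52; ChenJiangLiuZhang2024Branching, §5 p0024:L49; HazeltineLiuLoShahidi2024Wavefront, §6.1 p0016:L24, with Mok2012 §2.5 (bookkeeping proved here)] -/
theorem fortieth_mok_cm (l : Mok2015.LeafSupport.Leaf) :
    Mok2015.LeafSupport.Systems (Mok2015.LeafSupport.mkN (Mok2015.LeafSupport.cm l)) ∧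
      (∀ l', l' ≠ l → (Mok2015.LeafSupport.mkN (Mok2015.LeafSupport.cm l)).leaf l') ∧ ¬ (Mok2015.LeafSupport.mkN (Mok2015.LeafSupport.cm l)).leaf l ∧
      Implications40 νtop (Mok2015.LeafSupport.mkN (Mok2015.LeafSupport.cm l)) κnoMok (canon₄₀ νtop (Mok2015.LeafSupport.mkN (Mok2015.LeafSupport.cm l)) κnoMok) ∧
      ((canon₄₀ νtop (Mok2015.LeafSupport.mkN (Mok2015.LeafSupport.cm l)) κnoMok).JLZvoganHyp ∧ (canon₄₀ νtop (Mok2015.LeafSupport.mkN (Mok2015.LeafSupport.cm l)) κnoMok).HLLSHyp ∧ (canon₄₀ νtop (Mok2015.LeafSupport.mkN (Mok2015.LeafSupport.cm l)) κnoMok).AGIKMSaubertDual ∧ (canon₄₀ νtop (Mok2015.LeafSupport.mkN (Mok2015.LeafSupport.cm l)) κnoMok).HLLSequiv) ∧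
      (canon₄₀ νtop (Mok2015.LeafSupport.mkN (Mok2015.LeafSupport.cm l)) κnoMok).AtobeCiubotaruWF ∧
      ¬ (canon₄₀ νtop (Mok2015.LeafSupport.mkN (Mok2015.LeafSupport.cm l)) κnoMok).JLZwavefront ∧
      ¬ (canon₄₀ νtop (Mok2015.LeafSupport.mkN (Mok2015.LeafSupport.cm l)) κnoMok).CJLZbranching ∧
      ¬ (canon₄₀ νtop (Mok2015.LeafSupport.mkN (Mok2015.LeafSupport.cm l)) κnoMok).JLLMZreciprocity ∧
      ¬ (canon₄₀ νtop (Mok2015.LeafSupport.mkN (Mok2015.LeafSupport.cm l)) κnoMok).HLLSHypQS ∧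
      ¬ (canon₄₀ νtop (Mok2015.LeafSupport.mkN (Mok2015.LeafSupport.cm l)) κnoMok).HLLSequivQS :=
  have cmod := Mok2015.LeafSupport.countermodel l
  have nm := not_M_cm l
  have b : ∀ N, νtop.Everything N := bookInputs_top.everything
  ⟨cmod.1, cmod.2.1, cmod.2.2.1, canon_implications₄₀ _ _ _, ⟨trivial, trivial, trivial, trivial⟩, b,
    fun h => nm h.2.1, fun h => nm h.1.2.1, fun h => nm h.1.2.1, fun h => nm h.2, fun h => nm h.2⟩

/-- KMSW side: in KMSW's countermodel for a leaf `l ≠ MokMain` (KMSW's edges and every other KMSW leaf hold, `l` fails;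
book and Mok at the all-ones assignment; the Mok import edge then holds), every fortieth-tranche edge valid: the nodes,
`HLLSequiv`, the quasi-split pair `HLLSHypQS` / `HLLSequivQS` and B14 hold OUTRIGHT (no KMSW premise at any order), while
B60, B56 and B41 hold exactly when `l.onlyFull` — KMSW's PROVED-scope leaves (pure inner forms of unitary groups, generic
parameters: « [KMSW14] » among the sources of the Vogan packets) are load-bearing for the arithmetic-wavefront line, the
sequels `KMS_A`, `KMS_B` and `AubertSS` are in no support, as typed. [claim: KalethaMinguezShinWhite2014, under-review] (bookkeeping proved here) -/
theorem fortieth_kmsw_cm (l : KMSW2014.LeafSupport.Leaf) (hl : l ≠ .MokMain) :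
    (∃ ωκ, KMSW2014.LeafSupport.Systems (KMSW2014.LeafSupport.mkN (KMSW2014.LeafSupport.cm l)) ωκ) ∧
      (∀ l', l' ≠ l → (KMSW2014.LeafSupport.mkN (KMSW2014.LeafSupport.cm l)).leaf l') ∧ ¬ (KMSW2014.LeafSupport.mkN (KMSW2014.LeafSupport.cm l)).leaf l ∧
      KMSW2014.E_ImportMok μtop (KMSW2014.LeafSupport.mkN (KMSW2014.LeafSupport.cm l)) ∧
      Implications40 νtop μtop (KMSW2014.LeafSupport.mkN (KMSW2014.LeafSupport.cm l)) (canon₄₀ νtop μtop (KMSW2014.LeafSupport.mkN (KMSW2014.LeafSupport.cm l))) ∧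
      ((canon₄₀ νtop μtop (KMSW2014.LeafSupport.mkN (KMSW2014.LeafSupport.cm l))).JLZvoganHyp ∧ (canon₄₀ νtop μtop (KMSW2014.LeafSupport.mkN (KMSW2014.LeafSupport.cm l))).HLLSHyp ∧ (canon₄₀ νtop μtop (KMSW2014.LeafSupport.mkN (KMSW2014.LeafSupport.cm l))).AGIKMSaubertDual ∧ (canon₄₀ νtop μtop (KMSW2014.LeafSupport.mkN (KMSW2014.LeafSupport.cm l))).HLLSequiv) ∧
      ((canon₄₀ νtop μtop (KMSW2014.LeafSupport.mkN (KMSW2014.LeafSupport.cm l))).HLLSHypQS ∧ (canon₄₀ νtop μtop (KMSW2014.LeafSupport.mkN (KMSW2014.LeafSupport.cm l))).HLLSequivQS ∧ (canon₄₀ νtop μtop (KMSW2014.LeafSupport.mkN (KMSW2014.LeafSupport.cm l))).AtobeCiubotaruWF) ∧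
      ((canon₄₀ νtop μtop (KMSW2014.LeafSupport.mkN (KMSW2014.LeafSupport.cm l))).JLZwavefront ↔ l.onlyFull = true) ∧
      ((canon₄₀ νtop μtop (KMSW2014.LeafSupport.mkN (KMSW2014.LeafSupport.cm l))).CJLZbranching ↔ l.onlyFull = true) ∧
      ((canon₄₀ νtop μtop (KMSW2014.LeafSupport.mkN (KMSW2014.LeafSupport.cm l))).JLLMZreciprocity ↔ l.onlyFull = true) := by
  have cmod := KMSW2014.LeafSupport.countermodel l
  have m : ∀ N, μtop.Everything N := mokInputs_top.everything
  have b : ∀ N, νtop.Everything N := bookInputs_top.everything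
  have hsc : (∀ N, (KMSW2014.LeafSupport.mkN (KMSW2014.LeafSupport.cm l)).Scope N) ↔ l.onlyFull = true := by
    constructor
    · intro hk
      cases hb : l.onlyFull
      · exact absurd (hk 0) (KMSW2014.LeafSupport.not_scope_of (KMSW2014.LeafSupport.scope_fails l hb 0))
      · rfl
    · intro h
      exact scope_of_onlyFull l h
  exact ⟨⟨_, cmod.1⟩, cmod.2.1, cmod.2.2.1, fun _ => cmod.2.1 .MokMain (Ne.symm hl), canon_implications₄₀ _ _ _,
    ⟨trivial, trivial, trivial, trivial⟩, ⟨⟨b, m⟩, ⟨b, m⟩, b⟩,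
    ⟨fun h => hsc.1 h.2.2, fun h => ⟨b, m, hsc.2 h⟩⟩,
    ⟨fun h => hsc.1 h.1.2.2, fun h => ⟨⟨b, m, hsc.2 h⟩, ⟨b, m, hsc.2 h⟩⟩⟩,
    ⟨fun h => hsc.1 h.1.2.2, fun h => ⟨⟨b, m, hsc.2 h⟩, ⟨b, m, hsc.2 h⟩, ⟨⟨b, m, hsc.2 h⟩, ⟨b, m, hsc.2 h⟩⟩⟩⟩⟩

/-- B60'S OWN ASSUMPTION NODE IS LOAD-BEARING FOR THE WHOLE ARITHMETIC-WAVEFRONT LINE, AS TYPED.  In the all-ones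
assignment of the three DAGs there is a fortieth-tranche assignment satisfying EVERY fortieth-tranche edge in which the
node `JLZvoganHyp` and B60, B56, B41 are FALSE while B26's four fields and B14 (with their nodes) are TRUE.  The typed form
of Jiang – Liu – Zhang's « still in progress for some cases of even special orthogonal groups … we may have to consider it
as an assumption for those incomplete cases », inherited by B56 (through [JLZ22, Theorem 5.3]) and by B41 (through [JLZ25]
and [CJLZ24]). [cite: JiangLiuZhang2025Wavefront, §3.1 p0016:L58-60; ChenJiangLiuZhang2024Branching, §3 p0015:L37; JiangLiuLuoMaZhang2026Wavefront, proof of Thm 2.5 p0011:L19-39 (bookkeeping proved here)] -/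
theorem arithmeticWavefront_needs_node :
    ∃ c₄₀ : Consumers40,
      BookInputs νtop ∧ MokInputs μtop ∧ KMSWInputs μtop κtop ∧ κtop.UnwrittenSequels ∧
      (∀ l : Mok2015.LeafSupport.Leaf, μtop.leaf l) ∧ (∀ l : KMSW2014.LeafSupport.Leaf, κtop.leaf l) ∧
      Implications40 νtop μtop κtop c₄₀ ∧
      ¬ c₄₀.JLZvoganHyp ∧ ¬ c₄₀.JLZwavefront ∧ ¬ c₄₀.CJLZbranching ∧ ¬ c₄₀.JLLMZreciprocity ∧
      (c₄₀.HLLSHyp ∧ c₄₀.HLLSHypQS ∧ c₄₀.HLLSequiv ∧ c₄₀.HLLSequivQS) ∧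
      (c₄₀.AGIKMSaubertDual ∧ c₄₀.AtobeCiubotaruWF) :=
  have KQ := kmswInputs_top μtop
  have m : ∀ N, μtop.Everything N := mokInputs_top.everything
  have b : ∀ N, νtop.Everything N := bookInputs_top.everything
  ⟨canon₄₀noJLZ νtop μtop, bookInputs_top, mokInputs_top, KQ.1, KQ.2, mokLeaves_top, kmswLeaves_top,
    canon_implications₄₀noJLZ νtop μtop κtop, id, id, id, id, ⟨trivial, ⟨b, m⟩, trivial, ⟨b, m⟩⟩, ⟨trivial, b⟩⟩

/-- B26'S HYPOTHESIS IS ITS WHOLE SUPPORT, AS PRINTED AND AS TYPED.  In the all-ones assignment of the three DAGs there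
is a fortieth-tranche assignment satisfying EVERY fortieth-tranche edge in which the node `HLLSHyp` and `HLLSequiv` are
FALSE while every other field — including the quasi-split pair `HLLSHypQS`, `HLLSequivQS` — is TRUE: the theorems as
stated (« Assume the local Langlands correspondence … », « Assume there is a local Arthur packets theory for G ») display
no leaf of the three DAGs in the kernel; only their quasi-split instance does (sections `fortieth_book_cm`,
`fortieth_mok_cm`). [cite: HazeltineLiuLoShahidi2024Wavefront, Conj. 1.1 p0001:L34-35, Thm 1.5 p0003:L17, §6.1 p0016:L23-30 (bookkeeping proved here)] -/
theorem hllsEquiv_needs_node :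
    ∃ c₄₀ : Consumers40,
      BookInputs νtop ∧ MokInputs μtop ∧ KMSWInputs μtop κtop ∧ κtop.UnwrittenSequels ∧
      (∀ l : Mok2015.LeafSupport.Leaf, μtop.leaf l) ∧ (∀ l : KMSW2014.LeafSupport.Leaf, κtop.leaf l) ∧
      Implications40 νtop μtop κtop c₄₀ ∧
      ¬ c₄₀.HLLSHyp ∧ ¬ c₄₀.HLLSequiv ∧
      (c₄₀.HLLSHypQS ∧ c₄₀.HLLSequivQS) ∧
      (c₄₀.JLZvoganHyp ∧ c₄₀.JLZwavefront ∧ c₄₀.CJLZbranching ∧ c₄₀.JLLMZreciprocity) ∧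
      (c₄₀.AGIKMSaubertDual ∧ c₄₀.AtobeCiubotaruWF) :=
  have KQ := kmswInputs_top μtop
  have m : ∀ N, μtop.Everything N := mokInputs_top.everything
  have b : ∀ N, νtop.Everything N := bookInputs_top.everything
  have k : ∀ N, κtop.Scope N := KQ.1.scope mokInputs_top
  ⟨canon₄₀noHLLS νtop μtop κtop, bookInputs_top, mokInputs_top, KQ.1, KQ.2, mokLeaves_top, kmswLeaves_top,
    canon_implications₄₀noHLLS νtop μtop κtop, id, id, ⟨⟨b, m⟩, ⟨b, m⟩⟩,
    ⟨trivial, ⟨b, m, k⟩, ⟨⟨b, m, k⟩, ⟨b, m, k⟩⟩, ⟨⟨b, m, k⟩, ⟨b, m, k⟩, ⟨⟨b, m, k⟩, ⟨b, m, k⟩⟩⟩⟩, ⟨trivial, b⟩⟩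

/-- THE AGIKMS STATEMENT IS LOAD-BEARING FOR B14, AS CITED.  In the all-ones assignment of the three DAGs there is a
fortieth-tranche assignment satisfying EVERY fortieth-tranche edge in which the node `AGIKMSaubertDual` and B14 are FALSE
while every other field is TRUE.  The typed form of Atobe – Ciubotaru's « As explained in [AGIKMS], we have Π_ψ̂ = {π̂ | π
∈ Π_ψ} »: as printed, the wavefront sets of A-packets of split classical groups rest on a statement of the 2024–26
preprint arXiv:2410.13504 outside the book's typed leaves, beside the book itself. [cite: AtobeCiubotaru2026Wavefront, §1.3 p0004:L30-33 with Thm 1.4 (bookkeeping proved here)] -/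
theorem atobeCiubotaruWF_needs_node :
    ∃ c₄₀ : Consumers40,
      BookInputs νtop ∧ MokInputs μtop ∧ KMSWInputs μtop κtop ∧ κtop.UnwrittenSequels ∧
      (∀ l : Mok2015.LeafSupport.Leaf, μtop.leaf l) ∧ (∀ l : KMSW2014.LeafSupport.Leaf, κtop.leaf l) ∧
      Implications40 νtop μtop κtop c₄₀ ∧
      ¬ c₄₀.AGIKMSaubertDual ∧ ¬ c₄₀.AtobeCiubotaruWF ∧
      (c₄₀.JLZvoganHyp ∧ c₄₀.JLZwavefront ∧ c₄₀.CJLZbranching ∧ c₄₀.JLLMZreciprocity) ∧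
      (c₄₀.HLLSHyp ∧ c₄₀.HLLSHypQS ∧ c₄₀.HLLSequiv ∧ c₄₀.HLLSequivQS) :=
  have KQ := kmswInputs_top μtop
  have m : ∀ N, μtop.Everything N := mokInputs_top.everything
  have b : ∀ N, νtop.Everything N := bookInputs_top.everything
  have k : ∀ N, κtop.Scope N := KQ.1.scope mokInputs_top
  ⟨canon₄₀noAGIKMS νtop μtop κtop, bookInputs_top, mokInputs_top, KQ.1, KQ.2, mokLeaves_top, kmswLeaves_top,
    canon_implications₄₀noAGIKMS νtop μtop κtop, id, id,
    ⟨trivial, ⟨b, m, k⟩, ⟨⟨b, m, k⟩, ⟨b, m, k⟩⟩, ⟨⟨b, m, k⟩, ⟨b, m, k⟩, ⟨⟨b, m, k⟩, ⟨b, m, k⟩⟩⟩⟩,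
    ⟨trivial, ⟨b, m⟩, trivial, ⟨b, m⟩⟩⟩

/-! ## 44. Forty-first tranche (v1.2 of this file, after `Downstream10.lean` v1): supports of the wavefront line, II —
B106 (`JiangLiuWF` as stated, `JiangLiuWFqs` its quasi-split instance), B107 (`LiuShahidiJiang`), B31 (`HLLZclosure`,
over rows B2, B5, B42, B101), B17 (`LiuLoWeak`, over B31) — see the module docstring for the summary of what is
certified. -/

section Canon41

variable (ν : Nodes) (μ : Mok2015.Nodes) (κ : KMSW2014.Nodes)

/-- The canonical reading of the forty-first tranche: each field := the conjunction of the canonical values of its premises (book, Mok, KMSW's starred theorems in full for B106 as stated; book, Mok for its quasi-split instance; book for B107; book and the canonical values of rows B2, B5, B42 (`canon₂`, `canon₅`) and B101 (`canon₂₆`) for B31; book and B31's value for B17). [cite: JiangLiu2024Wavefront, Thm 1.3; LiuShahidi2026Jiang, Thm 1.9; HazeltineLiuLoZhang2025Closure, Thm 1.15; LiuLo2024Weak, Thm 1.5 (canonical model; bookkeeping)] -/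
abbrev canon₄₁ : Consumers41 where
  JiangLiuWF := (∀ N, ν.Everything N) ∧ (∀ N, μ.Everything N) ∧ (∀ N, κ.Full N)
  JiangLiuWFqs := (∀ N, ν.Everything N) ∧ (∀ N, μ.Everything N)
  LiuShahidiJiang := ∀ N, ν.Everything N
  HLLZclosure := (∀ N, ν.Everything N) ∧ (canon₂ ν μ κ).XuMoeglinParam ∧ (canon₅ ν μ κ).AtobeApackets ∧
    (canon₅ ν μ κ).AtobeMinguez ∧ (canon₂₆ ν μ κ).HLL
  LiuLoWeak := (∀ N, ν.Everything N) ∧ ((∀ N, ν.Everything N) ∧ (canon₂ ν μ κ).XuMoeglinParam ∧ (canon₅ ν μ κ).AtobeApackets ∧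
    (canon₅ ν μ κ).AtobeMinguez ∧ (canon₂₆ ν μ κ).HLL)

/-- The five forty-first-tranche edges hold in the canonical reading, for arbitrary ν, μ, κ. [cite: JiangLiu2024Wavefront, Thm 1.3; LiuShahidi2026Jiang, Thm 1.9; HazeltineLiuLoZhang2025Closure, Thm 1.15; LiuLo2024Weak, Thm 1.5 (bookkeeping proved here)] -/
theorem canon_implications₄₁ : Implications41 ν μ κ (canon₂ ν μ κ) (canon₅ ν μ κ) (canon₂₆ ν μ κ) (canon₄₁ ν μ κ) where
  jiangLiuWF := fun h0 h1 h2 => ⟨h0, h1, h2⟩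
  jiangLiuWFqs := fun h0 h1 => ⟨h0, h1⟩
  liuShahidiJiang := fun h => h
  hllzClosure := fun h0 h2 h5 h42 h101 => ⟨h0, h2, h5, h42, h101⟩
  liuLoWeak := fun h0 h31 => ⟨h0, h31⟩

/-- The forty-first-tranche reading over the DENIED row B101 (`canon₂₆noB101` of section 28): B31 and B17 false with it; B106 (both readings) and B107 as in `canon₄₁`. [cite: HazeltineLiuLoZhang2025Closure, §1 p0002:L9; LiuLo2024Weak, §2.4 p0010:L4 (separating model; bookkeeping)] -/
abbrev canon₄₁noB31 : Consumers41 where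
  JiangLiuWF := (∀ N, ν.Everything N) ∧ (∀ N, μ.Everything N) ∧ (∀ N, κ.Full N)
  JiangLiuWFqs := (∀ N, ν.Everything N) ∧ (∀ N, μ.Everything N)
  LiuShahidiJiang := ∀ N, ν.Everything N
  HLLZclosure := False
  LiuLoWeak := False

/-- Every forty-first-tranche edge holds in the reading over the denied B101 (B31's edge receives B101 = `False`; B17's receives B31 = `False`). [cite: HazeltineLiuLoZhang2025Closure, §1 p0002:L9; LiuLo2024Weak, §2.4 p0010:L4 (bookkeeping proved here)] -/
theorem canon_implications₄₁noB31 : Implications41 ν μ κ (canon₂ ν μ κ) (canon₅ ν μ κ) (canon₂₆noB101 ν μ κ) (canon₄₁noB31 ν μ κ) where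
  jiangLiuWF := fun h0 h1 h2 => ⟨h0, h1, h2⟩
  jiangLiuWFqs := fun h0 h1 => ⟨h0, h1⟩
  liuShahidiJiang := fun h => h
  hllzClosure := fun _ _ _ _ h => h.elim
  liuLoWeak := fun _ h => h.elim
end Canon41

/-- With every input of the three DAGs granted (all-ones assignments; KMSW WITH its two sequels) every field of the
forty-first tranche holds, through the tranche's own bookkeeping theorem `wavefrontLineII_of_inputs` and the canonical
certificates of tranches 2, 5, 26. [cite: JiangLiu2024Wavefront, Thm 1.3; LiuShahidi2026Jiang, Thm 1.9; HazeltineLiuLoZhang2025Closure, Thm 1.15; LiuLo2024Weak, Thm 1.5 (bookkeeping proved here)] -/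
theorem fortyfirst_holds_top :
    ((canon₄₁ νtop μtop κtop).JiangLiuWF ∧ (canon₄₁ νtop μtop κtop).JiangLiuWFqs) ∧ (canon₄₁ νtop μtop κtop).LiuShahidiJiang ∧ (canon₄₁ νtop μtop κtop).HLLZclosure ∧
      (canon₄₁ νtop μtop κtop).LiuLoWeak :=
  wavefrontLineII_of_inputs (canon_implications₄₁ νtop μtop κtop) (canon_implications₂ νtop μtop κtop)
    (canon_implications₅ νtop μtop κtop) (canon_implications₂₆ νtop μtop κtop) bookInputs_top mokInputs_top
    (kmswInputs_top μtop).1 (kmswInputs_top μtop).2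

/-- BOOK side: in each of the 24 book countermodels (book edge systems and every other book leaf hold, the removed leaf
fails; Mok and KMSW at the all-ones assignment; canonical readings of tranches 2, 5, 26 and 41, all forty-first-tranche
edges valid) ALL FIVE fields FAIL — every book leaf is load-bearing, as typed, for the global upper bound of Jiang – Liu
(« Theorem 1.1 (Theorem 1.5.2, [Ar13]) », both readings), for Liu – Shahidi's theorems towards Jiang's conj. (« Theorem
2.1 (Art13) »), for the closure ordering of Hazeltine – Liu – Lo – Zhang (« Theorem 2.6 ( [Art13]) », and through B2, B5,
B42, B101) and for Liu – Lo's weak packets (« In [ Art13], … he constructed », and through B31). [cite: JiangLiu2024Wavefront, §1 p0004:L6; LiuShahidi2026Jiang, §2 p0008:L51; HazeltineLiuLoZhang2025Closure, §2.3 p0010:L77; LiuLo2024Weak, §2.3 p0009:L13, with Arthur2013 §1.5 (bookkeeping proved here)] -/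
theorem fortyfirst_book_cm (l : LeafSupport.Leaf) :
    LeafSupport.Systems (LeafSupport.mkN (LeafSupport.cm l)) (LeafSupport.mkW (LeafSupport.cm l)) (LeafSupport.mkG (LeafSupport.cm l)) ∧
      (∀ l', l' ≠ l → (LeafSupport.mkN (LeafSupport.cm l)).leaf l') ∧ ¬ (LeafSupport.mkN (LeafSupport.cm l)).leaf l ∧
      Implications41 (LeafSupport.mkN (LeafSupport.cm l)) μtop κtop (canon₂ (LeafSupport.mkN (LeafSupport.cm l)) μtop κtop) (canon₅ (LeafSupport.mkN (LeafSupport.cm l)) μtop κtop) (canon₂₆ (LeafSupport.mkN (LeafSupport.cm l)) μtop κtop) (canon₄₁ (LeafSupport.mkN (LeafSupport.cm l)) μtop κtop) ∧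
      ¬ (canon₄₁ (LeafSupport.mkN (LeafSupport.cm l)) μtop κtop).JiangLiuWF ∧
      ¬ (canon₄₁ (LeafSupport.mkN (LeafSupport.cm l)) μtop κtop).JiangLiuWFqs ∧
      ¬ (canon₄₁ (LeafSupport.mkN (LeafSupport.cm l)) μtop κtop).LiuShahidiJiang ∧
      ¬ (canon₄₁ (LeafSupport.mkN (LeafSupport.cm l)) μtop κtop).HLLZclosure ∧
      ¬ (canon₄₁ (LeafSupport.mkN (LeafSupport.cm l)) μtop κtop).LiuLoWeak :=
  have cmod := LeafSupport.countermodel l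
  ⟨cmod.1, cmod.2.1, cmod.2.2.1, canon_implications₄₁ _ _ _,
    fun h => not_B_cm l h.1, fun h => not_B_cm l h.1, fun h => not_B_cm l h, fun h => not_B_cm l h.1,
    fun h => not_B_cm l h.1⟩

/-- MOK side: in each of Mok's 29 countermodels (Mok's edges and every other Mok leaf hold, the removed leaf fails; the
book at the all-ones assignment; KMSW read without its import of Mok, `κnoMok`), every forty-first-tranche edge valid
over the canonical reading: B106 in BOTH readings FAILS, while B107, B31, B17 HOLD — every Mok leaf is load-bearing, as
typed, for the global upper bound (quasi-split unitary groups U_n among Jiang – Liu's G_n: « the global Arthur parameter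
attached to π ( [Ar13], [Mok15], [KMSW14]) ») and for nothing else in the tranche (B107, B31, B17 concern symplectic and
orthogonal groups only). [cite: JiangLiu2024Wavefront, §1 p0003:L25, §4 p0011:L69, with Mok2012 §2.5 (bookkeeping proved here)] -/
theorem fortyfirst_mok_cm (l : Mok2015.LeafSupport.Leaf) :
    Mok2015.LeafSupport.Systems (Mok2015.LeafSupport.mkN (Mok2015.LeafSupport.cm l)) ∧
      (∀ l', l' ≠ l → (Mok2015.LeafSupport.mkN (Mok2015.LeafSupport.cm l)).leaf l') ∧ ¬ (Mok2015.LeafSupport.mkN (Mok2015.LeafSupport.cm l)).leaf l ∧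
      Implications41 νtop (Mok2015.LeafSupport.mkN (Mok2015.LeafSupport.cm l)) κnoMok (canon₂ νtop (Mok2015.LeafSupport.mkN (Mok2015.LeafSupport.cm l)) κnoMok) (canon₅ νtop (Mok2015.LeafSupport.mkN (Mok2015.LeafSupport.cm l)) κnoMok) (canon₂₆ νtop (Mok2015.LeafSupport.mkN (Mok2015.LeafSupport.cm l)) κnoMok) (canon₄₁ νtop (Mok2015.LeafSupport.mkN (Mok2015.LeafSupport.cm l)) κnoMok) ∧
      ((canon₄₁ νtop (Mok2015.LeafSupport.mkN (Mok2015.LeafSupport.cm l)) κnoMok).LiuShahidiJiang ∧ (canon₄₁ νtop (Mok2015.LeafSupport.mkN (Mok2015.LeafSupport.cm l)) κnoMok).HLLZclosure ∧ (canon₄₁ νtop (Mok2015.LeafSupport.mkN (Mok2015.LeafSupport.cm l)) κnoMok).LiuLoWeak) ∧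
      ¬ (canon₄₁ νtop (Mok2015.LeafSupport.mkN (Mok2015.LeafSupport.cm l)) κnoMok).JiangLiuWF ∧
      ¬ (canon₄₁ νtop (Mok2015.LeafSupport.mkN (Mok2015.LeafSupport.cm l)) κnoMok).JiangLiuWFqs :=
  have cmod := Mok2015.LeafSupport.countermodel l
  have nm := not_M_cm l
  have b : ∀ N, νtop.Everything N := bookInputs_top.everything
  ⟨cmod.1, cmod.2.1, cmod.2.2.1, canon_implications₄₁ _ _ _, ⟨b, ⟨b, b, b, b, b, b⟩, ⟨b, b, b, b, b, b, b⟩⟩,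
    fun h => nm h.2.1, fun h => nm h.2⟩

/-- KMSW side: in KMSW's countermodel for ANY leaf `l ≠ MokMain` (KMSW's edges and every other KMSW leaf hold, `l`
fails; book and Mok at the all-ones assignment; the Mok import edge then holds), every forty-first-tranche edge valid:
B106 AS STATED (which takes KMSW's Theorem* 1.7.1 in full, for the inner forms of unitary groups with arbitrary
parameters) FAILS for every such `l` — the sequels `KMS_A`, `KMS_B`, the leaf `AubertSS` and every proved-scope leaf
alike are load-bearing —, while its quasi-split instance, B107, B31 and B17 hold OUTRIGHT (no KMSW premise at any
order). [claim: KalethaMinguezShinWhite2014, under-review] [cite: JiangLiu2024Wavefront, §1 p0003:L15-16, L25 (bookkeeping proved here)] -/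
theorem fortyfirst_kmsw_cm (l : KMSW2014.LeafSupport.Leaf) (hl : l ≠ .MokMain) :
    (∃ ωκ, KMSW2014.LeafSupport.Systems (KMSW2014.LeafSupport.mkN (KMSW2014.LeafSupport.cm l)) ωκ) ∧
      (∀ l', l' ≠ l → (KMSW2014.LeafSupport.mkN (KMSW2014.LeafSupport.cm l)).leaf l') ∧ ¬ (KMSW2014.LeafSupport.mkN (KMSW2014.LeafSupport.cm l)).leaf l ∧
      KMSW2014.E_ImportMok μtop (KMSW2014.LeafSupport.mkN (KMSW2014.LeafSupport.cm l)) ∧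
      Implications41 νtop μtop (KMSW2014.LeafSupport.mkN (KMSW2014.LeafSupport.cm l)) (canon₂ νtop μtop (KMSW2014.LeafSupport.mkN (KMSW2014.LeafSupport.cm l))) (canon₅ νtop μtop (KMSW2014.LeafSupport.mkN (KMSW2014.LeafSupport.cm l))) (canon₂₆ νtop μtop (KMSW2014.LeafSupport.mkN (KMSW2014.LeafSupport.cm l))) (canon₄₁ νtop μtop (KMSW2014.LeafSupport.mkN (KMSW2014.LeafSupport.cm l))) ∧
      ¬ (canon₄₁ νtop μtop (KMSW2014.LeafSupport.mkN (KMSW2014.LeafSupport.cm l))).JiangLiuWF ∧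
      ((canon₄₁ νtop μtop (KMSW2014.LeafSupport.mkN (KMSW2014.LeafSupport.cm l))).JiangLiuWFqs ∧ (canon₄₁ νtop μtop (KMSW2014.LeafSupport.mkN (KMSW2014.LeafSupport.cm l))).LiuShahidiJiang ∧ (canon₄₁ νtop μtop (KMSW2014.LeafSupport.mkN (KMSW2014.LeafSupport.cm l))).HLLZclosure ∧ (canon₄₁ νtop μtop (KMSW2014.LeafSupport.mkN (KMSW2014.LeafSupport.cm l))).LiuLoWeak) :=
  have cmod := KMSW2014.LeafSupport.countermodel l
  have nf : ¬ ∀ N, (KMSW2014.LeafSupport.mkN (KMSW2014.LeafSupport.cm l)).Full N :=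
    fun h => KMSW2014.LeafSupport.not_full_of_noFull (cmod.2.2.2 0) (h 0)
  have b : ∀ N, νtop.Everything N := bookInputs_top.everything
  have m : ∀ N, μtop.Everything N := mokInputs_top.everything
  ⟨⟨_, cmod.1⟩, cmod.2.1, cmod.2.2.1, fun _ => cmod.2.1 .MokMain (Ne.symm hl), canon_implications₄₁ _ _ _,
    fun h => nf h.2.2, ⟨⟨b, m⟩, b, ⟨b, b, b, b, b, b⟩, ⟨b, b, b, b, b, b, b⟩⟩⟩

/-- THE UNWRITTEN SEQUEL [KMS_A] IS LOAD-BEARING FOR JIANG – LIU'S THEOREM 1.3 AS STATED, NOT FOR ITS QUASI-SPLIT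
INSTANCE: the instance `l = KMS_A` of `fortyfirst_kmsw_cm` — KMSW's edges, every KMSW leaf except `KMS_A`, the book
and Mok at the top, every forty-first-tranche edge —, in which `JiangLiuWF` is FALSE and `JiangLiuWFqs` TRUE.  The typed
form of « the global Arthur parameter attached to π ( [Ar13], [Mok15], [KMSW14]) » for « RU_n, quasi-split or inner
forms »: KMSW's Theorem* 1.7.1 « will be completely proved in [KMS_A] … and in [KMS_B] in general ». [claim: KalethaMinguezShinWhite2014, under-review] [cite: JiangLiu2024Wavefront, §1 p0003:L16, L25 (bookkeeping proved here)] -/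
theorem jiangLiuWF_needs_sequel_A :
    (∀ l', l' ≠ KMSW2014.LeafSupport.Leaf.KMS_A → (KMSW2014.LeafSupport.mkN (KMSW2014.LeafSupport.cm .KMS_A)).leaf l') ∧ ¬ (KMSW2014.LeafSupport.mkN (KMSW2014.LeafSupport.cm .KMS_A)).leaf .KMS_A ∧
      Implications41 νtop μtop (KMSW2014.LeafSupport.mkN (KMSW2014.LeafSupport.cm .KMS_A)) (canon₂ νtop μtop (KMSW2014.LeafSupport.mkN (KMSW2014.LeafSupport.cm .KMS_A))) (canon₅ νtop μtop (KMSW2014.LeafSupport.mkN (KMSW2014.LeafSupport.cm .KMS_A))) (canon₂₆ νtop μtop (KMSW2014.LeafSupport.mkN (KMSW2014.LeafSupport.cm .KMS_A))) (canon₄₁ νtop μtop (KMSW2014.LeafSupport.mkN (KMSW2014.LeafSupport.cm .KMS_A))) ∧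
      ¬ (canon₄₁ νtop μtop (KMSW2014.LeafSupport.mkN (KMSW2014.LeafSupport.cm .KMS_A))).JiangLiuWF ∧ (canon₄₁ νtop μtop (KMSW2014.LeafSupport.mkN (KMSW2014.LeafSupport.cm .KMS_A))).JiangLiuWFqs :=
  have h := fortyfirst_kmsw_cm .KMS_A (by decide)
  ⟨h.2.1, h.2.2.1, h.2.2.2.2.1, h.2.2.2.2.2.1, h.2.2.2.2.2.2.1⟩

/-- ROW B101 IS LOAD-BEARING FOR THE CLOSURE ORDERING AND THE WEAK PACKETS, AS TYPED.  In the all-ones assignment of the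
three DAGs there is a forty-first-tranche assignment, over the canonical rows B2, B5, B42 and the DENIED row B101
(`canon₂₆noB101`), satisfying EVERY forty-first-tranche edge, in which B31 and B17 are FALSE while B106 (both
readings) and B107 are TRUE.  The typed form of Hazeltine – Liu – Lo – Zhang's « Our key ingredients … are the operators
developed in [HLL22] » and, one step further down, of Liu – Lo's « These statements follow from [ HLLZ22, Lemma 6.2,
6.4] ». [cite: HazeltineLiuLoZhang2025Closure, §1 p0002:L9, p0004:L20-47; LiuLo2024Weak, §2.3–2.4 p0009:L66-68, p0010:L4 (bookkeeping proved here)] -/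
theorem closureLine_needs_B101 :
    ∃ c₂₆ : Consumers26, ∃ c₄₁ : Consumers41,
      BookInputs νtop ∧ MokInputs μtop ∧ KMSWInputs μtop κtop ∧ κtop.UnwrittenSequels ∧
      (∀ l : Mok2015.LeafSupport.Leaf, μtop.leaf l) ∧ (∀ l : KMSW2014.LeafSupport.Leaf, κtop.leaf l) ∧
      Implications41 νtop μtop κtop (canon₂ νtop μtop κtop) (canon₅ νtop μtop κtop) c₂₆ c₄₁ ∧
      ((canon₂ νtop μtop κtop).XuMoeglinParam ∧ (canon₅ νtop μtop κtop).AtobeApackets ∧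
        (canon₅ νtop μtop κtop).AtobeMinguez) ∧
      ¬ c₂₆.HLL ∧ ¬ c₄₁.HLLZclosure ∧ ¬ c₄₁.LiuLoWeak ∧
      (c₄₁.JiangLiuWF ∧ c₄₁.JiangLiuWFqs ∧ c₄₁.LiuShahidiJiang) :=
  have KQ := kmswInputs_top μtop
  have m : ∀ N, μtop.Everything N := mokInputs_top.everything
  have b : ∀ N, νtop.Everything N := bookInputs_top.everything
  have f : ∀ N, κtop.Full N := KQ.1.full mokInputs_top KQ.2
  ⟨canon₂₆noB101 νtop μtop κtop, (canon₄₁noB31 νtop μtop κtop), bookInputs_top, mokInputs_top, KQ.1, KQ.2, mokLeaves_top,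
    kmswLeaves_top, canon_implications₄₁noB31 νtop μtop κtop, ⟨b, b, b⟩, id, id, id, ⟨⟨b, m, f⟩, ⟨b, m⟩, b⟩⟩

/-! ## 45. Forty-second tranche (v1.3 of this file, after `Downstream10.lean` v2): supports of the unipotent clauses — B26
§11 (`HLLSunipQS`), B17's « in particular » clauses (`LiuLoWeakIP`), B107's Theorem 1.14 (`LiuShahidi114`) — see the module
docstring for the summary of what is certified. -/

section Canon42

variable (ν : Nodes) (μ : Mok2015.Nodes) (κ : KMSW2014.Nodes)

/-- The canonical reading of the forty-second tranche, over `canon₄₀` (tranche 40) and `canon₄₁` (tranche 41): `HLLSunipQS` := the canonical `HLLSHypQS` ∧ `HLLSequivQS` ∧ B31; `LiuLoWeakIP` := the canonical B17 ∧ that; `LiuShahidi114` := book ∧ the canonical B107 ∧ that. [cite: HazeltineLiuLoShahidi2024Wavefront, Rem. 11.5; LiuLo2024Weak, Thm 1.5; LiuShahidi2026Jiang, Thm 1.14 (canonical model; bookkeeping)] -/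
abbrev canon₄₂ : Consumers42 where
  HLLSunipQS := (canon₄₀ ν μ κ).HLLSHypQS ∧ (canon₄₀ ν μ κ).HLLSequivQS ∧ (canon₄₁ ν μ κ).HLLZclosure
  LiuLoWeakIP := (canon₄₁ ν μ κ).LiuLoWeak ∧ ((canon₄₀ ν μ κ).HLLSHypQS ∧ (canon₄₀ ν μ κ).HLLSequivQS ∧ (canon₄₁ ν μ κ).HLLZclosure)
  LiuShahidi114 := (∀ N, ν.Everything N) ∧ (canon₄₁ ν μ κ).LiuShahidiJiang ∧
    ((canon₄₀ ν μ κ).HLLSHypQS ∧ (canon₄₀ ν μ κ).HLLSequivQS ∧ (canon₄₁ ν μ κ).HLLZclosure)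

/-- The three forty-second-tranche edges hold in the canonical reading, for arbitrary ν, μ, κ. [cite: HazeltineLiuLoShahidi2024Wavefront, Rem. 11.5; LiuLo2024Weak, Thm 1.5; LiuShahidi2026Jiang, Thm 1.14 (bookkeeping proved here)] -/
theorem canon_implications₄₂ : Implications42 ν (canon₄₀ ν μ κ) (canon₄₁ ν μ κ) (canon₄₂ ν μ κ) where
  hllsUnipQS := fun a e h => ⟨a, e, h⟩
  liuLoWeakIP := fun a h => ⟨a, h⟩
  liuShahidi114 := fun b a h => ⟨b, a, h⟩

/-- The forty-second-tranche reading INDUCED over the DENIED row B101 of section 28 (`canon₂₆noB101`) and section 44's `canon₄₁noB31`, by the same recipe as `canon₄₂`: each of the three clauses then carries the conjunct B31 = `False` (resp. B17 = `False`), hence fails. [cite: HazeltineLiuLoShahidi2024Wavefront, Rem. 11.5 « (Theorem 6.3) » (separating model; bookkeeping)] -/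
abbrev canon₄₂noB31 : Consumers42 where
  HLLSunipQS := (canon₄₀ ν μ κ).HLLSHypQS ∧ (canon₄₀ ν μ κ).HLLSequivQS ∧ (canon₄₁noB31 ν μ κ).HLLZclosure
  LiuLoWeakIP := (canon₄₁noB31 ν μ κ).LiuLoWeak ∧ ((canon₄₀ ν μ κ).HLLSHypQS ∧ (canon₄₀ ν μ κ).HLLSequivQS ∧ (canon₄₁noB31 ν μ κ).HLLZclosure)
  LiuShahidi114 := (∀ N, ν.Everything N) ∧ (canon₄₁noB31 ν μ κ).LiuShahidiJiang ∧
    ((canon₄₀ ν μ κ).HLLSHypQS ∧ (canon₄₀ ν μ κ).HLLSequivQS ∧ (canon₄₁noB31 ν μ κ).HLLZclosure)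

/-- Every forty-second-tranche edge holds in the induced reading over the denied B101 (same certificate as `canon_implications₄₂`, now over `canon₄₁noB31`). [cite: HazeltineLiuLoShahidi2024Wavefront, Rem. 11.5 (bookkeeping proved here)] -/
theorem canon_implications₄₂noB31 : Implications42 ν (canon₄₀ ν μ κ) (canon₄₁noB31 ν μ κ) (canon₄₂noB31 ν μ κ) where
  hllsUnipQS := fun a e h => ⟨a, e, h⟩
  liuLoWeakIP := fun a h => ⟨a, h⟩
  liuShahidi114 := fun b a h => ⟨b, a, h⟩
end Canon42

/-- With every input of the three DAGs granted, the three unipotent clauses hold, through the tranche's own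
`unipotentClauses_of_inputs` and the canonical certificates of tranches 2, 5, 26, 40, 41. [cite: HazeltineLiuLoShahidi2024Wavefront, Rem. 11.5; LiuLo2024Weak, Thm 1.5; LiuShahidi2026Jiang, Thm 1.14 (bookkeeping proved here)] -/
theorem fortysecond_holds_top :
    (canon₄₂ νtop μtop κtop).HLLSunipQS ∧ (canon₄₂ νtop μtop κtop).LiuLoWeakIP ∧ (canon₄₂ νtop μtop κtop).LiuShahidi114 :=
  unipotentClauses_of_inputs (canon_implications₄₂ νtop μtop κtop) (canon_implications₄₀ νtop μtop κtop)
    (canon_implications₄₁ νtop μtop κtop) (canon_implications₂ νtop μtop κtop) (canon_implications₅ νtop μtop κtop)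
    (canon_implications₂₆ νtop μtop κtop) bookInputs_top mokInputs_top

/-- BOOK side: in each of the 24 book countermodels (Mok and KMSW at the all-ones assignment; canonical readings of
tranches 2, 5, 26, 40, 41, 42, all forty-second-tranche edges valid) ALL THREE clauses FAIL — every book leaf is
load-bearing, as typed, for B26's unipotent theorem (« [Art13, Proposition 7.4.1] », Prop. 6.1; and through B31), for
B17's unconditional weak-packet clause and for B107's Theorem 1.14 (« Theorem 2.1 (Art13) » through Theorem 1.13). [cite: HazeltineLiuLoShahidi2024Wavefront, §11 p0031:L8; LiuLo2024Weak, Thm 1.5 p0004:L50-51; LiuShahidi2026Jiang, Thm 1.14, with Arthur2013 §1.5 (bookkeeping proved here)] -/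
theorem fortysecond_book_cm (l : LeafSupport.Leaf) :
    LeafSupport.Systems (LeafSupport.mkN (LeafSupport.cm l)) (LeafSupport.mkW (LeafSupport.cm l)) (LeafSupport.mkG (LeafSupport.cm l)) ∧
      (∀ l', l' ≠ l → (LeafSupport.mkN (LeafSupport.cm l)).leaf l') ∧ ¬ (LeafSupport.mkN (LeafSupport.cm l)).leaf l ∧
      Implications42 (LeafSupport.mkN (LeafSupport.cm l)) (canon₄₀ (LeafSupport.mkN (LeafSupport.cm l)) μtop κtop) (canon₄₁ (LeafSupport.mkN (LeafSupport.cm l)) μtop κtop) (canon₄₂ (LeafSupport.mkN (LeafSupport.cm l)) μtop κtop) ∧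
      ¬ (canon₄₂ (LeafSupport.mkN (LeafSupport.cm l)) μtop κtop).HLLSunipQS ∧
      ¬ (canon₄₂ (LeafSupport.mkN (LeafSupport.cm l)) μtop κtop).LiuLoWeakIP ∧
      ¬ (canon₄₂ (LeafSupport.mkN (LeafSupport.cm l)) μtop κtop).LiuShahidi114 :=
  have cmod := LeafSupport.countermodel l
  ⟨cmod.1, cmod.2.1, cmod.2.2.1, canon_implications₄₂ _ _ _,
    fun h => not_B_cm l h.1.1, fun h => not_B_cm l h.1.1, fun h => not_B_cm l h.1⟩

/-- MOK side: in each of Mok's 29 countermodels (book at the all-ones assignment; KMSW read without its import of Mok),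
every forty-second-tranche edge valid: ALL THREE clauses FAIL, AS TYPED — Mok's leaves reach the three symplectic /
odd-orthogonal statements only through the quasi-split node `HLLSHypQS` of tranche 40, typed ⇐ book ∧ Mok after B26's
joint supplier sentence « the existence of Π_ψ is proved in [Art13, Mok15] » for all quasi-split classical groups; the
register records this as an artefact of B26's uniform assumption, not as a use of Mok's theorems by Liu – Lo or Liu –
Shahidi (whose groups are Sp_{2n}, SO_{2n+1}). [cite: HazeltineLiuLoShahidi2024Wavefront, §6.1 p0016:L23-24 with §11; LiuLo2024Weak, Thm 1.4; LiuShahidi2026Jiang, Thm 1.11 (bookkeeping proved here)] -/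
theorem fortysecond_mok_cm (l : Mok2015.LeafSupport.Leaf) :
    Mok2015.LeafSupport.Systems (Mok2015.LeafSupport.mkN (Mok2015.LeafSupport.cm l)) ∧
      (∀ l', l' ≠ l → (Mok2015.LeafSupport.mkN (Mok2015.LeafSupport.cm l)).leaf l') ∧ ¬ (Mok2015.LeafSupport.mkN (Mok2015.LeafSupport.cm l)).leaf l ∧
      Implications42 νtop (canon₄₀ νtop (Mok2015.LeafSupport.mkN (Mok2015.LeafSupport.cm l)) κnoMok) (canon₄₁ νtop (Mok2015.LeafSupport.mkN (Mok2015.LeafSupport.cm l)) κnoMok) (canon₄₂ νtop (Mok2015.LeafSupport.mkN (Mok2015.LeafSupport.cm l)) κnoMok) ∧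
      ¬ (canon₄₂ νtop (Mok2015.LeafSupport.mkN (Mok2015.LeafSupport.cm l)) κnoMok).HLLSunipQS ∧
      ¬ (canon₄₂ νtop (Mok2015.LeafSupport.mkN (Mok2015.LeafSupport.cm l)) κnoMok).LiuLoWeakIP ∧
      ¬ (canon₄₂ νtop (Mok2015.LeafSupport.mkN (Mok2015.LeafSupport.cm l)) κnoMok).LiuShahidi114 :=
  have cmod := Mok2015.LeafSupport.countermodel l
  have nm := not_M_cm l
  ⟨cmod.1, cmod.2.1, cmod.2.2.1, canon_implications₄₂ _ _ _,
    fun h => nm h.1.2, fun h => nm h.2.1.2, fun h => nm h.2.2.1.2⟩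

/-- KMSW side: in KMSW's countermodel for any leaf `l ≠ MokMain` (book and Mok at the all-ones assignment; the Mok import
edge then holds), every forty-second-tranche edge valid: ALL THREE clauses HOLD outright — no KMSW premise at any order.
[claim: KalethaMinguezShinWhite2014, under-review] [cite: HazeltineLiuLoShahidi2024Wavefront, Rem. 11.5 (bookkeeping proved here)] -/
theorem fortysecond_kmsw_cm (l : KMSW2014.LeafSupport.Leaf) (hl : l ≠ .MokMain) :
    (∃ ωκ, KMSW2014.LeafSupport.Systems (KMSW2014.LeafSupport.mkN (KMSW2014.LeafSupport.cm l)) ωκ) ∧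
      (∀ l', l' ≠ l → (KMSW2014.LeafSupport.mkN (KMSW2014.LeafSupport.cm l)).leaf l') ∧ ¬ (KMSW2014.LeafSupport.mkN (KMSW2014.LeafSupport.cm l)).leaf l ∧
      KMSW2014.E_ImportMok μtop (KMSW2014.LeafSupport.mkN (KMSW2014.LeafSupport.cm l)) ∧
      Implications42 νtop (canon₄₀ νtop μtop (KMSW2014.LeafSupport.mkN (KMSW2014.LeafSupport.cm l))) (canon₄₁ νtop μtop (KMSW2014.LeafSupport.mkN (KMSW2014.LeafSupport.cm l))) (canon₄₂ νtop μtop (KMSW2014.LeafSupport.mkN (KMSW2014.LeafSupport.cm l))) ∧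
      ((canon₄₂ νtop μtop (KMSW2014.LeafSupport.mkN (KMSW2014.LeafSupport.cm l))).HLLSunipQS ∧ (canon₄₂ νtop μtop (KMSW2014.LeafSupport.mkN (KMSW2014.LeafSupport.cm l))).LiuLoWeakIP ∧ (canon₄₂ νtop μtop (KMSW2014.LeafSupport.mkN (KMSW2014.LeafSupport.cm l))).LiuShahidi114) :=
  have cmod := KMSW2014.LeafSupport.countermodel l
  have b : ∀ N, νtop.Everything N := bookInputs_top.everything
  have m : ∀ N, μtop.Everything N := mokInputs_top.everything
  have u : (canon₄₂ νtop μtop (KMSW2014.LeafSupport.mkN (KMSW2014.LeafSupport.cm l))).HLLSunipQS := ⟨⟨b, m⟩, ⟨b, m⟩, ⟨b, b, b, b, b, b⟩⟩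
  ⟨⟨_, cmod.1⟩, cmod.2.1, cmod.2.2.1, fun _ => cmod.2.1 .MokMain (Ne.symm hl), canon_implications₄₂ _ _ _,
    ⟨u, ⟨⟨b, b, b, b, b, b, b⟩, u⟩, ⟨b, b, u⟩⟩⟩

/-- ROW B31 — HENCE B101 — IS LOAD-BEARING FOR ALL THREE UNIPOTENT CLAUSES, AS TYPED.  In the all-ones assignment of the
three DAGs there are readings of tranches 26, 41, 42 over the DENIED row B101 (`canon₂₆noB101`, `canon₄₁noB31`,
`canon₄₂noB31`) satisfying EVERY forty-first- and forty-second-tranche edge, in which B31, B17, B26's unipotent theorem,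
B17's clause and B107's Theorem 1.14 are FALSE while B106 (both readings), B107's Theorem 1.9 field and tranche 40's
quasi-split node and field are TRUE.  The typed form of B26's « Working Hypothesis 6.2 is verified (Theorem 6.3) » =
[HLLZ25, Theorem 1.3]. [cite: HazeltineLiuLoShahidi2024Wavefront, Rem. 11.5 p0031:L14-15, Thm 6.3 p0017:L11-12; LiuLo2024Weak, Thm 1.4; LiuShahidi2026Jiang, Thm 1.14 (bookkeeping proved here)] -/
theorem unipotentClauses_need_B31 :
    ∃ c₂₆ : Consumers26, ∃ c₄₁ : Consumers41, ∃ c₄₂ : Consumers42,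
      BookInputs νtop ∧ MokInputs μtop ∧ KMSWInputs μtop κtop ∧ κtop.UnwrittenSequels ∧
      Implications41 νtop μtop κtop (canon₂ νtop μtop κtop) (canon₅ νtop μtop κtop) c₂₆ c₄₁ ∧
      Implications42 νtop (canon₄₀ νtop μtop κtop) c₄₁ c₄₂ ∧
      ((canon₄₀ νtop μtop κtop).HLLSHypQS ∧ (canon₄₀ νtop μtop κtop).HLLSequivQS ∧ c₄₁.JiangLiuWF ∧
        c₄₁.JiangLiuWFqs ∧ c₄₁.LiuShahidiJiang) ∧
      ¬ c₂₆.HLL ∧ ¬ c₄₁.HLLZclosure ∧ ¬ c₄₁.LiuLoWeak ∧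
      ¬ c₄₂.HLLSunipQS ∧ ¬ c₄₂.LiuLoWeakIP ∧ ¬ c₄₂.LiuShahidi114 :=
  have KQ := kmswInputs_top μtop
  have m : ∀ N, μtop.Everything N := mokInputs_top.everything
  have b : ∀ N, νtop.Everything N := bookInputs_top.everything
  have f : ∀ N, κtop.Full N := KQ.1.full mokInputs_top KQ.2
  ⟨canon₂₆noB101 νtop μtop κtop, canon₄₁noB31 νtop μtop κtop, (canon₄₂noB31 νtop μtop κtop), bookInputs_top, mokInputs_top, KQ.1, KQ.2,
    canon_implications₄₁noB31 νtop μtop κtop, canon_implications₄₂noB31 νtop μtop κtop,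
    ⟨⟨b, m⟩, ⟨b, m⟩, ⟨b, m, f⟩, ⟨b, m⟩, b⟩, id, id, id, fun h => h.2.2, fun h => h.1, fun h => h.2.2.2.2⟩

/-! ## 46. Forty-third tranche (v1.4 of this file, after `Downstream10.lean` v3): supports of the Hecke-algebra line — B28
(`AMSHecke`, `AMScoincide`), B40 (`SolleveldQS`), B69 (`SolleveldStd`) — see the module docstring for the summary of what
is certified. -/

section Canon43

variable (ν : Nodes) (μ : Mok2015.Nodes) (κ : KMSW2014.Nodes)

/-- The canonical reading of the forty-third tranche, over `canon` (tranche 1: A7), `canon₁₃` (A8-p), `canon₁₄` (E41), `canon₁₅` (A14) of the first support file: `AMSHecke` := book ∧ Mok ∧ KMSW's scope ∧ the canonical E41 ∧ the canonical A8-p; `AMScoincide` := book ∧ A8-p ∧ that; `SolleveldQS` := book ∧ Mok ∧ the canonical A7 ∧ A14; `SolleveldStd` := A8-p ∧ `AMSHecke`'s value. [cite: AubertMoussaouiSolleveld2022Hecke, Thms B, C, D; Solleveld2020Parameters, Thm 8.7; Solleveld2023Submodules, Thm 7.4 (canonical model; bookkeeping)] -/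
abbrev canon₄₃ : Consumers43 where
  AMSHecke := (∀ N, ν.Everything N) ∧ (∀ N, μ.Everything N) ∧ (∀ N, κ.Scope N) ∧ (canon₁₄ ν).MoeglinStable ∧ (canon₁₃ ν κ).MRpadic
  AMScoincide := (∀ N, ν.Everything N) ∧ (canon₁₃ ν κ).MRpadic ∧ ((∀ N, ν.Everything N) ∧ (∀ N, μ.Everything N) ∧ (∀ N, κ.Scope N) ∧ (canon₁₄ ν).MoeglinStable ∧ (canon₁₃ ν κ).MRpadic)
  SolleveldQS := (∀ N, ν.Everything N) ∧ (∀ N, μ.Everything N) ∧ (canon ν μ κ).XuGSp ∧ (canon₁₅ ν μ).XuLifting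
  SolleveldStd := (canon₁₃ ν κ).MRpadic ∧ ((∀ N, ν.Everything N) ∧ (∀ N, μ.Everything N) ∧ (∀ N, κ.Scope N) ∧ (canon₁₄ ν).MoeglinStable ∧ (canon₁₃ ν κ).MRpadic)

/-- The four forty-third-tranche edges hold in the canonical reading, for arbitrary ν, μ, κ. [cite: AubertMoussaouiSolleveld2022Hecke, Thms B, C, D; Solleveld2020Parameters, Thm 8.7; Solleveld2023Submodules, Thm 7.4 (bookkeeping proved here)] -/
theorem canon_implications₄₃ : Implications43 ν μ κ (canon ν μ κ) (canon₁₃ ν κ) (canon₁₄ ν) (canon₁₅ ν μ) (canon₄₃ ν μ κ) where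
  amsHecke := fun b m k e r => ⟨b, m, k, e, r⟩
  amsCoincide := fun b r h => ⟨b, r, h⟩
  solleveldQS := fun b m x l => ⟨b, m, x, l⟩
  solleveldStd := fun r h => ⟨r, h⟩

/-- Row A8-p DENIED outright (both readings `False`): a reading of `Consumers13` used only to display what the
forty-third-tranche edges make of it; no thirteenth-tranche edge is claimed for it. [cite: MoeglinRenard2018, §3.1 (separating model; bookkeeping)] -/
abbrev c₁₃noA8p : Consumers13 where
  MRpadic := False
  MRpadicOrth := False

/-- The forty-third-tranche reading INDUCED over the denied A8-p (`c₁₃noA8p`) by `canon₄₃`'s own recipe: `AMSHecke`, `AMScoincide`, `SolleveldStd` then carry the conjunct A8-p = `False`; `SolleveldQS` is as in `canon₄₃`. [cite: AubertMoussaouiSolleveld2022Hecke, §2 p0012:L96 « [MoRe] » (separating model; bookkeeping)] -/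
abbrev canon₄₃noA8p : Consumers43 where
  AMSHecke := (∀ N, ν.Everything N) ∧ (∀ N, μ.Everything N) ∧ (∀ N, κ.Scope N) ∧ (canon₁₄ ν).MoeglinStable ∧ False
  AMScoincide := (∀ N, ν.Everything N) ∧ False ∧ ((∀ N, ν.Everything N) ∧ (∀ N, μ.Everything N) ∧ (∀ N, κ.Scope N) ∧ (canon₁₄ ν).MoeglinStable ∧ False)
  SolleveldQS := (∀ N, ν.Everything N) ∧ (∀ N, μ.Everything N) ∧ (canon ν μ κ).XuGSp ∧ (canon₁₅ ν μ).XuLifting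
  SolleveldStd := False ∧ ((∀ N, ν.Everything N) ∧ (∀ N, μ.Everything N) ∧ (∀ N, κ.Scope N) ∧ (canon₁₄ ν).MoeglinStable ∧ False)

/-- Every forty-third-tranche edge holds in the induced reading over the denied A8-p (same certificate as
`canon_implications₄₃`). [cite: AubertMoussaouiSolleveld2022Hecke, Thms B, C, D; Solleveld2023Submodules, Thm 7.4 (bookkeeping proved here)] -/
theorem canon_implications₄₃noA8p : Implications43 ν μ κ (canon ν μ κ) c₁₃noA8p (canon₁₄ ν) (canon₁₅ ν μ) (canon₄₃noA8p ν μ κ) where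
  amsHecke := fun b m k e r => ⟨b, m, k, e, r⟩
  amsCoincide := fun b r h => ⟨b, r, h⟩
  solleveldQS := fun b m x l => ⟨b, m, x, l⟩
  solleveldStd := fun r h => ⟨r, h⟩
end Canon43

/-- With every input of the three DAGs granted, the four statements of the Hecke-algebra line hold, through the tranche's
own `heckeLine_of_inputs` and the canonical certificates of tranches 1, 13, 14, 15. [cite: AubertMoussaouiSolleveld2022Hecke, Thms B, C, D; Solleveld2020Parameters, Thm 8.7; Solleveld2023Submodules, Thm 7.4 (bookkeeping proved here)] -/
theorem fortythird_holds_top :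
    (canon₄₃ νtop μtop κtop).AMSHecke ∧ (canon₄₃ νtop μtop κtop).AMScoincide ∧ (canon₄₃ νtop μtop κtop).SolleveldQS ∧ (canon₄₃ νtop μtop κtop).SolleveldStd :=
  heckeLine_of_inputs (canon_implications₄₃ νtop μtop κtop) (canon_implications νtop μtop κtop)
    (canon_implications₁₃ νtop μtop κtop) (canon_implications₁₄ νtop) (canon_implications₁₅ νtop μtop κtop) bookInputs_top
    mokInputs_top (kmswInputs_top μtop).1

/-- BOOK side: in each of the 24 book countermodels (Mok and KMSW at the all-ones assignment; canonical readings, all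
forty-third-tranche edges valid) ALL FOUR statements FAIL — every book leaf is load-bearing for B28 (« [Art] », Theorem A
and the normalization that « boils down to [Art] »), for B40 (« [Art] (for $Sp_{2n}, SO_{2n+1}$, $SO_{2n}, SO_{2n}^*$) »)
and, second order, for B69. [cite: AubertMoussaouiSolleveld2022Hecke, §2 p0012:L3-4, p0004:L94-96; Solleveld2020Parameters, p0051:L112-113; Solleveld2023Submodules, p0005:L22 (bookkeeping proved here)] -/
theorem fortythird_book_cm (l : LeafSupport.Leaf) :
    LeafSupport.Systems (LeafSupport.mkN (LeafSupport.cm l)) (LeafSupport.mkW (LeafSupport.cm l)) (LeafSupport.mkG (LeafSupport.cm l)) ∧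
      (∀ l', l' ≠ l → (LeafSupport.mkN (LeafSupport.cm l)).leaf l') ∧ ¬ (LeafSupport.mkN (LeafSupport.cm l)).leaf l ∧
      Implications43 (LeafSupport.mkN (LeafSupport.cm l)) μtop κtop (canon (LeafSupport.mkN (LeafSupport.cm l)) μtop κtop) (canon₁₃ (LeafSupport.mkN (LeafSupport.cm l)) κtop) (canon₁₄ (LeafSupport.mkN (LeafSupport.cm l))) (canon₁₅ (LeafSupport.mkN (LeafSupport.cm l)) μtop) (canon₄₃ (LeafSupport.mkN (LeafSupport.cm l)) μtop κtop) ∧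
      ¬ (canon₄₃ (LeafSupport.mkN (LeafSupport.cm l)) μtop κtop).AMSHecke ∧ ¬ (canon₄₃ (LeafSupport.mkN (LeafSupport.cm l)) μtop κtop).AMScoincide ∧
      ¬ (canon₄₃ (LeafSupport.mkN (LeafSupport.cm l)) μtop κtop).SolleveldQS ∧ ¬ (canon₄₃ (LeafSupport.mkN (LeafSupport.cm l)) μtop κtop).SolleveldStd :=
  have cmod := LeafSupport.countermodel l
  ⟨cmod.1, cmod.2.1, cmod.2.2.1, canon_implications₄₃ _ _ _,
    fun h => not_B_cm l h.1, fun h => not_B_cm l h.1, fun h => not_B_cm l h.1, fun h => not_B_cm l h.2.1⟩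

/-- MOK side: in each of Mok's 29 countermodels (book at the all-ones assignment; KMSW read without its import of Mok),
every forty-third-tranche edge valid: ALL FOUR statements FAIL — B28's theorems and B40's Theorem 8.7 quantify over the
unitary groups (« [Mok] », « [KMSW] »; « [Mok] (for $U_n$) »), B69 inherits through B28.  Every Mok leaf is load-bearing,
as typed. [cite: AubertMoussaouiSolleveld2022Hecke, §2 p0012:L4-5; Solleveld2020Parameters, p0051:L113, p0052:L2-3 (bookkeeping proved here)] -/
theorem fortythird_mok_cm (l : Mok2015.LeafSupport.Leaf) :
    Mok2015.LeafSupport.Systems (Mok2015.LeafSupport.mkN (Mok2015.LeafSupport.cm l)) ∧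
      (∀ l', l' ≠ l → (Mok2015.LeafSupport.mkN (Mok2015.LeafSupport.cm l)).leaf l') ∧ ¬ (Mok2015.LeafSupport.mkN (Mok2015.LeafSupport.cm l)).leaf l ∧
      Implications43 νtop (Mok2015.LeafSupport.mkN (Mok2015.LeafSupport.cm l)) κnoMok (canon νtop (Mok2015.LeafSupport.mkN (Mok2015.LeafSupport.cm l)) κnoMok) (canon₁₃ νtop κnoMok) (canon₁₄ νtop) (canon₁₅ νtop (Mok2015.LeafSupport.mkN (Mok2015.LeafSupport.cm l))) (canon₄₃ νtop (Mok2015.LeafSupport.mkN (Mok2015.LeafSupport.cm l)) κnoMok) ∧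
      ¬ (canon₄₃ νtop (Mok2015.LeafSupport.mkN (Mok2015.LeafSupport.cm l)) κnoMok).AMSHecke ∧ ¬ (canon₄₃ νtop (Mok2015.LeafSupport.mkN (Mok2015.LeafSupport.cm l)) κnoMok).AMScoincide ∧
      ¬ (canon₄₃ νtop (Mok2015.LeafSupport.mkN (Mok2015.LeafSupport.cm l)) κnoMok).SolleveldQS ∧ ¬ (canon₄₃ νtop (Mok2015.LeafSupport.mkN (Mok2015.LeafSupport.cm l)) κnoMok).SolleveldStd :=
  have cmod := Mok2015.LeafSupport.countermodel l
  have nm := not_M_cm l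
  ⟨cmod.1, cmod.2.1, cmod.2.2.1, canon_implications₄₃ _ _ _,
    fun h => nm h.2.1, fun h => nm h.2.2.2.1, fun h => nm h.2.1, fun h => nm h.2.2.1⟩

/-- KMSW side: in KMSW's countermodel for any leaf `l ≠ MokMain` (book and Mok at the all-ones assignment; the Mok import
edge then holds), every forty-third-tranche edge valid: B40's Theorem 8.7 HOLDS outright (no KMSW premise); B28's two
fields and B69's Theorem 7.4 hold EXACTLY when `l` is one of `AubertSS`, `KMS_A`, `KMS_B` — KMSW's proved scope is
load-bearing (directly for « [KMSW] » and through A8-p), neither unwritten sequel is: the characterisation of section 17's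
`thirteenth_kmsw_cm`, inherited. [claim: KalethaMinguezShinWhite2014, under-review] [cite: AubertMoussaouiSolleveld2022Hecke, §2 p0012:L5, §5 p0037:L9-14 (bookkeeping proved here)] -/
theorem fortythird_kmsw_cm (l : KMSW2014.LeafSupport.Leaf) (hl : l ≠ .MokMain) :
    (∃ ωκ, KMSW2014.LeafSupport.Systems (KMSW2014.LeafSupport.mkN (KMSW2014.LeafSupport.cm l)) ωκ) ∧
      (∀ l', l' ≠ l → (KMSW2014.LeafSupport.mkN (KMSW2014.LeafSupport.cm l)).leaf l') ∧ ¬ (KMSW2014.LeafSupport.mkN (KMSW2014.LeafSupport.cm l)).leaf l ∧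
      KMSW2014.E_ImportMok μtop (KMSW2014.LeafSupport.mkN (KMSW2014.LeafSupport.cm l)) ∧
      Implications43 νtop μtop (KMSW2014.LeafSupport.mkN (KMSW2014.LeafSupport.cm l)) (canon νtop μtop (KMSW2014.LeafSupport.mkN (KMSW2014.LeafSupport.cm l))) (canon₁₃ νtop (KMSW2014.LeafSupport.mkN (KMSW2014.LeafSupport.cm l))) (canon₁₄ νtop) (canon₁₅ νtop μtop) (canon₄₃ νtop μtop (KMSW2014.LeafSupport.mkN (KMSW2014.LeafSupport.cm l))) ∧
      ((canon₄₃ νtop μtop (KMSW2014.LeafSupport.mkN (KMSW2014.LeafSupport.cm l))).AMSHecke ↔ l.onlyFull = true) ∧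
      ((canon₄₃ νtop μtop (KMSW2014.LeafSupport.mkN (KMSW2014.LeafSupport.cm l))).AMScoincide ↔ l.onlyFull = true) ∧
      ((canon₄₃ νtop μtop (KMSW2014.LeafSupport.mkN (KMSW2014.LeafSupport.cm l))).SolleveldStd ↔ l.onlyFull = true) ∧
      (canon₄₃ νtop μtop (KMSW2014.LeafSupport.mkN (KMSW2014.LeafSupport.cm l))).SolleveldQS :=
  have cmod := KMSW2014.LeafSupport.countermodel l
  have T := thirteenth_kmsw_cm l hl
  have b : ∀ N, νtop.Everything N := bookInputs_top.everything
  have m : ∀ N, μtop.Everything N := mokInputs_top.everything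
  have e : (canon₁₄ νtop).MoeglinStable := moeglinStable_of_bookInputs (canon_implications₁₄ νtop) bookInputs_top
  have i8 : (canon₁₃ νtop (KMSW2014.LeafSupport.mkN (KMSW2014.LeafSupport.cm l))).MRpadic ↔ l.onlyFull = true := T.2.2.2.2.2.1
  have hA : (canon₄₃ νtop μtop (KMSW2014.LeafSupport.mkN (KMSW2014.LeafSupport.cm l))).AMSHecke ↔ l.onlyFull = true :=
    ⟨fun h => i8.1 h.2.2.2.2, fun h => ⟨b, m, scope_of_onlyFull l h, e, i8.2 h⟩⟩
  ⟨⟨_, cmod.1⟩, cmod.2.1, cmod.2.2.1, fun _ => cmod.2.1 .MokMain (Ne.symm hl), canon_implications₄₃ _ _ _, hA,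
    ⟨fun h => hA.1 h.2.2, fun h => ⟨b, i8.2 h, hA.2 h⟩⟩, ⟨fun h => hA.1 h.2, fun h => ⟨i8.2 h, hA.2 h⟩⟩, ⟨b, m, b, b⟩⟩

/-- ROW A8-p IS LOAD-BEARING, AS TYPED, FOR B28 AND B69 — NOT FOR B40.  In the all-ones assignment of the three DAGs the
reading induced over the denied A8-p satisfies EVERY forty-third-tranche edge; in it B28's two fields and B69's Theorem
7.4 are FALSE and B40's Theorem 8.7 is TRUE.  The typed form of « Later this was worked out for non-quasi-split groups in
[MoRe]. » and « The paper [MoRe] uses [Art], and also leaves some other details to be worked out. » [cite: AubertMoussaouiSolleveld2022Hecke, §2 p0012:L96, p0013:L4; Solleveld2023Submodules, p0005:L22; Solleveld2020Parameters, Thm 8.7 (bookkeeping proved here)] -/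
theorem heckeLine_needs_A8p :
    ∃ c₁₃ : Consumers13, ∃ c₄₃ : Consumers43,
      BookInputs νtop ∧ MokInputs μtop ∧ KMSWInputs μtop κtop ∧
      Implications43 νtop μtop κtop (canon νtop μtop κtop) c₁₃ (canon₁₄ νtop) (canon₁₅ νtop μtop) c₄₃ ∧
      ¬ c₁₃.MRpadic ∧ ¬ c₄₃.AMSHecke ∧ ¬ c₄₃.AMScoincide ∧ ¬ c₄₃.SolleveldStd ∧ c₄₃.SolleveldQS :=
  have b : ∀ N, νtop.Everything N := bookInputs_top.everything
  have m : ∀ N, μtop.Everything N := mokInputs_top.everything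
  ⟨c₁₃noA8p, (canon₄₃noA8p νtop μtop κtop), bookInputs_top, mokInputs_top, (kmswInputs_top μtop).1, canon_implications₄₃noA8p νtop μtop κtop,
    id, fun h => h.2.2.2.2, fun h => h.2.1, fun h => h.1, ⟨b, m, b, b⟩⟩

/-! ## 47. Forty-fourth tranche (v1.5 of this file, after `Downstream10.lean` v4): supports of the Hecke-algebra line, II —
V. Heiermann: B10 (`HeiermannDecomp`), B47 (`HeiermannStd`) — see the module docstring for the summary of what is
certified. -/

section Canon44

variable (ν : Nodes) (μ : Mok2015.Nodes) (κ : KMSW2014.Nodes)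

/-- The canonical reading of the forty-fourth tranche, over `canon₁₄` (E41) of the first support file: `HeiermannDecomp` := book ∧ the canonical E41; `HeiermannStd` := book ∧ Mok ∧ KMSW's scope. [cite: Heiermann2017Hecke, Cor. 3.5; Heiermann2016Standard, Thms 3.1–3.3 (canonical model; bookkeeping)] -/
abbrev canon₄₄ : Consumers44 where
  HeiermannDecomp := (∀ N, ν.Everything N) ∧ (canon₁₄ ν).MoeglinStable
  HeiermannStd := (∀ N, ν.Everything N) ∧ (∀ N, μ.Everything N) ∧ (∀ N, κ.Scope N)

/-- The two forty-fourth-tranche edges hold in the canonical reading, for arbitrary ν, μ, κ. [cite: Heiermann2017Hecke, Cor. 3.5; Heiermann2016Standard, Thms 3.1–3.3 (bookkeeping proved here)] -/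
theorem canon_implications₄₄ : Implications44 ν μ κ (canon₁₄ ν) (canon₄₄ ν μ κ) where
  heiermannDecomp := fun b e => ⟨b, e⟩
  heiermannStd := fun b m k => ⟨b, m, k⟩

/-- Row E41 DENIED outright (`MoeglinStable` := `False`): a reading of `Consumers14` used only to display what the
forty-fourth-tranche edges make of it; no fourteenth-tranche edge is claimed for it. [cite: Moeglin2014Stable, Thm 32 (separating model; bookkeeping)] -/
abbrev c₁₄noE41 : Consumers14 where
  MoeglinStable := False

/-- The forty-fourth-tranche reading INDUCED over the denied E41 (`c₁₄noE41`) by `canon₄₄`'s own recipe: `HeiermannDecomp` then carries the conjunct E41 = `False`; `HeiermannStd` is as in `canon₄₄`. [cite: Heiermann2017Hecke, 1.1 (p0003:L7) « [M1, 1.5.1] » with 1.7 (iv) (p0007:L2) « [M1, M3] » (separating model; bookkeeping)] -/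
abbrev canon₄₄noE41 : Consumers44 where
  HeiermannDecomp := (∀ N, ν.Everything N) ∧ False
  HeiermannStd := (∀ N, ν.Everything N) ∧ (∀ N, μ.Everything N) ∧ (∀ N, κ.Scope N)

/-- Every forty-fourth-tranche edge holds in the induced reading over the denied E41 (same certificate as
`canon_implications₄₄`). [cite: Heiermann2017Hecke, Cor. 3.5; Heiermann2016Standard, Thms 3.1–3.3 (bookkeeping proved here)] -/
theorem canon_implications₄₄noE41 : Implications44 ν μ κ c₁₄noE41 (canon₄₄noE41 ν μ κ) where
  heiermannDecomp := fun b e => ⟨b, e⟩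
  heiermannStd := fun b m k => ⟨b, m, k⟩

end Canon44

/-- With every input of the three DAGs granted, both statements of Heiermann's two papers hold, through the tranche's own
`heiermannLine_of_inputs` and the canonical certificate of tranche 14. [cite: Heiermann2017Hecke, Cor. 3.5; Heiermann2016Standard, Thms 3.1–3.3 (bookkeeping proved here)] -/
theorem fortyfourth_holds_top :
    (canon₄₄ νtop μtop κtop).HeiermannDecomp ∧ (canon₄₄ νtop μtop κtop).HeiermannStd :=
  heiermannLine_of_inputs (canon_implications₄₄ νtop μtop κtop) (canon_implications₁₄ νtop) bookInputs_top mokInputs_top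
    (kmswInputs_top μtop).1

/-- BOOK side: in each of the 24 book countermodels (Mok and KMSW at the all-ones assignment; canonical readings, both
forty-fourth-tranche edges valid) BOTH statements FAIL — every book leaf is load-bearing for B10 (« J. Arthur has
determined in [A] the parameters », the results of Moeglin « (based on Arthur's work) ») and for B47 (« the stabilization
of the trace formula in [A, Mk, KMSW] »); E41's eight leaves are second occurrences. [cite: Heiermann2017Hecke, p0001:L50, p0002:L1; Heiermann2016Standard, §3.1 p0006:L3 (bookkeeping proved here)] -/
theorem fortyfourth_book_cm (l : LeafSupport.Leaf) :
    LeafSupport.Systems (LeafSupport.mkN (LeafSupport.cm l)) (LeafSupport.mkW (LeafSupport.cm l)) (LeafSupport.mkG (LeafSupport.cm l)) ∧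
      (∀ l', l' ≠ l → (LeafSupport.mkN (LeafSupport.cm l)).leaf l') ∧ ¬ (LeafSupport.mkN (LeafSupport.cm l)).leaf l ∧
      Implications44 (LeafSupport.mkN (LeafSupport.cm l)) μtop κtop (canon₁₄ (LeafSupport.mkN (LeafSupport.cm l))) (canon₄₄ (LeafSupport.mkN (LeafSupport.cm l)) μtop κtop) ∧
      ¬ (canon₄₄ (LeafSupport.mkN (LeafSupport.cm l)) μtop κtop).HeiermannDecomp ∧ ¬ (canon₄₄ (LeafSupport.mkN (LeafSupport.cm l)) μtop κtop).HeiermannStd :=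
  have cmod := LeafSupport.countermodel l
  ⟨cmod.1, cmod.2.1, cmod.2.2.1, canon_implications₄₄ _ _ _, fun h => not_B_cm l h.1, fun h => not_B_cm l h.1⟩

/-- MOK side: in each of Mok's 29 countermodels (book at the all-ones assignment; KMSW read without its import of Mok),
both forty-fourth-tranche edges valid: B10 HOLDS — its edge has no Mok premise (annex C names « [Mk] » as the
generalisation of Arthur's work and takes [M2] « (see also [M3]) » as its input) — and B47 FAILS (« [A, Mk, KMSW] »; the
application « following the work of Mok [Mk] and Kaletha-Minguez-Shin-White [KMSW] »).  Every Mok leaf is load-bearing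
for B47 and none for B10, as typed. [cite: Heiermann2017Hecke, annex C.1 (p0014:L38); Heiermann2016Standard, §3.1 p0006:L3, p0002:L15 (bookkeeping proved here)] -/
theorem fortyfourth_mok_cm (l : Mok2015.LeafSupport.Leaf) :
    Mok2015.LeafSupport.Systems (Mok2015.LeafSupport.mkN (Mok2015.LeafSupport.cm l)) ∧
      (∀ l', l' ≠ l → (Mok2015.LeafSupport.mkN (Mok2015.LeafSupport.cm l)).leaf l') ∧ ¬ (Mok2015.LeafSupport.mkN (Mok2015.LeafSupport.cm l)).leaf l ∧
      Implications44 νtop (Mok2015.LeafSupport.mkN (Mok2015.LeafSupport.cm l)) κnoMok (canon₁₄ νtop) (canon₄₄ νtop (Mok2015.LeafSupport.mkN (Mok2015.LeafSupport.cm l)) κnoMok) ∧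
      (canon₄₄ νtop (Mok2015.LeafSupport.mkN (Mok2015.LeafSupport.cm l)) κnoMok).HeiermannDecomp ∧ ¬ (canon₄₄ νtop (Mok2015.LeafSupport.mkN (Mok2015.LeafSupport.cm l)) κnoMok).HeiermannStd :=
  have cmod := Mok2015.LeafSupport.countermodel l
  have b : ∀ N, νtop.Everything N := bookInputs_top.everything
  ⟨cmod.1, cmod.2.1, cmod.2.2.1, canon_implications₄₄ _ _ _, ⟨b, fourteenth_holds_top⟩, fun h => not_M_cm l h.2.1⟩

/-- KMSW side: in KMSW's countermodel for any leaf `l ≠ MokMain` (book and Mok at the all-ones assignment; the Mok import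
edge then holds), both forty-fourth-tranche edges valid: B10 HOLDS outright (no KMSW premise); B47 holds EXACTLY when `l`
is one of `AubertSS`, `KMS_A`, `KMS_B` — KMSW's proved scope is load-bearing (« [KMSW] » for the generic Vogan L-packets
of the unitary groups across pure inner forms), neither unwritten sequel is. [claim: KalethaMinguezShinWhite2014, under-review] [cite: Heiermann2016Standard, §3.1 p0006:L3, p0002:L15; Heiermann2017Hecke, Cor. 3.5 (bookkeeping proved here)] -/
theorem fortyfourth_kmsw_cm (l : KMSW2014.LeafSupport.Leaf) (hl : l ≠ .MokMain) :
    (∃ ωκ, KMSW2014.LeafSupport.Systems (KMSW2014.LeafSupport.mkN (KMSW2014.LeafSupport.cm l)) ωκ) ∧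
      (∀ l', l' ≠ l → (KMSW2014.LeafSupport.mkN (KMSW2014.LeafSupport.cm l)).leaf l') ∧ ¬ (KMSW2014.LeafSupport.mkN (KMSW2014.LeafSupport.cm l)).leaf l ∧
      KMSW2014.E_ImportMok μtop (KMSW2014.LeafSupport.mkN (KMSW2014.LeafSupport.cm l)) ∧
      Implications44 νtop μtop (KMSW2014.LeafSupport.mkN (KMSW2014.LeafSupport.cm l)) (canon₁₄ νtop) (canon₄₄ νtop μtop (KMSW2014.LeafSupport.mkN (KMSW2014.LeafSupport.cm l))) ∧
      (canon₄₄ νtop μtop (KMSW2014.LeafSupport.mkN (KMSW2014.LeafSupport.cm l))).HeiermannDecomp ∧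
      ((canon₄₄ νtop μtop (KMSW2014.LeafSupport.mkN (KMSW2014.LeafSupport.cm l))).HeiermannStd ↔ l.onlyFull = true) := by
  have cmod := KMSW2014.LeafSupport.countermodel l
  have b : ∀ N, νtop.Everything N := bookInputs_top.everything
  have m : ∀ N, μtop.Everything N := mokInputs_top.everything
  have hsc : (∀ N, (KMSW2014.LeafSupport.mkN (KMSW2014.LeafSupport.cm l)).Scope N) ↔ l.onlyFull = true := by
    constructor
    · intro hk
      cases hb : l.onlyFull
      · exact absurd (hk 0) (KMSW2014.LeafSupport.not_scope_of (KMSW2014.LeafSupport.scope_fails l hb 0))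
      · rfl
    · intro h
      exact scope_of_onlyFull l h
  exact ⟨⟨_, cmod.1⟩, cmod.2.1, cmod.2.2.1, fun _ => cmod.2.1 .MokMain (Ne.symm hl), canon_implications₄₄ _ _ _,
    ⟨b, fourteenth_holds_top⟩, ⟨fun h => hsc.1 h.2.2, fun h => ⟨b, m, hsc.2 h⟩⟩⟩

/-- ROW E41 IS LOAD-BEARING, AS TYPED, FOR B10 — NOT FOR B47.  In the all-ones assignment of the three DAGs the reading
induced over the denied E41 satisfies EVERY forty-fourth-tranche edge; in it B10's decomposition is FALSE and B47's
Theorems 3.1–3.3 are TRUE.  The typed form of Theorem 1.1 « [M1, 1.5.1] » and 1.7 (iv) « the work of C. Moeglin [M1, M3]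
»: the book alone does not feed B10's edge. [cite: Heiermann2017Hecke, 1.1 (p0003:L7), 1.7 (iv) (p0007:L1-2), 1.8 (p0007:L8); Heiermann2016Standard, Thms 3.1–3.3 (bookkeeping proved here)] -/
theorem heiermannDecomp_needs_E41 :
    ∃ c₁₄ : Consumers14, ∃ c₄₄ : Consumers44,
      BookInputs νtop ∧ MokInputs μtop ∧ KMSWInputs μtop κtop ∧
      Implications44 νtop μtop κtop c₁₄ c₄₄ ∧
      ¬ c₁₄.MoeglinStable ∧ ¬ c₄₄.HeiermannDecomp ∧ c₄₄.HeiermannStd :=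
  have b : ∀ N, νtop.Everything N := bookInputs_top.everything
  have m : ∀ N, μtop.Everything N := mokInputs_top.everything
  ⟨c₁₄noE41, (canon₄₄noE41 νtop μtop κtop), bookInputs_top, mokInputs_top, (kmswInputs_top μtop).1, canon_implications₄₄noE41 νtop μtop κtop,
    id, fun h => h.2, ⟨b, m, (KMSWInputs.scope mokInputs_top (kmswInputs_top μtop).1)⟩⟩

/-! ## 48. Forty-fifth tranche (v1.6 of this file, after NEW `Downstream11.lean` v1): supports of the Mœglin conduits, I —
B75's node `MoeglinDSHyp` / `MoeglinDSHypQS`, statements `MoeglinMult1` / `MoeglinMult1qs` / `MoeglinMp`, E43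
`MoeglinUnitaryDS`, and the re-issued consumers B10 / B47 / B28 — see the module docstring for the summary of what is
certified. -/

section Canon45

variable (ν : Nodes) (μ : Mok2015.Nodes) (κ : KMSW2014.Nodes)

/-- The canonical reading of the forty-fifth tranche: the node := (its quasi-split instance = the book at all ranks) ∧ (the remainder beyond that instance, GRANTED here as `True`); the instance and `MoeglinMult1qs` := book; `MoeglinMult1`, `MoeglinMp` := the node's value; `MoeglinUnitaryDS` := its five published leaves. [cite: Moeglin2011Mult1, §1 p0342:L22-29, §2 p0346:L26-28; Moeglin2007Unitary, p0001:L14-17 (canonical model; bookkeeping)] -/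
abbrev canon₄₅ : Consumers45 where
  MoeglinDSHyp := (∀ N, ν.Everything N) ∧ True
  MoeglinDSHypQS := (∀ N, ν.Everything N)
  MoeglinMult1 := (∀ N, ν.Everything N) ∧ True
  MoeglinMult1qs := (∀ N, ν.Everything N)
  MoeglinMp := (∀ N, ν.Everything N) ∧ True
  MoeglinUnitaryDS := ν.LLC_GLN ∧ ν.FL ∧ ν.Transfer ∧ ν.InvariantTF ∧ ν.TwistedTF

/-- Every forty-fifth-tranche edge — the three re-issues included, read against the unchanged `canon₄₃`, `canon₄₄` — holds in the canonical reading, for arbitrary ν, μ, κ. [cite: Moeglin2011Mult1, Thms 2.3.1–2.5.1, §4; Moeglin2007Unitary, 5.7; Heiermann2017Hecke, Cor. 3.5; Heiermann2016Standard, Thms 3.1–3.3; AubertMoussaouiSolleveld2022Hecke, Thms B, C (bookkeeping proved here)] -/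
theorem canon_implications₄₅ : Implications45 ν μ κ (canon₁₃ ν κ) (canon₁₄ ν) (canon₄₃ ν μ κ) (canon₄₄ ν μ κ) (canon₄₅ ν) where
  dsHypQS := fun b => b
  dsHypCase := fun h => h.1
  mult1 := fun h => h
  mult1qs := fun b => b
  mult1Case := fun h => h.1
  mp := fun h => h
  unitaryDS := fun a b c d e => ⟨a, b, c, d, e⟩
  heiermannDecompM := fun b e _ _ => ⟨b, e⟩
  heiermannStdM := fun b m k _ _ => ⟨b, m, k⟩
  amsHeckeM := fun b m k e r _ _ => ⟨b, m, k, e, r⟩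

/-- The forty-fifth-tranche reading with the node's remainder DENIED (`False`): the node, `MoeglinMult1`, `MoeglinMp` then carry the conjunct `False`; the instance, `MoeglinMult1qs`, `MoeglinUnitaryDS` are as in `canon₄₅`. [cite: Moeglin2011Mult1, Thm 2.4.1 (p0354:L31-33), §2 p0346:L26-28 (separating model; bookkeeping)] -/
abbrev canon₄₅noR : Consumers45 where
  MoeglinDSHyp := (∀ N, ν.Everything N) ∧ False
  MoeglinDSHypQS := (∀ N, ν.Everything N)
  MoeglinMult1 := (∀ N, ν.Everything N) ∧ False
  MoeglinMult1qs := (∀ N, ν.Everything N)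
  MoeglinMp := (∀ N, ν.Everything N) ∧ False
  MoeglinUnitaryDS := ν.LLC_GLN ∧ ν.FL ∧ ν.Transfer ∧ ν.InvariantTF ∧ ν.TwistedTF

/-- B28's reading COMPANION to the denied remainder: `AMSHecke` := its canonical value (tranche 43) ∧ B75's denied value — what the RE-ISSUED edge `E_AMSHeckeM` delivers —; the other three fields as in `canon₄₃`. [cite: AubertMoussaouiSolleveld2022Hecke, §2 p0012:L8-9, L95-96 (separating model; bookkeeping)] -/
abbrev c₄₃noM : Consumers43 where
  AMSHecke := (canon₄₃ ν μ κ).AMSHecke ∧ ((∀ N, ν.Everything N) ∧ False)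
  AMScoincide := (canon₄₃ ν μ κ).AMScoincide
  SolleveldQS := (canon₄₃ ν μ κ).SolleveldQS
  SolleveldStd := (canon₄₃ ν μ κ).SolleveldStd

/-- B10's and B47's readings COMPANION to the denied remainder: each field := its canonical value (tranche 44) ∧ B75's denied value — what the re-issued edges deliver. [cite: Heiermann2017Hecke, p0002:L3; Heiermann2016Standard, §3.1 p0006:L3 (separating model; bookkeeping)] -/
abbrev c₄₄noM : Consumers44 where
  HeiermannDecomp := ((∀ N, ν.Everything N) ∧ (canon₁₄ ν).MoeglinStable) ∧ ((∀ N, ν.Everything N) ∧ False)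
  HeiermannStd := ((∀ N, ν.Everything N) ∧ (∀ N, μ.Everything N) ∧ (∀ N, κ.Scope N)) ∧ ((∀ N, ν.Everything N) ∧ False)

/-- Every forty-fifth-tranche edge holds in the denied-remainder reading with its companions (the re-issues deliver exactly the conjunction with B75's value). [cite: Moeglin2011Mult1, §1 p0342:L22-29; Heiermann2017Hecke, 1.1; Heiermann2016Standard, §3.1; AubertMoussaouiSolleveld2022Hecke, §2 p0012:L93-99 (bookkeeping proved here)] -/
theorem canon_implications₄₅noR :
    Implications45 ν μ κ (canon₁₃ ν κ) (canon₁₄ ν) (c₄₃noM ν μ κ) (c₄₄noM ν μ κ) (canon₄₅noR ν) where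
  dsHypQS := fun b => b
  dsHypCase := fun h => h.1
  mult1 := fun h => h
  mult1qs := fun b => b
  mult1Case := fun h => h.1
  mp := fun h => h
  unitaryDS := fun a b c d e => ⟨a, b, c, d, e⟩
  heiermannDecompM := fun b e m₁ _ => ⟨⟨b, e⟩, m₁⟩
  heiermannStdM := fun b m k m₁ _ => ⟨⟨b, m, k⟩, m₁⟩
  amsHeckeM := fun b m k e r m₁ _ => ⟨⟨b, m, k, e, r⟩, m₁⟩

end Canon45

/-- With every input of the book granted (and the remainder granted by the reading), all six tranche-45 fields hold at
the top, through the tranche's own `moeglinConduits_of_inputs`. [cite: Moeglin2011Mult1, Thms 2.3.1–2.5.1, §4, Thm 6.0.2; Moeglin2007Unitary, 5.7 (bookkeeping proved here)] -/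
theorem fortyfifth_holds_top :
    (canon₄₅ νtop).MoeglinDSHyp ∧ (canon₄₅ νtop).MoeglinDSHypQS ∧ (canon₄₅ νtop).MoeglinMult1 ∧ (canon₄₅ νtop).MoeglinMult1qs ∧ (canon₄₅ νtop).MoeglinMp ∧
      (canon₄₅ νtop).MoeglinUnitaryDS :=
  moeglinConduits_of_inputs (canon_implications₄₅ νtop μtop κtop) bookInputs_top ⟨bookInputs_top.everything, trivial⟩

/-- BOOK side: in each of the 24 book countermodels (Mok and KMSW at the all-ones assignment; canonical readings, every
forty-fifth-tranche edge valid) the node, its instance and the three B75 statements FAIL — every book leaf is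
load-bearing for B75 in every reading (« Ces résultats sont annoncés … par Arthur »; the quasi-split symplectic /
orthogonal instance IS the book's local classification).  E43 is treated apart (next three theorems). [cite: Moeglin2011Mult1, §1 p0342:L26-29, §2.3 p0351:L27-30 (bookkeeping proved here)] -/
theorem fortyfifth_book_cm (l : LeafSupport.Leaf) :
    LeafSupport.Systems (LeafSupport.mkN (LeafSupport.cm l)) (LeafSupport.mkW (LeafSupport.cm l)) (LeafSupport.mkG (LeafSupport.cm l)) ∧
      (∀ l', l' ≠ l → (LeafSupport.mkN (LeafSupport.cm l)).leaf l') ∧ ¬ (LeafSupport.mkN (LeafSupport.cm l)).leaf l ∧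
      Implications45 (LeafSupport.mkN (LeafSupport.cm l)) μtop κtop (canon₁₃ (LeafSupport.mkN (LeafSupport.cm l)) κtop) (canon₁₄ (LeafSupport.mkN (LeafSupport.cm l))) (canon₄₃ (LeafSupport.mkN (LeafSupport.cm l)) μtop κtop) (canon₄₄ (LeafSupport.mkN (LeafSupport.cm l)) μtop κtop) (canon₄₅ (LeafSupport.mkN (LeafSupport.cm l))) ∧
      ¬ (canon₄₅ (LeafSupport.mkN (LeafSupport.cm l))).MoeglinDSHyp ∧ ¬ (canon₄₅ (LeafSupport.mkN (LeafSupport.cm l))).MoeglinDSHypQS ∧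
      ¬ (canon₄₅ (LeafSupport.mkN (LeafSupport.cm l))).MoeglinMult1 ∧ ¬ (canon₄₅ (LeafSupport.mkN (LeafSupport.cm l))).MoeglinMult1qs ∧
      ¬ (canon₄₅ (LeafSupport.mkN (LeafSupport.cm l))).MoeglinMp :=
  have cmod := LeafSupport.countermodel l
  ⟨cmod.1, cmod.2.1, cmod.2.2.1, canon_implications₄₅ _ _ _, fun h => not_B_cm l h.1, fun h => not_B_cm l h,
    fun h => not_B_cm l h.1, fun h => not_B_cm l h, fun h => not_B_cm l h.1⟩

/-- E43's SUPPORT, first half: in the book countermodel for every leaf OUTSIDE {LLC_GLN, FL, Transfer, InvariantTF,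
TwistedTF} (every other leaf true there) Mœglin's 2007 classification HOLDS in the canonical reading. [cite: Moeglin2007Unitary, p0001:L14-17 (bookkeeping proved here)] -/
theorem moeglinUnitaryDS_cm_holds (l : LeafSupport.Leaf) (h₁ : l ≠ .LLC_GLN) (h₂ : l ≠ .FL) (h₃ : l ≠ .Transfer)
    (h₄ : l ≠ .InvariantTF) (h₅ : l ≠ .TwistedTF) : (canon₄₅ (LeafSupport.mkN (LeafSupport.cm l))).MoeglinUnitaryDS :=
  have o := (LeafSupport.countermodel l).2.1
  ⟨o .LLC_GLN (Ne.symm h₁), o .FL (Ne.symm h₂), o .Transfer (Ne.symm h₃), o .InvariantTF (Ne.symm h₄),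
    o .TwistedTF (Ne.symm h₅)⟩

/-- E43's SUPPORT, the other half: in the book countermodel for each of the five leaves LLC_GLN, FL, Transfer,
InvariantTF, TwistedTF (canonical reading) E43 FAILS.  So, as typed, E43 rests on exactly these five PUBLISHED leaves of
the 24. [cite: Moeglin2007Unitary, p0001:L14-17, L33-35, 1.4 p0004:L29-30, 1.5 p0005:L48-51 (bookkeeping proved here)] -/
theorem moeglinUnitaryDS_cm_fails (l : LeafSupport.Leaf)
    (hl : l = .LLC_GLN ∨ l = .FL ∨ l = .Transfer ∨ l = .InvariantTF ∨ l = .TwistedTF) :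
    Implications45 (LeafSupport.mkN (LeafSupport.cm l)) μtop κtop (canon₁₃ (LeafSupport.mkN (LeafSupport.cm l)) κtop) (canon₁₄ (LeafSupport.mkN (LeafSupport.cm l))) (canon₄₃ (LeafSupport.mkN (LeafSupport.cm l)) μtop κtop) (canon₄₄ (LeafSupport.mkN (LeafSupport.cm l)) μtop κtop) (canon₄₅ (LeafSupport.mkN (LeafSupport.cm l))) ∧
      ¬ (canon₄₅ (LeafSupport.mkN (LeafSupport.cm l))).MoeglinUnitaryDS := by
  refine ⟨canon_implications₄₅ _ _ _, ?_⟩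
  rcases hl with rfl | rfl | rfl | rfl | rfl <;> intro h
  · exact (LeafSupport.countermodel .LLC_GLN).2.2.1 h.1
  · exact (LeafSupport.countermodel .FL).2.2.1 h.2.1
  · exact (LeafSupport.countermodel .Transfer).2.2.1 h.2.2.1
  · exact (LeafSupport.countermodel .InvariantTF).2.2.1 h.2.2.2.1
  · exact (LeafSupport.countermodel .TwistedTF).2.2.1 h.2.2.2.2

/-- E43 IS INDEPENDENT OF EVERY OPEN LEAF OF THE BOOK'S DAG, AS TYPED: in the book countermodel for each of the seven
2024–2026 preprint leaves (AGIKMS Thm 1.8.1 / 1.9.1 / 1.10.5 / Cor. D.2.1 / App. E, [KM26], [CK26]) and for each of the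
two UNWRITTEN weighted fundamental lemmas (general, non-standard) — every book edge valid, every other leaf true, every
forty-fifth-tranche edge valid in the canonical reading — Mœglin's 2007 classification and base change for the discrete
series of p-adic quasi-split unitary groups HOLDS while everything the book establishes FAILS at every rank.  (Compare
section 18: E41, Mœglin 2014, holds for the preprint leaves but FAILS for both weighted lemmas.) [cite: Moeglin2007Unitary, p0001:L5-17 (bookkeeping proved here)] -/
theorem moeglinUnitaryDS_indep_open_leaves (l : LeafSupport.Leaf)
    (hl : l = .AGIKMS_181 ∨ l = .AGIKMS_191 ∨ l = .AGIKMS_1105 ∨ l = .AGIKMS_D21 ∨ l = .AGIKMS_AppE ∨ l = .KM26 ∨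
      l = .CK26 ∨ l = .WFL_general ∨ l = .WFL_nonstandard) :
    Implications45 (LeafSupport.mkN (LeafSupport.cm l)) μtop κtop (canon₁₃ (LeafSupport.mkN (LeafSupport.cm l)) κtop) (canon₁₄ (LeafSupport.mkN (LeafSupport.cm l))) (canon₄₃ (LeafSupport.mkN (LeafSupport.cm l)) μtop κtop) (canon₄₄ (LeafSupport.mkN (LeafSupport.cm l)) μtop κtop) (canon₄₅ (LeafSupport.mkN (LeafSupport.cm l))) ∧
      (canon₄₅ (LeafSupport.mkN (LeafSupport.cm l))).MoeglinUnitaryDS ∧ ¬ ∀ N, (LeafSupport.mkN (LeafSupport.cm l)).Everything N := by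
  refine ⟨canon_implications₄₅ _ _ _, ?_, not_B_cm l⟩
  rcases hl with rfl | rfl | rfl | rfl | rfl | rfl | rfl | rfl | rfl <;>
    exact moeglinUnitaryDS_cm_holds _ (by decide) (by decide) (by decide) (by decide) (by decide)

/-- MOK side: in each of Mok's 29 countermodels (book at the all-ones assignment; KMSW read without its import of Mok),
every forty-fifth-tranche edge valid: ALL SIX tranche-45 fields HOLD — no Mok premise anywhere in B75 or E43 (B75's §1
notes that unitary groups « sont aussi acceptables » for its methods and leaves them to E43; E43 predates Mok's memoir). [cite: Moeglin2011Mult1, §1 p0345:L43-45; Moeglin2007Unitary, p0001:L5-7 (bookkeeping proved here)] -/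
theorem fortyfifth_mok_cm (l : Mok2015.LeafSupport.Leaf) :
    Mok2015.LeafSupport.Systems (Mok2015.LeafSupport.mkN (Mok2015.LeafSupport.cm l)) ∧
      (∀ l', l' ≠ l → (Mok2015.LeafSupport.mkN (Mok2015.LeafSupport.cm l)).leaf l') ∧ ¬ (Mok2015.LeafSupport.mkN (Mok2015.LeafSupport.cm l)).leaf l ∧
      Implications45 νtop (Mok2015.LeafSupport.mkN (Mok2015.LeafSupport.cm l)) κnoMok (canon₁₃ νtop κnoMok) (canon₁₄ νtop) (canon₄₃ νtop (Mok2015.LeafSupport.mkN (Mok2015.LeafSupport.cm l)) κnoMok) (canon₄₄ νtop (Mok2015.LeafSupport.mkN (Mok2015.LeafSupport.cm l)) κnoMok) (canon₄₅ νtop) ∧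
      (canon₄₅ νtop).MoeglinDSHyp ∧ (canon₄₅ νtop).MoeglinDSHypQS ∧ (canon₄₅ νtop).MoeglinMult1 ∧ (canon₄₅ νtop).MoeglinMult1qs ∧ (canon₄₅ νtop).MoeglinMp ∧
      (canon₄₅ νtop).MoeglinUnitaryDS :=
  have cmod := Mok2015.LeafSupport.countermodel l
  ⟨cmod.1, cmod.2.1, cmod.2.2.1, canon_implications₄₅ _ _ _, fortyfifth_holds_top⟩

/-- KMSW side: in KMSW's countermodel for any leaf `l ≠ MokMain` (book and Mok at the all-ones assignment; the Mok import
edge then holds), every forty-fifth-tranche edge valid: ALL SIX tranche-45 fields HOLD — no KMSW premise. [claim: KalethaMinguezShinWhite2014, under-review] [cite: Moeglin2011Mult1, §2 p0346:L26-28 (bookkeeping proved here)] -/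
theorem fortyfifth_kmsw_cm (l : KMSW2014.LeafSupport.Leaf) (hl : l ≠ .MokMain) :
    (∃ ωκ, KMSW2014.LeafSupport.Systems (KMSW2014.LeafSupport.mkN (KMSW2014.LeafSupport.cm l)) ωκ) ∧
      (∀ l', l' ≠ l → (KMSW2014.LeafSupport.mkN (KMSW2014.LeafSupport.cm l)).leaf l') ∧ ¬ (KMSW2014.LeafSupport.mkN (KMSW2014.LeafSupport.cm l)).leaf l ∧
      KMSW2014.E_ImportMok μtop (KMSW2014.LeafSupport.mkN (KMSW2014.LeafSupport.cm l)) ∧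
      Implications45 νtop μtop (KMSW2014.LeafSupport.mkN (KMSW2014.LeafSupport.cm l)) (canon₁₃ νtop (KMSW2014.LeafSupport.mkN (KMSW2014.LeafSupport.cm l))) (canon₁₄ νtop) (canon₄₃ νtop μtop (KMSW2014.LeafSupport.mkN (KMSW2014.LeafSupport.cm l))) (canon₄₄ νtop μtop (KMSW2014.LeafSupport.mkN (KMSW2014.LeafSupport.cm l))) (canon₄₅ νtop) ∧
      (canon₄₅ νtop).MoeglinDSHyp ∧ (canon₄₅ νtop).MoeglinDSHypQS ∧ (canon₄₅ νtop).MoeglinMult1 ∧ (canon₄₅ νtop).MoeglinMult1qs ∧ (canon₄₅ νtop).MoeglinMp ∧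
      (canon₄₅ νtop).MoeglinUnitaryDS :=
  have cmod := KMSW2014.LeafSupport.countermodel l
  ⟨⟨_, cmod.1⟩, cmod.2.1, cmod.2.2.1, fun _ => cmod.2.1 .MokMain (Ne.symm hl), canon_implications₄₅ _ _ _,
    fortyfifth_holds_top⟩

/-- MŒGLIN'S 2011 HYPOTHESIS BEYOND ITS QUASI-SPLIT INSTANCE IS LOAD-BEARING, AS TYPED BY THE RE-ISSUED EDGES, FOR B10,
B47 AND B28 — and for B75 as printed and its metaplectic statements; NOT for B75's quasi-split statements, NOT for E43,
NOT for B40.  In the all-ones assignment of the three DAGs (every leaf true; E41 and A8-p at their canonical values, both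
true there) the denied-remainder reading with its companions satisfies EVERY forty-fifth-tranche edge while the node,
`MoeglinMult1`, `MoeglinMp`, `HeiermannDecomp`, `HeiermannStd`, `AMSHecke` are FALSE and `MoeglinDSHypQS`,
`MoeglinMult1qs`, `MoeglinUnitaryDS`, `SolleveldQS` are TRUE.  The landed edges of tranches 43 / 44 (`E_AMSHecke`,
`E_HeiermannDecomp`, `E_HeiermannStd`, binder « the book at all ranks ») are precisely what fails in this reading: the
typed form of Heiermann's « forthcoming », of B47's « remains to be published » and of B28's « not all arguments have
been worked out in detail ». [cite: Heiermann2017Hecke, p0002:L3; Heiermann2016Standard, §3.1 p0006:L3; AubertMoussaouiSolleveld2022Hecke, §2 p0012:L8-9; Moeglin2011Mult1, §1 p0342:L22-29 (bookkeeping proved here)] -/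
theorem moeglinConsumers_need_node :
    ∃ c₄₃ : Consumers43, ∃ c₄₄ : Consumers44, ∃ c₄₅ : Consumers45,
      BookInputs νtop ∧ MokInputs μtop ∧ KMSWInputs μtop κtop ∧ (canon₁₄ νtop).MoeglinStable ∧
      (canon₁₃ νtop κtop).MRpadic ∧
      Implications45 νtop μtop κtop (canon₁₃ νtop κtop) (canon₁₄ νtop) c₄₃ c₄₄ c₄₅ ∧
      ¬ c₄₅.MoeglinDSHyp ∧ c₄₅.MoeglinDSHypQS ∧ ¬ c₄₅.MoeglinMult1 ∧ c₄₅.MoeglinMult1qs ∧ ¬ c₄₅.MoeglinMp ∧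
      c₄₅.MoeglinUnitaryDS ∧ ¬ c₄₄.HeiermannDecomp ∧ ¬ c₄₄.HeiermannStd ∧ ¬ c₄₃.AMSHecke ∧ c₄₃.SolleveldQS ∧
      ¬ E_HeiermannDecomp νtop (canon₁₄ νtop) c₄₄ ∧ ¬ E_HeiermannStd νtop μtop κtop c₄₄ ∧
      ¬ E_AMSHecke νtop μtop κtop (canon₁₃ νtop κtop) (canon₁₄ νtop) c₄₃ :=
  have A := bookInputs_top
  have b : ∀ N, νtop.Everything N := A.everything
  have m : ∀ N, μtop.Everything N := mokInputs_top.everything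
  have k : ∀ N, κtop.Scope N := KMSWInputs.scope mokInputs_top (kmswInputs_top μtop).1
  have e : (canon₁₄ νtop).MoeglinStable := fourteenth_holds_top
  have r : (canon₁₃ νtop κtop).MRpadic := thirteenth_holds_top.1.1
  have P := A.published
  ⟨c₄₃noM νtop μtop κtop, c₄₄noM νtop μtop κtop, canon₄₅noR νtop, A, mokInputs_top, (kmswInputs_top μtop).1,
    e, r, canon_implications₄₅noR νtop μtop κtop,
    fun h => h.2, b, fun h => h.2, b, fun h => h.2, ⟨P.llc, P.fl, P.transfer, P.itf, P.ttf⟩,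
    fun h => h.2.2, fun h => h.2.2, fun h => h.2.2, fortythird_holds_top.2.2.1,
    fun h => (h b e).2.2, fun h => (h b m k).2.2, fun h => (h b m k e r).2.2⟩

/-! ## 49. Forty-sixth tranche (v1.7 of this file, after `Downstream11.lean` v2): supports of the A6 split — `ChenZouO` /
`ChenZouU`, A10 `ChenZouLLCU`, and the RE-BASED readings of A12 Peng and C165 Graham — see the module docstring for the
summary of what is certified. -/

section Canon46

variable (ν : Nodes) (μ : Mok2015.Nodes) (κ : KMSW2014.Nodes)

/-- The canonical reading of the forty-sixth tranche: Case O := the book at all ranks, Case U := Mok's memoir at all ranks, A10 := Mok's memoir at all ranks. [cite: ChenZou2025AMF, Thms 2.1, 2.4 with p0003:L24; ChenZou2021LLCUnitary, Thm 2.5.1 (canonical model; bookkeeping)] -/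
abbrev canon₄₆ : Consumers46 where
  ChenZouO := (∀ N, ν.Everything N)
  ChenZouU := (∀ N, μ.Everything N)
  ChenZouLLCU := (∀ N, μ.Everything N)

/-- The fourth-tranche reading RE-BASED for A12: `canon₄` with `Peng` := the book at all ranks (its re-issued edge's inputs: book, Case O = book, `StabInner` ⊆ book), instead of section 8's book ∧ Mok. [cite: Peng2025, Thm 5.1 proof p0012:L2 (re-based canonical model; bookkeeping)] -/
abbrev c₄pengO : Consumers4 := { canon₄ ν μ κ with Peng := (∀ N, ν.Everything N) }

/-- The sixth-tranche reading RE-BASED for C165: `canon₆` with `Graham` := Mok's memoir at all ranks (Case U = Mok), instead of section 11's book ∧ Mok. [cite: Graham2026, p0092:L54 (re-based canonical model; bookkeeping)] -/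
abbrev c₆grahamU : Consumers6 := { canon₆ ν μ with Graham := (∀ N, μ.Everything N) }

/-- Every forty-sixth-tranche edge holds in the canonical / re-based readings (third tranche: `canon₃`), for arbitrary ν, μ, κ. [cite: ChenZou2025AMF, Thms 2.1, 2.4; Peng2025, Thm 5.1; Graham2026, Thms 1, 2; ChenZou2021LLCUnitary, Thm 2.5.1; DatEtAl2026, Thm 8.2 (bookkeeping proved here)] -/
theorem canon_implications₄₆ : Implications46 ν μ κ (canon ν μ κ) (canon₃ ν μ κ) (c₄pengO ν μ κ) (c₆grahamU ν μ) (canon₄₆ ν μ) where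
  chenZouO := fun b => b
  chenZouU := fun m => m
  cases := fun h => h
  join := fun b m => ⟨b, m⟩
  pengO := fun b _ _ => b
  grahamU := fun m => m
  chenZouLLCU := fun m => m
  dhkmB := fun b m k _ _ => ⟨b, m, k⟩

/-- THE RE-BASED READING OF A12 IS A READING OF THE LANDED REGISTER: every FOURTH-tranche edge (the landed `E_Peng` : book → `ChenZou` → `StabInner` → Peng included) holds with `Peng` := book. [cite: Peng2025, Thm 1 (bookkeeping proved here)] -/
theorem canon_implications₄pengO : Implications4 ν μ κ (canon ν μ κ) (canon₂ ν μ κ) (canon₃ ν μ κ) (c₄pengO ν μ κ) :=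
  { canon_implications₄ ν μ κ with peng := fun b _ _ => b }

/-- THE RE-BASED READING OF C165 IS A READING OF THE LANDED REGISTER: every SIXTH-tranche edge (the landed `E_Graham` : `ChenZou` → Graham included) holds with `Graham` := Mok. [cite: Graham2026, Thms 1, 2 (bookkeeping proved here)] -/
theorem canon_implications₆grahamU : Implications6 ν (canon ν μ κ) (c₆grahamU ν μ) :=
  { canon_implications₆ ν μ κ with graham := fun cz => cz.2 }

end Canon46

/-- At the top (every input of the three DAGs) the two cases, A10, the landed A6, Peng and Graham hold. [cite: ChenZou2025AMF, Thms 2.1, 2.4; Peng2025, Thm 1; Graham2026, Thms 1, 2 (bookkeeping proved here)] -/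
theorem fortysixth_holds_top :
    (canon₄₆ νtop μtop).ChenZouO ∧ (canon₄₆ νtop μtop).ChenZouU ∧ (canon₄₆ νtop μtop).ChenZouLLCU ∧ (canon νtop μtop κtop).ChenZou ∧ (c₄pengO νtop μtop κtop).Peng ∧
      (c₆grahamU νtop μtop).Graham :=
  have b : ∀ N, νtop.Everything N := bookInputs_top.everything
  have m : ∀ N, μtop.Everything N := mokInputs_top.everything
  ⟨b, m, m, ⟨b, m⟩, b, m⟩

/-- BOOK side: in each of the 24 book countermodels (Mok and KMSW at the all-ones assignment; every forty-sixth edge valid,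
and the landed fourth / sixth bundles valid in the re-based readings): Case O, the landed A6 and PENG FAIL; Case U, A10 and
GRAHAM HOLD — Graham's theorems inherit no leaf of the book's own DAG, as re-typed on Case U. [cite: Graham2026, p0092:L54; ChenZou2025AMF, p0003:L24 (bookkeeping proved here)] -/
theorem fortysixth_book_cm (l : LeafSupport.Leaf) :
    LeafSupport.Systems (LeafSupport.mkN (LeafSupport.cm l)) (LeafSupport.mkW (LeafSupport.cm l)) (LeafSupport.mkG (LeafSupport.cm l)) ∧
      (∀ l', l' ≠ l → (LeafSupport.mkN (LeafSupport.cm l)).leaf l') ∧ ¬ (LeafSupport.mkN (LeafSupport.cm l)).leaf l ∧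
      Implications46 (LeafSupport.mkN (LeafSupport.cm l)) μtop κtop (canon (LeafSupport.mkN (LeafSupport.cm l)) μtop κtop) (canon₃ (LeafSupport.mkN (LeafSupport.cm l)) μtop κtop) (c₄pengO (LeafSupport.mkN (LeafSupport.cm l)) μtop κtop) (c₆grahamU (LeafSupport.mkN (LeafSupport.cm l)) μtop) (canon₄₆ (LeafSupport.mkN (LeafSupport.cm l)) μtop) ∧
      Implications4 (LeafSupport.mkN (LeafSupport.cm l)) μtop κtop (canon (LeafSupport.mkN (LeafSupport.cm l)) μtop κtop) (canon₂ (LeafSupport.mkN (LeafSupport.cm l)) μtop κtop) (canon₃ (LeafSupport.mkN (LeafSupport.cm l)) μtop κtop) (c₄pengO (LeafSupport.mkN (LeafSupport.cm l)) μtop κtop) ∧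
      Implications6 (LeafSupport.mkN (LeafSupport.cm l)) (canon (LeafSupport.mkN (LeafSupport.cm l)) μtop κtop) (c₆grahamU (LeafSupport.mkN (LeafSupport.cm l)) μtop) ∧
      ¬ (canon₄₆ (LeafSupport.mkN (LeafSupport.cm l)) μtop).ChenZouO ∧ (canon₄₆ (LeafSupport.mkN (LeafSupport.cm l)) μtop).ChenZouU ∧ (canon₄₆ (LeafSupport.mkN (LeafSupport.cm l)) μtop).ChenZouLLCU ∧ ¬ (canon (LeafSupport.mkN (LeafSupport.cm l)) μtop κtop).ChenZou ∧
      ¬ (c₄pengO (LeafSupport.mkN (LeafSupport.cm l)) μtop κtop).Peng ∧ (c₆grahamU (LeafSupport.mkN (LeafSupport.cm l)) μtop).Graham :=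
  have cmod := LeafSupport.countermodel l
  have m : ∀ N, μtop.Everything N := mokInputs_top.everything
  ⟨cmod.1, cmod.2.1, cmod.2.2.1, canon_implications₄₆ _ _ _, canon_implications₄pengO _ _ _, canon_implications₆grahamU _ _ _,
    not_B_cm l, m, m, fun h => not_B_cm l h.1, not_B_cm l, m⟩

/-- MOK side: in each of Mok's 29 countermodels (book at the all-ones assignment; KMSW read without its import of Mok; every
forty-sixth edge valid, the landed fourth / sixth bundles valid in the re-based readings): Case U, A10, the landed A6 and
GRAHAM FAIL; Case O and PENG HOLD — Peng's endoscopic character identity for even special orthogonal groups inherits no leaf of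
Mok's memoir, as re-typed on Case O (section 8 had it inherit all 29). [cite: Peng2025, Thm 5.1 proof p0012:L2; ChenZou2025AMF, p0003:L24 (bookkeeping proved here)] -/
theorem fortysixth_mok_cm (l : Mok2015.LeafSupport.Leaf) :
    Mok2015.LeafSupport.Systems (Mok2015.LeafSupport.mkN (Mok2015.LeafSupport.cm l)) ∧
      (∀ l', l' ≠ l → (Mok2015.LeafSupport.mkN (Mok2015.LeafSupport.cm l)).leaf l') ∧ ¬ (Mok2015.LeafSupport.mkN (Mok2015.LeafSupport.cm l)).leaf l ∧
      Implications46 νtop (Mok2015.LeafSupport.mkN (Mok2015.LeafSupport.cm l)) κnoMok (canon νtop (Mok2015.LeafSupport.mkN (Mok2015.LeafSupport.cm l)) κnoMok) (canon₃ νtop (Mok2015.LeafSupport.mkN (Mok2015.LeafSupport.cm l)) κnoMok) (c₄pengO νtop (Mok2015.LeafSupport.mkN (Mok2015.LeafSupport.cm l)) κnoMok) (c₆grahamU νtop (Mok2015.LeafSupport.mkN (Mok2015.LeafSupport.cm l))) (canon₄₆ νtop (Mok2015.LeafSupport.mkN (Mok2015.LeafSupport.cm l))) ∧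
      Implications4 νtop (Mok2015.LeafSupport.mkN (Mok2015.LeafSupport.cm l)) κnoMok (canon νtop (Mok2015.LeafSupport.mkN (Mok2015.LeafSupport.cm l)) κnoMok) (canon₂ νtop (Mok2015.LeafSupport.mkN (Mok2015.LeafSupport.cm l)) κnoMok) (canon₃ νtop (Mok2015.LeafSupport.mkN (Mok2015.LeafSupport.cm l)) κnoMok) (c₄pengO νtop (Mok2015.LeafSupport.mkN (Mok2015.LeafSupport.cm l)) κnoMok) ∧
      Implications6 νtop (canon νtop (Mok2015.LeafSupport.mkN (Mok2015.LeafSupport.cm l)) κnoMok) (c₆grahamU νtop (Mok2015.LeafSupport.mkN (Mok2015.LeafSupport.cm l))) ∧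
      (canon₄₆ νtop (Mok2015.LeafSupport.mkN (Mok2015.LeafSupport.cm l))).ChenZouO ∧ ¬ (canon₄₆ νtop (Mok2015.LeafSupport.mkN (Mok2015.LeafSupport.cm l))).ChenZouU ∧ ¬ (canon₄₆ νtop (Mok2015.LeafSupport.mkN (Mok2015.LeafSupport.cm l))).ChenZouLLCU ∧ ¬ (canon νtop (Mok2015.LeafSupport.mkN (Mok2015.LeafSupport.cm l)) κnoMok).ChenZou ∧
      (c₄pengO νtop (Mok2015.LeafSupport.mkN (Mok2015.LeafSupport.cm l)) κnoMok).Peng ∧ ¬ (c₆grahamU νtop (Mok2015.LeafSupport.mkN (Mok2015.LeafSupport.cm l))).Graham :=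
  have cmod := Mok2015.LeafSupport.countermodel l
  have b : ∀ N, νtop.Everything N := bookInputs_top.everything
  ⟨cmod.1, cmod.2.1, cmod.2.2.1, canon_implications₄₆ _ _ _, canon_implications₄pengO _ _ _, canon_implications₆grahamU _ _ _,
    b, not_M_cm l, not_M_cm l, fun h => not_M_cm l h.2, b, not_M_cm l⟩

/-- KMSW side: in KMSW's countermodel for any leaf `l ≠ MokMain` everything of the tranche holds (no KMSW premise). [claim: KalethaMinguezShinWhite2014, under-review] [cite: ChenZou2025AMF, p0003:L24 (bookkeeping proved here)] -/
theorem fortysixth_kmsw_cm (l : KMSW2014.LeafSupport.Leaf) (hl : l ≠ .MokMain) :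
    (∃ ωκ, KMSW2014.LeafSupport.Systems (KMSW2014.LeafSupport.mkN (KMSW2014.LeafSupport.cm l)) ωκ) ∧
      (∀ l', l' ≠ l → (KMSW2014.LeafSupport.mkN (KMSW2014.LeafSupport.cm l)).leaf l') ∧ ¬ (KMSW2014.LeafSupport.mkN (KMSW2014.LeafSupport.cm l)).leaf l ∧
      KMSW2014.E_ImportMok μtop (KMSW2014.LeafSupport.mkN (KMSW2014.LeafSupport.cm l)) ∧
      Implications46 νtop μtop (KMSW2014.LeafSupport.mkN (KMSW2014.LeafSupport.cm l)) (canon νtop μtop (KMSW2014.LeafSupport.mkN (KMSW2014.LeafSupport.cm l))) (canon₃ νtop μtop (KMSW2014.LeafSupport.mkN (KMSW2014.LeafSupport.cm l))) (c₄pengO νtop μtop (KMSW2014.LeafSupport.mkN (KMSW2014.LeafSupport.cm l))) (c₆grahamU νtop μtop) (canon₄₆ νtop μtop) ∧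
      (canon₄₆ νtop μtop).ChenZouO ∧ (canon₄₆ νtop μtop).ChenZouU ∧ (canon₄₆ νtop μtop).ChenZouLLCU ∧ (canon νtop μtop (KMSW2014.LeafSupport.mkN (KMSW2014.LeafSupport.cm l))).ChenZou ∧ (c₄pengO νtop μtop (KMSW2014.LeafSupport.mkN (KMSW2014.LeafSupport.cm l))).Peng ∧
      (c₆grahamU νtop μtop).Graham :=
  have cmod := KMSW2014.LeafSupport.countermodel l
  have b : ∀ N, νtop.Everything N := bookInputs_top.everything
  have m : ∀ N, μtop.Everything N := mokInputs_top.everything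
  ⟨⟨_, cmod.1⟩, cmod.2.1, cmod.2.2.1, fun _ => cmod.2.1 .MokMain (Ne.symm hl), canon_implications₄₆ _ _ _, b, m, m, ⟨b, m⟩,
    b, m⟩

/-! ## 50. Forty-seventh tranche (v1.8 of this file, after `Downstream11.lean` v3): supports of the Mœglin conduits, II
— `ArthurClay30`, E42 `MoeglinDS2007` (re-graded against E43), `MoeglinHypGen` / `MoeglinHypGenSOU`, B71, B72 — see the
module docstring for the summary of what is certified. -/

section Canon47

variable (ν : Nodes) (μ : Mok2015.Nodes) (κ : KMSW2014.Nodes)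

/-- The canonical reading of the forty-seventh tranche: Arthur 2005 §30 := the book at all ranks; E42's own hypothesis GRANTED; E42 := FL ∧ Transfer ∧ book; the « Hypothèse générale », its instance, B71, B72 := B75's value ∧ E43's five published leaves. [cite: Arthur2005IntroTraceFormula, Thm 30.1; Moeglin2007DiscreteSeries, §1.2; Moeglin2009DiscretePackets, p0005:L134 (canonical model; bookkeeping)] -/
abbrev canon₄₇ : Consumers47 where
  ArthurClay30 := (∀ N, ν.Everything N)
  MoeglinIcuspHyp := True
  MoeglinDS2007 := ν.FL ∧ ν.Transfer ∧ (∀ N, ν.Everything N)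
  MoeglinHypGen := ((∀ N, ν.Everything N) ∧ True) ∧ (ν.LLC_GLN ∧ ν.FL ∧ ν.Transfer ∧ ν.InvariantTF ∧ ν.TwistedTF)
  MoeglinHypGenSOU := ((∀ N, ν.Everything N) ∧ True) ∧ (ν.LLC_GLN ∧ ν.FL ∧ ν.Transfer ∧ ν.InvariantTF ∧ ν.TwistedTF)
  MoeglinDiscretePackets := ((∀ N, ν.Everything N) ∧ True) ∧ (ν.LLC_GLN ∧ ν.FL ∧ ν.Transfer ∧ ν.InvariantTF ∧ ν.TwistedTF)
  MoeglinPacketsComb := ((∀ N, ν.Everything N) ∧ True) ∧ (ν.LLC_GLN ∧ ν.FL ∧ ν.Transfer ∧ ν.InvariantTF ∧ ν.TwistedTF)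

/-- Every forty-seventh-tranche edge holds in the canonical reading (over the unchanged `canon₄₅`), for arbitrary ν. [cite: Arthur2005IntroTraceFormula, Thm 30.1; Moeglin2007DiscreteSeries, Théorèmes; Moeglin2009DiscretePackets, p0005:L134; Moeglin2006PacketsComb, §1.4; Moeglin2011Mult1, §1 (bookkeeping proved here)] -/
theorem canon_implications₄₇ : Implications47 ν (canon₄₅ ν) (canon₄₇ ν) where
  clay30 := fun b => b
  dsHypQS_of_clay30 := fun b => b
  ds2007 := fun f t b _ => ⟨f, t, b⟩
  hypGenSOU := fun d u => ⟨⟨d.2.2, trivial⟩, u⟩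
  hypGenSOU_of_printed := fun h => h
  hypGen := fun m u => ⟨m, u⟩
  discretePackets := fun h => h
  packetsComb := fun h _ => h

end Canon47

/-- At the top (every input of the book's DAG) all six typed statements of the tranche hold. [cite: Arthur2005IntroTraceFormula, Thm 30.1; Moeglin2007DiscreteSeries, Théorèmes (bookkeeping proved here)] -/
theorem fortyseventh_holds_top :
    (canon₄₇ νtop).ArthurClay30 ∧ (canon₄₇ νtop).MoeglinDS2007 ∧ (canon₄₇ νtop).MoeglinHypGen ∧ (canon₄₇ νtop).MoeglinHypGenSOU ∧
      (canon₄₇ νtop).MoeglinDiscretePackets ∧ (canon₄₇ νtop).MoeglinPacketsComb :=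
  have b : ∀ N, νtop.Everything N := bookInputs_top.everything
  have P := bookInputs_top.published
  have u : (νtop.LLC_GLN ∧ νtop.FL ∧ νtop.Transfer ∧ νtop.InvariantTF ∧ νtop.TwistedTF) := ⟨P.llc, P.fl, P.transfer, P.itf, P.ttf⟩
  ⟨b, ⟨P.fl, P.transfer, b⟩, ⟨⟨b, trivial⟩, u⟩, ⟨⟨b, trivial⟩, u⟩, ⟨⟨b, trivial⟩, u⟩, ⟨⟨b, trivial⟩, u⟩⟩

/-- BOOK side: in each of the 24 book countermodels (every forty-fifth and forty-seventh edge valid): Arthur 2005 §30 as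
typed, E42, the « Hypothèse générale », its instance, B71 and B72 ALL FAIL. [cite: Moeglin2007DiscreteSeries, §1.2 (p0005:L16-19); Moeglin2009DiscretePackets, p0005:L134 (bookkeeping proved here)] -/
theorem fortyseventh_book_cm (l : LeafSupport.Leaf) :
    LeafSupport.Systems (LeafSupport.mkN (LeafSupport.cm l)) (LeafSupport.mkW (LeafSupport.cm l)) (LeafSupport.mkG (LeafSupport.cm l)) ∧
      (∀ l', l' ≠ l → (LeafSupport.mkN (LeafSupport.cm l)).leaf l') ∧ ¬ (LeafSupport.mkN (LeafSupport.cm l)).leaf l ∧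
      Implications45 (LeafSupport.mkN (LeafSupport.cm l)) μtop κtop (canon₁₃ (LeafSupport.mkN (LeafSupport.cm l)) κtop) (canon₁₄ (LeafSupport.mkN (LeafSupport.cm l))) (canon₄₃ (LeafSupport.mkN (LeafSupport.cm l)) μtop κtop) (canon₄₄ (LeafSupport.mkN (LeafSupport.cm l)) μtop κtop) (canon₄₅ (LeafSupport.mkN (LeafSupport.cm l))) ∧
      Implications47 (LeafSupport.mkN (LeafSupport.cm l)) (canon₄₅ (LeafSupport.mkN (LeafSupport.cm l))) (canon₄₇ (LeafSupport.mkN (LeafSupport.cm l))) ∧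
      ¬ (canon₄₇ (LeafSupport.mkN (LeafSupport.cm l))).ArthurClay30 ∧ ¬ (canon₄₇ (LeafSupport.mkN (LeafSupport.cm l))).MoeglinDS2007 ∧ ¬ (canon₄₇ (LeafSupport.mkN (LeafSupport.cm l))).MoeglinHypGen ∧ ¬ (canon₄₇ (LeafSupport.mkN (LeafSupport.cm l))).MoeglinHypGenSOU ∧
      ¬ (canon₄₇ (LeafSupport.mkN (LeafSupport.cm l))).MoeglinDiscretePackets ∧ ¬ (canon₄₇ (LeafSupport.mkN (LeafSupport.cm l))).MoeglinPacketsComb :=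
  have cmod := LeafSupport.countermodel l
  have nb := not_B_cm l
  ⟨cmod.1, cmod.2.1, cmod.2.2.1, canon_implications₄₅ _ _ _, canon_implications₄₇ _, nb, fun h => nb h.2.2,
    fun h => nb h.1.1, fun h => nb h.1.1, fun h => nb h.1.1, fun h => nb h.1.1⟩

/-- THE RE-GRADING OF E42, CERTIFIED: in the book countermodel of each of the NINE OPEN leaves of the book's DAG (the
seven preprint leaves, the two unwritten weighted fundamental lemmas; every forty-fifth and forty-seventh edge valid)
E42 — census grade « CONTROL » — FAILS, while E43 HOLDS.  As typed through its use of Arthur 2005 Theorem 30.1, E42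
inherits every open leaf; E43 (tranche 45: published leaves only) none. [cite: Moeglin2007DiscreteSeries, §1.2 (p0005:L16-19); Arthur2005IntroTraceFormula, p0234:L6-12, p0246:L16-18; Moeglin2007Unitary, p0001:L14-17 (bookkeeping proved here)] -/
theorem e42_vs_e43_open_leaves (l : LeafSupport.Leaf)
    (hl : l = .AGIKMS_181 ∨ l = .AGIKMS_191 ∨ l = .AGIKMS_1105 ∨ l = .AGIKMS_D21 ∨ l = .AGIKMS_AppE ∨ l = .KM26 ∨
      l = .CK26 ∨ l = .WFL_general ∨ l = .WFL_nonstandard) :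
    Implications45 (LeafSupport.mkN (LeafSupport.cm l)) μtop κtop (canon₁₃ (LeafSupport.mkN (LeafSupport.cm l)) κtop) (canon₁₄ (LeafSupport.mkN (LeafSupport.cm l))) (canon₄₃ (LeafSupport.mkN (LeafSupport.cm l)) μtop κtop) (canon₄₄ (LeafSupport.mkN (LeafSupport.cm l)) μtop κtop) (canon₄₅ (LeafSupport.mkN (LeafSupport.cm l))) ∧
      Implications47 (LeafSupport.mkN (LeafSupport.cm l)) (canon₄₅ (LeafSupport.mkN (LeafSupport.cm l))) (canon₄₇ (LeafSupport.mkN (LeafSupport.cm l))) ∧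
      ¬ (canon₄₇ (LeafSupport.mkN (LeafSupport.cm l))).MoeglinDS2007 ∧ (canon₄₅ (LeafSupport.mkN (LeafSupport.cm l))).MoeglinUnitaryDS :=
  ⟨canon_implications₄₅ _ _ _, canon_implications₄₇ _, fun h => not_B_cm l h.2.2,
    (moeglinUnitaryDS_indep_open_leaves l hl).2.1⟩

/-- The pair E42 / E43 on the FIVE PUBLISHED leaves LLC_GLN, FL, Transfer, InvariantTF, TwistedTF: in each of these book
countermodels BOTH fail (E42 through the book, E43 through its own premises). [cite: Moeglin2007DiscreteSeries, p0003:L15; Moeglin2007Unitary, p0001:L14-17 (bookkeeping proved here)] -/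
theorem moeglin2007_pair_published_leaves (l : LeafSupport.Leaf)
    (hl : l = .LLC_GLN ∨ l = .FL ∨ l = .Transfer ∨ l = .InvariantTF ∨ l = .TwistedTF) :
    ¬ (canon₄₇ (LeafSupport.mkN (LeafSupport.cm l))).MoeglinDS2007 ∧ ¬ (canon₄₅ (LeafSupport.mkN (LeafSupport.cm l))).MoeglinUnitaryDS :=
  ⟨fun h => not_B_cm l h.2.2, (moeglinUnitaryDS_cm_fails l hl).2⟩

/-- MOK side: in each of Mok's 29 countermodels (book at the all-ones assignment) every forty-seventh edge is valid and
ALL SIX statements HOLD — no Mok premise in the Mœglin series. [cite: Moeglin2009DiscretePackets, §1.1 (the groups: symplectic, orthogonal); Moeglin2007DiscreteSeries, §0 (bookkeeping proved here)] -/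
theorem fortyseventh_mok_cm (l : Mok2015.LeafSupport.Leaf) :
    Mok2015.LeafSupport.Systems (Mok2015.LeafSupport.mkN (Mok2015.LeafSupport.cm l)) ∧
      (∀ l', l' ≠ l → (Mok2015.LeafSupport.mkN (Mok2015.LeafSupport.cm l)).leaf l') ∧ ¬ (Mok2015.LeafSupport.mkN (Mok2015.LeafSupport.cm l)).leaf l ∧
      Implications47 νtop (canon₄₅ νtop) (canon₄₇ νtop) ∧
      (canon₄₇ νtop).ArthurClay30 ∧ (canon₄₇ νtop).MoeglinDS2007 ∧ (canon₄₇ νtop).MoeglinHypGen ∧ (canon₄₇ νtop).MoeglinHypGenSOU ∧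
      (canon₄₇ νtop).MoeglinDiscretePackets ∧ (canon₄₇ νtop).MoeglinPacketsComb :=
  have cmod := Mok2015.LeafSupport.countermodel l
  ⟨cmod.1, cmod.2.1, cmod.2.2.1, canon_implications₄₇ _, fortyseventh_holds_top⟩

/-- KMSW side: in KMSW's countermodel for any leaf `l ≠ MokMain` every forty-seventh edge is valid and all six statements
hold (no KMSW premise). [claim: KalethaMinguezShinWhite2014, under-review] [cite: Moeglin2007DiscreteSeries, §0 (bookkeeping proved here)] -/
theorem fortyseventh_kmsw_cm (l : KMSW2014.LeafSupport.Leaf) (hl : l ≠ .MokMain) :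
    (∃ ωκ, KMSW2014.LeafSupport.Systems (KMSW2014.LeafSupport.mkN (KMSW2014.LeafSupport.cm l)) ωκ) ∧
      (∀ l', l' ≠ l → (KMSW2014.LeafSupport.mkN (KMSW2014.LeafSupport.cm l)).leaf l') ∧ ¬ (KMSW2014.LeafSupport.mkN (KMSW2014.LeafSupport.cm l)).leaf l ∧
      KMSW2014.E_ImportMok μtop (KMSW2014.LeafSupport.mkN (KMSW2014.LeafSupport.cm l)) ∧
      Implications47 νtop (canon₄₅ νtop) (canon₄₇ νtop) ∧
      (canon₄₇ νtop).ArthurClay30 ∧ (canon₄₇ νtop).MoeglinDS2007 ∧ (canon₄₇ νtop).MoeglinHypGen ∧ (canon₄₇ νtop).MoeglinHypGenSOU ∧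
      (canon₄₇ νtop).MoeglinDiscretePackets ∧ (canon₄₇ νtop).MoeglinPacketsComb :=
  have cmod := KMSW2014.LeafSupport.countermodel l
  ⟨⟨_, cmod.1⟩, cmod.2.1, cmod.2.2.1, fun _ => cmod.2.1 .MokMain (Ne.symm hl), canon_implications₄₇ _, fortyseventh_holds_top⟩

/-! ## 51. Forty-eighth tranche (v1.9 of this file, after `Downstream11.lean` v4; unit `pub-arthur-down-g26`): supports of
the Mœglin conduits, III — B70 `MoeglinElementary` / `MoeglinElemHyp`, B73 `MoeglinHolomorphy`, B74 `MoeglinComparaison` /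
`MoeglinLdsConv` — see the module docstring for the summary of what is certified. -/

section Canon48

variable (ν : Nodes) (μ : Mok2015.Nodes) (κ : KMSW2014.Nodes)

/-- The canonical reading of the forty-eighth tranche: every field := (B75's value: book ∧ granted remainder) ∧ (E43's five published leaves), the value `canon₄₇` gives the « Hypothèse générale », B71 and B72. [cite: Moeglin2006Elementary, §2.1; Moeglin2010Holomorphy, §2.1; Moeglin2009Comparaison, p0004:L2 (canonical model; bookkeeping)] -/
abbrev canon₄₈ : Consumers48 where
  MoeglinElemHyp := ((∀ N, ν.Everything N) ∧ True) ∧ (ν.LLC_GLN ∧ ν.FL ∧ ν.Transfer ∧ ν.InvariantTF ∧ ν.TwistedTF)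
  MoeglinElementary := ((∀ N, ν.Everything N) ∧ True) ∧ (ν.LLC_GLN ∧ ν.FL ∧ ν.Transfer ∧ ν.InvariantTF ∧ ν.TwistedTF)
  MoeglinHolomorphy := ((∀ N, ν.Everything N) ∧ True) ∧ (ν.LLC_GLN ∧ ν.FL ∧ ν.Transfer ∧ ν.InvariantTF ∧ ν.TwistedTF)
  MoeglinLdsConv := ((∀ N, ν.Everything N) ∧ True) ∧ (ν.LLC_GLN ∧ ν.FL ∧ ν.Transfer ∧ ν.InvariantTF ∧ ν.TwistedTF)
  MoeglinComparaison := ((∀ N, ν.Everything N) ∧ True) ∧ (ν.LLC_GLN ∧ ν.FL ∧ ν.Transfer ∧ ν.InvariantTF ∧ ν.TwistedTF)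

/-- Every forty-eighth-tranche edge holds in the canonical reading (over the unchanged `canon₄₅`, `canon₄₇`), for arbitrary ν. [cite: Moeglin2006Elementary, §2.1; Moeglin2010Holomorphy, Thm 3.2.1; Moeglin2009Comparaison, Thm 2.4 (bookkeeping proved here)] -/
theorem canon_implications₄₈ : Implications48 (canon₄₅ ν) (canon₄₇ ν) (canon₄₈ ν) where
  elemHyp := fun h => h
  elementary := fun h => h
  holomorphy := fun _ _ e _ _ => e
  ldsConv := fun _ d => d
  comparaison := fun l _ _ _ _ _ _ => l

/-- The forty-seventh-tranche reading COMPANION to the denied remainder of section 48 (`canon₄₅noR`: B75's node and `MoeglinMult1` carry the conjunct `False`): Arthur 2005 §30 := book, E42's node granted, E42 := FL ∧ Transfer ∧ book, the instance `MoeglinHypGenSOU` := its canonical value (E42 ∧ E43 feed it), and the « Hypothèse générale », B71, B72 := (book ∧ False) ∧ E43's leaves — what the 2011 supplier edge then delivers. [cite: Moeglin2009DiscretePackets, p0005:L134; Moeglin2006PacketsComb, §1.4 p0005:L6-7 (separating model; bookkeeping)] -/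
abbrev canon₄₇noR : Consumers47 where
  ArthurClay30 := (∀ N, ν.Everything N)
  MoeglinIcuspHyp := True
  MoeglinDS2007 := ν.FL ∧ ν.Transfer ∧ (∀ N, ν.Everything N)
  MoeglinHypGen := ((∀ N, ν.Everything N) ∧ False) ∧ (ν.LLC_GLN ∧ ν.FL ∧ ν.Transfer ∧ ν.InvariantTF ∧ ν.TwistedTF)
  MoeglinHypGenSOU := ((∀ N, ν.Everything N) ∧ True) ∧ (ν.LLC_GLN ∧ ν.FL ∧ ν.Transfer ∧ ν.InvariantTF ∧ ν.TwistedTF)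
  MoeglinDiscretePackets := ((∀ N, ν.Everything N) ∧ False) ∧ (ν.LLC_GLN ∧ ν.FL ∧ ν.Transfer ∧ ν.InvariantTF ∧ ν.TwistedTF)
  MoeglinPacketsComb := ((∀ N, ν.Everything N) ∧ False) ∧ (ν.LLC_GLN ∧ ν.FL ∧ ν.Transfer ∧ ν.InvariantTF ∧ ν.TwistedTF)

/-- The forty-eighth-tranche reading COMPANION to the denied remainder: all five fields := (book ∧ False) ∧ E43's leaves. [cite: Moeglin2009Comparaison, p0004:L2; Moeglin2006Elementary, p0001:L24-25 (separating model; bookkeeping)] -/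
abbrev canon₄₈noR : Consumers48 where
  MoeglinElemHyp := ((∀ N, ν.Everything N) ∧ False) ∧ (ν.LLC_GLN ∧ ν.FL ∧ ν.Transfer ∧ ν.InvariantTF ∧ ν.TwistedTF)
  MoeglinElementary := ((∀ N, ν.Everything N) ∧ False) ∧ (ν.LLC_GLN ∧ ν.FL ∧ ν.Transfer ∧ ν.InvariantTF ∧ ν.TwistedTF)
  MoeglinHolomorphy := ((∀ N, ν.Everything N) ∧ False) ∧ (ν.LLC_GLN ∧ ν.FL ∧ ν.Transfer ∧ ν.InvariantTF ∧ ν.TwistedTF)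
  MoeglinLdsConv := ((∀ N, ν.Everything N) ∧ False) ∧ (ν.LLC_GLN ∧ ν.FL ∧ ν.Transfer ∧ ν.InvariantTF ∧ ν.TwistedTF)
  MoeglinComparaison := ((∀ N, ν.Everything N) ∧ False) ∧ (ν.LLC_GLN ∧ ν.FL ∧ ν.Transfer ∧ ν.InvariantTF ∧ ν.TwistedTF)

/-- Every forty-seventh-tranche edge holds in the denied-remainder readings (`canon₄₅noR`, `canon₄₇noR`), for arbitrary ν. [cite: Arthur2005IntroTraceFormula, Thm 30.1; Moeglin2007DiscreteSeries, §1.2; Moeglin2009DiscretePackets, p0005:L134; Moeglin2006PacketsComb, §1.4 (bookkeeping proved here)] -/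
theorem canon_implications₄₇noR : Implications47 ν (canon₄₅noR ν) (canon₄₇noR ν) where
  clay30 := fun b => b
  dsHypQS_of_clay30 := fun b => b
  ds2007 := fun f t b _ => ⟨f, t, b⟩
  hypGenSOU := fun d u => ⟨⟨d.2.2, trivial⟩, u⟩
  hypGenSOU_of_printed := fun h => ⟨⟨h.1.1, trivial⟩, h.2⟩
  hypGen := fun m u => ⟨m, u⟩
  discretePackets := fun h => h
  packetsComb := fun h _ => h

/-- Every forty-eighth-tranche edge holds in the denied-remainder readings (`canon₄₅noR`, `canon₄₇noR`, `canon₄₈noR`), for arbitrary ν. [cite: Moeglin2006Elementary, §2.1; Moeglin2010Holomorphy, §2.1; Moeglin2009Comparaison, §2.1 (bookkeeping proved here)] -/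
theorem canon_implications₄₈noR : Implications48 (canon₄₅noR ν) (canon₄₇noR ν) (canon₄₈noR ν) where
  elemHyp := fun h => h
  elementary := fun h => h
  holomorphy := fun _ _ e _ _ => e
  ldsConv := fun _ d => d
  comparaison := fun l _ _ _ _ _ _ => l

end Canon48

/-- At the top (every input of the book's DAG; the remainder granted by the reading) all five typed statements of the
tranche hold, through the tranche's own `moeglinConduitsIII_of_inputs`. [cite: Moeglin2006Elementary, §§3–7; Moeglin2010Holomorphy, Thm 3.2.1; Moeglin2009Comparaison, Thm 2.4 (bookkeeping proved here)] -/
theorem fortyeighth_holds_top :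
    (canon₄₈ νtop).MoeglinElemHyp ∧ (canon₄₈ νtop).MoeglinElementary ∧ (canon₄₈ νtop).MoeglinHolomorphy ∧ (canon₄₈ νtop).MoeglinLdsConv ∧
      (canon₄₈ νtop).MoeglinComparaison :=
  moeglinConduitsIII_of_inputs (canon_implications₄₈ νtop) (canon_implications₄₇ νtop) (canon_implications₄₅ νtop μtop κtop)
    bookInputs_top ⟨bookInputs_top.everything, trivial⟩

/-- BOOK side: in each of the 24 book countermodels (every edge of tranches 45, 47 and 48 valid) B70 and its node, B73,
B74 and its node ALL FAIL. [cite: Moeglin2006Elementary, §2.1 (p0008:L38-45); Moeglin2010Holomorphy, §2.1 (p0006:L16); Moeglin2009Comparaison, p0002:L19, p0004:L2 (bookkeeping proved here)] -/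
theorem fortyeighth_book_cm (l : LeafSupport.Leaf) :
    LeafSupport.Systems (LeafSupport.mkN (LeafSupport.cm l)) (LeafSupport.mkW (LeafSupport.cm l)) (LeafSupport.mkG (LeafSupport.cm l)) ∧
      (∀ l', l' ≠ l → (LeafSupport.mkN (LeafSupport.cm l)).leaf l') ∧ ¬ (LeafSupport.mkN (LeafSupport.cm l)).leaf l ∧
      Implications45 (LeafSupport.mkN (LeafSupport.cm l)) μtop κtop (canon₁₃ (LeafSupport.mkN (LeafSupport.cm l)) κtop) (canon₁₄ (LeafSupport.mkN (LeafSupport.cm l))) (canon₄₃ (LeafSupport.mkN (LeafSupport.cm l)) μtop κtop) (canon₄₄ (LeafSupport.mkN (LeafSupport.cm l)) μtop κtop) (canon₄₅ (LeafSupport.mkN (LeafSupport.cm l))) ∧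
      Implications47 (LeafSupport.mkN (LeafSupport.cm l)) (canon₄₅ (LeafSupport.mkN (LeafSupport.cm l))) (canon₄₇ (LeafSupport.mkN (LeafSupport.cm l))) ∧
      Implications48 (canon₄₅ (LeafSupport.mkN (LeafSupport.cm l))) (canon₄₇ (LeafSupport.mkN (LeafSupport.cm l))) (canon₄₈ (LeafSupport.mkN (LeafSupport.cm l))) ∧
      ¬ (canon₄₈ (LeafSupport.mkN (LeafSupport.cm l))).MoeglinElemHyp ∧ ¬ (canon₄₈ (LeafSupport.mkN (LeafSupport.cm l))).MoeglinElementary ∧ ¬ (canon₄₈ (LeafSupport.mkN (LeafSupport.cm l))).MoeglinHolomorphy ∧ ¬ (canon₄₈ (LeafSupport.mkN (LeafSupport.cm l))).MoeglinLdsConv ∧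
      ¬ (canon₄₈ (LeafSupport.mkN (LeafSupport.cm l))).MoeglinComparaison :=
  have cmod := LeafSupport.countermodel l
  have nb := not_B_cm l
  ⟨cmod.1, cmod.2.1, cmod.2.2.1, canon_implications₄₅ _ _ _, canon_implications₄₇ _, canon_implications₄₈ _,
    fun h => nb h.1.1, fun h => nb h.1.1, fun h => nb h.1.1, fun h => nb h.1.1, fun h => nb h.1.1⟩

/-- THE NINE OPEN LEAVES: in the book countermodel of each of the seven 2024–2026 preprint leaves and of the two unwritten
weighted fundamental lemmas (every edge of tranches 45, 47, 48 valid), B70, B73, B74 and both nodes FAIL while E43 —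
whose five published leaves are the other conjunct of their canonical values — HOLDS: what fails is Arthur's input, not
Mœglin's published ones. [cite: Moeglin2010Holomorphy, §2.1 (p0006:L16-18), §2.6 (p0009:L11); Moeglin2007Unitary, p0001:L14-17 (bookkeeping proved here)] -/
theorem fortyeighth_open_leaves (l : LeafSupport.Leaf)
    (hl : l = .AGIKMS_181 ∨ l = .AGIKMS_191 ∨ l = .AGIKMS_1105 ∨ l = .AGIKMS_D21 ∨ l = .AGIKMS_AppE ∨ l = .KM26 ∨
      l = .CK26 ∨ l = .WFL_general ∨ l = .WFL_nonstandard) :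
    Implications48 (canon₄₅ (LeafSupport.mkN (LeafSupport.cm l))) (canon₄₇ (LeafSupport.mkN (LeafSupport.cm l))) (canon₄₈ (LeafSupport.mkN (LeafSupport.cm l))) ∧
      ¬ (canon₄₈ (LeafSupport.mkN (LeafSupport.cm l))).MoeglinElemHyp ∧ ¬ (canon₄₈ (LeafSupport.mkN (LeafSupport.cm l))).MoeglinElementary ∧ ¬ (canon₄₈ (LeafSupport.mkN (LeafSupport.cm l))).MoeglinHolomorphy ∧ ¬ (canon₄₈ (LeafSupport.mkN (LeafSupport.cm l))).MoeglinLdsConv ∧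
      ¬ (canon₄₈ (LeafSupport.mkN (LeafSupport.cm l))).MoeglinComparaison ∧
      (canon₄₅ (LeafSupport.mkN (LeafSupport.cm l))).MoeglinUnitaryDS :=
  have nb := not_B_cm l
  ⟨canon_implications₄₈ _, fun h => nb h.1.1, fun h => nb h.1.1, fun h => nb h.1.1, fun h => nb h.1.1, fun h => nb h.1.1,
    (moeglinUnitaryDS_indep_open_leaves l hl).2.1⟩

/-- MOK side: in each of Mok's 29 countermodels (book at the all-ones assignment; KMSW read without its import of Mok) every
forty-eighth edge is valid and ALL FIVE statements HOLD — no Mok premise in the series (its unitary members are not typed,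
`Downstream11.lean` v4). [cite: Moeglin2010Holomorphy, §1 (p0004:L4); Moeglin2009Comparaison, p0002:L7 (bookkeeping proved here)] -/
theorem fortyeighth_mok_cm (l : Mok2015.LeafSupport.Leaf) :
    Mok2015.LeafSupport.Systems (Mok2015.LeafSupport.mkN (Mok2015.LeafSupport.cm l)) ∧
      (∀ l', l' ≠ l → (Mok2015.LeafSupport.mkN (Mok2015.LeafSupport.cm l)).leaf l') ∧ ¬ (Mok2015.LeafSupport.mkN (Mok2015.LeafSupport.cm l)).leaf l ∧
      Implications45 νtop (Mok2015.LeafSupport.mkN (Mok2015.LeafSupport.cm l)) κnoMok (canon₁₃ νtop κnoMok) (canon₁₄ νtop) (canon₄₃ νtop (Mok2015.LeafSupport.mkN (Mok2015.LeafSupport.cm l)) κnoMok) (canon₄₄ νtop (Mok2015.LeafSupport.mkN (Mok2015.LeafSupport.cm l)) κnoMok) (canon₄₅ νtop) ∧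
      Implications48 (canon₄₅ νtop) (canon₄₇ νtop) (canon₄₈ νtop) ∧
      (canon₄₈ νtop).MoeglinElemHyp ∧ (canon₄₈ νtop).MoeglinElementary ∧ (canon₄₈ νtop).MoeglinHolomorphy ∧ (canon₄₈ νtop).MoeglinLdsConv ∧
      (canon₄₈ νtop).MoeglinComparaison :=
  have cmod := Mok2015.LeafSupport.countermodel l
  ⟨cmod.1, cmod.2.1, cmod.2.2.1, canon_implications₄₅ _ _ _, canon_implications₄₈ _, fortyeighth_holds_top⟩

/-- KMSW side: in KMSW's countermodel for any leaf `l ≠ MokMain` (book and Mok at the all-ones assignment; the Mok import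
edge then holds) every forty-eighth edge is valid and all five statements hold (no KMSW premise). [claim: KalethaMinguezShinWhite2014, under-review] [cite: Moeglin2009Comparaison, p0002:L7 (bookkeeping proved here)] -/
theorem fortyeighth_kmsw_cm (l : KMSW2014.LeafSupport.Leaf) (hl : l ≠ .MokMain) :
    (∃ ωκ, KMSW2014.LeafSupport.Systems (KMSW2014.LeafSupport.mkN (KMSW2014.LeafSupport.cm l)) ωκ) ∧
      (∀ l', l' ≠ l → (KMSW2014.LeafSupport.mkN (KMSW2014.LeafSupport.cm l)).leaf l') ∧ ¬ (KMSW2014.LeafSupport.mkN (KMSW2014.LeafSupport.cm l)).leaf l ∧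
      KMSW2014.E_ImportMok μtop (KMSW2014.LeafSupport.mkN (KMSW2014.LeafSupport.cm l)) ∧
      Implications45 νtop μtop (KMSW2014.LeafSupport.mkN (KMSW2014.LeafSupport.cm l)) (canon₁₃ νtop (KMSW2014.LeafSupport.mkN (KMSW2014.LeafSupport.cm l))) (canon₁₄ νtop) (canon₄₃ νtop μtop (KMSW2014.LeafSupport.mkN (KMSW2014.LeafSupport.cm l))) (canon₄₄ νtop μtop (KMSW2014.LeafSupport.mkN (KMSW2014.LeafSupport.cm l))) (canon₄₅ νtop) ∧
      Implications48 (canon₄₅ νtop) (canon₄₇ νtop) (canon₄₈ νtop) ∧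
      (canon₄₈ νtop).MoeglinElemHyp ∧ (canon₄₈ νtop).MoeglinElementary ∧ (canon₄₈ νtop).MoeglinHolomorphy ∧ (canon₄₈ νtop).MoeglinLdsConv ∧
      (canon₄₈ νtop).MoeglinComparaison :=
  have cmod := KMSW2014.LeafSupport.countermodel l
  ⟨⟨_, cmod.1⟩, cmod.2.1, cmod.2.2.1, fun _ => cmod.2.1 .MokMain (Ne.symm hl), canon_implications₄₅ _ _ _,
    canon_implications₄₈ _, fortyeighth_holds_top⟩

/-- ARTHUR'S ANNOUNCED RESULTS BEYOND THE BOOK'S CASE ARE LOAD-BEARING FOR THE WHOLE 2006–2010 SERIES AS TYPED.  At the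
all-ones assignment of the three DAGs (every leaf true; E41 and A8-p at their canonical values), the denied-remainder
readings satisfy EVERY edge of tranches 45, 47 and 48 while: B75's node, B75 as printed, its metaplectic statements, the
« Hypothèse générale », B71, B72, B70 and its node, B73, B74 and its node are FALSE; B75's quasi-split instance and
statements, E43, Arthur 2005 §30, E42, the instance `MoeglinHypGenSOU` are TRUE.  No edge of the register forces the
remainder: the series as printed (GSpin and non-quasi-split groups included) waits on it. [cite: Moeglin2011Mult1, §1 p0342:L22-29, §2 p0346:L26-28; Moeglin2009Comparaison, p0004:L2; Moeglin2006Elementary, p0001:L24-25; Moeglin2010Holomorphy, p0006:L18 (bookkeeping proved here)] -/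
theorem moeglinSeries_needs_node :
    ∃ c₄₃ : Consumers43, ∃ c₄₄ : Consumers44, ∃ c₄₅ : Consumers45, ∃ c₄₇ : Consumers47, ∃ c₄₈ : Consumers48,
      BookInputs νtop ∧ MokInputs μtop ∧ KMSWInputs μtop κtop ∧
      Implications45 νtop μtop κtop (canon₁₃ νtop κtop) (canon₁₄ νtop) c₄₃ c₄₄ c₄₅ ∧ Implications47 νtop c₄₅ c₄₇ ∧
      Implications48 c₄₅ c₄₇ c₄₈ ∧
      (¬ c₄₅.MoeglinDSHyp ∧ ¬ c₄₅.MoeglinMult1 ∧ ¬ c₄₅.MoeglinMp ∧ ¬ c₄₇.MoeglinHypGen ∧ ¬ c₄₇.MoeglinDiscretePackets ∧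
        ¬ c₄₇.MoeglinPacketsComb ∧ ¬ c₄₈.MoeglinElemHyp ∧ ¬ c₄₈.MoeglinElementary ∧ ¬ c₄₈.MoeglinHolomorphy ∧
        ¬ c₄₈.MoeglinLdsConv ∧ ¬ c₄₈.MoeglinComparaison) ∧
      (c₄₅.MoeglinDSHypQS ∧ c₄₅.MoeglinMult1qs ∧ c₄₅.MoeglinUnitaryDS ∧ c₄₇.ArthurClay30 ∧ c₄₇.MoeglinDS2007 ∧
        c₄₇.MoeglinHypGenSOU) :=
  have A := bookInputs_top
  have b : ∀ N, νtop.Everything N := A.everything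
  have P := A.published
  have u : (νtop.LLC_GLN ∧ νtop.FL ∧ νtop.Transfer ∧ νtop.InvariantTF ∧ νtop.TwistedTF) := ⟨P.llc, P.fl, P.transfer, P.itf, P.ttf⟩
  ⟨c₄₃noM νtop μtop κtop, c₄₄noM νtop μtop κtop, canon₄₅noR νtop, canon₄₇noR νtop, canon₄₈noR νtop, A, mokInputs_top,
    (kmswInputs_top μtop).1, canon_implications₄₅noR νtop μtop κtop, canon_implications₄₇noR νtop, canon_implications₄₈noR νtop,
    ⟨fun h => h.2, fun h => h.2, fun h => h.2, fun h => h.1.2, fun h => h.1.2, fun h => h.1.2, fun h => h.1.2, fun h => h.1.2,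
      fun h => h.1.2, fun h => h.1.2, fun h => h.1.2⟩,
    ⟨b, b, u, b, ⟨P.fl, P.transfer, b⟩, ⟨⟨b, trivial⟩, u⟩⟩⟩

end Support

end Downstream

end Literature.NumberTheory.Automorphic.Arthur2013
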